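import Summits.AtomisticToContinuum.BoseEinsteinCondensation.Theorems.GaussianDominationCan.Negative.CruxForms
import Literature.MathematicalPhysics.QuantumManyBody.LangevinGenerator
import Literature.Topology.FourManifolds.RadialStretch
import Literature.MathematicalPhysics.QuantumManyBody.HardCoreScatteringLength
import Literature.MathematicalPhysics.QuantumManyBody.PeriodicBoseGasUpperBoundProofs
import Summits.AtomisticToContinuum.BoseEinsteinCondensation.Theorems.BECThomsonPrincipleFibreFubini
import Literature.MathematicalPhysics.QuantumManyBody.JelliumBochnerFibre

/-!
# Disproof work file for crux `FibreConductance` (stmt-AtomisticToContinuum-9480) — cycle 3 (v7)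

Standing adversary on the crux of route `BECThomsonPrinciple` (`Theses/BECThomsonPrinciple.lean`,
`def FibreConductance`).  Everything below is `lean check`ed: rc 0, **0 sorry**, axioms
`propext / Classical.choice / Quot.sound`.  Prose only in docstrings.  Namespace
`Summit.AtomisticToContinuum.BoseEinsteinCondensation.Cruxes.FibreConductance.Disproof`.

## NEW in cycle 3 (v7, 2026-08-16) — §Infrared: INFRARED NECESSITY is now a theorem

The structural fact every seat on this crux has quoted informally since the ideation round
("Disproof §D ⇒ InfraredNecessity: the crux forces single-mode occupation bounds next to `−k`")
is kernel-checked (§Infrared at the end of this file; standalone chain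
`Theorems/FibreConductance/Negative/InfraredBridge → InfraredTestFunction → InfraredNecessity`,
proposals in flight), for an ARBITRARY zero-free `C¹` periodic `Φ` — no minimality, no potential:

* `infraredNecessity`: if `J` has weak divergence `q = L^{-3/2}(e_nψ − βψ²)` (the crux's charge) and
  cost `∫|J|²W/ψ² ≤ K`, then for EVERY lattice vector `e`
  `S_e := ∫_{cell^N}|A_e|²W dX ≤ K·L⁶·|k_e|²`, `k_e = 2πe/L`,
  `A_e(X̂) = ∫e_{n−e}ψ dy − β(X̂)∫e_{−e}ψ² dy` (`beatAmp`: `L^{3/2}`× the `e_{−e}(x₀)`-mode of `q` on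
  the fibre — the BEAT of the source wave against the landscape).  Proof = `norm_pairing_sq_le` with
  `η_e = e_{−e}(x₀)conj(A_e)W` (`irTest`; fibre gradient `−ik_eη_e` since `A_e, W` are fibre
  constants; pairing `L^{-9/2}S_e`, dual energy `L⁻³|k_e|²S_e`).  This is the Cauchy–Schwarz OPTIMUM
  over bath factors `h(X̂)` at fixed fibre momentum, so nothing sharper follows from single-mode tests.
* `infraredNecessity_occupation`: `n_{e−n}(|Φ|) ≤ 2n_{−n}(|Φ|) + 2NK|k_e|²` (occupations of the
  plane waves in `X ↦ |Φ X|`; `∫_{cell^N}W|∫e_pψ|² = L⁶n_{−p}(|Φ|)/N` by the lead's fibre Fubini,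
  `|∫e_{−e}ψ²| ≤ 1`).  The honest form bounds `n_{p′}` RELATIVE to `n_{−n}` (drefute's remark made
  exact: the `β`-term is not droppable, it costs the summand `2n_{−n}` and a factor `2`).
* `fibreBoundAt_occupation`: with the crux's `K = CL²/‖n‖²` the bound is SCALE-FREE,
  `n_{e−n}(|Φ|) ≤ 2n_{−n}(|Φ|) + 8π²C N |e|₂²/‖n‖²`; `fibreConductance_infrared :
  FibreConductance → InfraredBound` (the crux's thermodynamic-limit content isolated as a `Prop`
  about exact ground states in the crux's own window).  CONTRAPOSITIVE = the template for any kill at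
  `v ≠ 0`: exhibit a bounded admissible `v` whose exact ground states put, on a lattice neighbour of
  the source mode `−n`, more than `2n_{−n} + 8π²CN/‖n‖²` particles for every `C`.
* Calibration: at `v = 0` (constant state, `e = n`, `n_0 = N`, `n_{−n} = 0`) it reads
  `C ≥ ‖n‖²/(8π²|n|₂²)` — the free floor of §Tight up to the factor `2` of the triangle inequality.
  At density `ρ` and the window top (`‖n‖ ≈ M√ρL/2π`) it allows `≈ 32π⁴C|e|²L/M²` particles per
  neighbouring mode against Bogoliubov's `≈ √(πa)/M`: room `≍ L`, so NO Bogoliubov-like ground state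
  violates it — consistent with the standing assessment that a kill needs an anomalously occupied
  mode ADJACENT to the source, i.e. exact-ground-state control no method in print has.

Other cycle-3 notes (paper, not Lean): (a) (H2) `Φ` zero-free is IMPLIED by (H1) for bounded `v`
(`E(|Φ|) ≤ E(Φ)` makes `|Φ|` a minimiser, hence a weak solution of `(−Δ + V − E₀)|Φ| = 0` with
`V ∈ L^∞`, and the strong minimum principle for `−Δu + cu ≥ 0`, `u ≥ 0`, `c = ‖V − E₀‖_∞` gives
`|Φ| > 0`) — provers may treat (H2) as free, refuters cannot exploit it; (b) the "every-`κ`" kinetic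
slack `δ = κN/L²` of cycle 2's attack surface (iii) is out of reach of PRODUCT states (1-D
Cauchy–Schwarz: a profile equal to `σ` on a barrier of width `w_b ≤ L` and to `1` on a chamber has
`∫|g′|² ≥ (1−σ)²/w_b` while `Z = ∫g² ≤ L`, so the excess energy per particle is
`≥ (1−σ)²/(w_b L) ≥ (1−σ)²/L²`: `κ ≥ (1−σ)²`, bounded below as `σ → 0`), so cycle 2's witness
already realises the product-state mechanism up to constants (`κ₀ = 1024π²K²`) and "every `κ`" needs
correlated rare-bath superpositions `√(1−p)·1 + √p·(slab state)` (cost `≍ p/σ²` vs slack `≍ p`) —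
true on paper, not formalised (low marginal value over `not_fibreConductanceNearMinimiser`);
(c) cage arithmetic behind "no kill for bounded `v`": a cage of radius `r`, wall `R₀`, transmission
`τ` in ONE bath adds `≈ r⁴R₀/(L³τ²)` to the pointwise resistance `1/k²`; bath-averaging over
`≈ ρ_cage L³` cage sites gives the RELATIVE excess `ρ_cage r⁴R₀k²/τ²`, `L`-independent and maximal
at the window top `k = M√ρ`; with `ρ_cage ≲ ρ(ρR₀³)^{n_c−1}` against `τ^{-2} ≲ e^{2cn_layers}`,
`n_c ≍ n_layers(r/R₀)²`, the cage sum converges for `ρ₀(v)` small — so neither pointwise-rare cages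
nor their average threaten the crux for bounded `v`; the pointwise-in-bath strengthening
(`sup_X̂`) IS false in the thermodynamic limit (cages of `≍ log L` layers exist as configurations)
but proving it needs Agmon-type control of the exact `Ψ₀` on atypical baths: not attempted.

## Findings (index)

* **§Vocabulary** (`fibreW`, `fibrePsi`, `wave`, `fibreBeta`, `fibreCharge`, `IsFibreFlow`,
  `fibreCost`, `FibreBoundAt`, `FibreConductanceWith`): the crux verbatim is
  `∀ v bounded admissible, ∀ M > 0, ∃ ρ₀ C N₀, FibreConductanceWith ρ₀ C N₀ v M`
  (`fibreConductance_iff`, by `Iff.rfl`).  `W/ψ²` is the per-fibre normalisation of the Thomson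
  energy; `‖n‖` is the SUP norm (harmless); `wave = cellWave` (`wave_eq_cellWave`).
* **§Duality — the calibration tool every line must respect** (`norm_pairing_sq_le`): if `J` is a
  fibre flow with weak divergence `q`, then for EVERY `C¹` periodic test function `η` and every
  positive measurable weight `w`,  `‖∫ q η‖² ≤ (∫|J|² w) · (∫ Σₗ|∂_{0,l}η|² / w)`.  Junk-proof (a
  non-integrable pairing has Bochner integral `0`; no measurability of `J` is needed).  With
  `w = W/ψ²` the first factor is the crux's cost, so EVERY lower bound on the fibre resistance is an
  instance: `cost ≥ sup_η ‖∫qη‖² / ∫|∇₀η|²ψ²/W`.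
* **§ProductFibre** (`fibreW_realProd`, `fibrePsi_realProd`, `fibreBeta_realProd`,
  `fibreCharge_realProd`, `fibreCost_realProd`): for a real positive product state `Φ = φ^{⊗N}`
  with `∫φ² = 1`:  `W = ∏_{j≠0}φ(xⱼ)²`, `ψ = φ(x₀)` EXACTLY (the conditional amplitude of a product
  state is the factor), `β ≡ β₀ = ∫ e_n φ`, `q = L^{-3/2}(e_n(x₀)φ(x₀) - β₀φ(x₀)²)`.
* **§Tight (tightness / boundary lemma)** `fibreConductanceWith_zero_const_ge`: if the crux's
  conclusion holds at `v = 0` with constant `C` (some `ρ₀ > 0`, `N₀`, `M > 0`) then `C ≥ 1/4π²`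
  (constant state, `q = L^{-3}e_n(x₀)`, test `η = e_{-n}(x₀)`: cost `≥ L²/(4π²|n|₂²)`); hence
  `not_fibreConductanceSharp` (no universal `c < 1/4π²`).  The free value is the FLOOR; `v` can
  only push `C` up.
* **LANDED in the tree** (importable; namespace `…Theorems.FibreConductance.Negative`, directory
  `Theorems/FibreConductance/Negative/`): `Profiles.lean` (p73761), `OneDimAxis.lean` (p74200),
  `FibreVocabulary.lean` (p73774: the crux's `W/ψ/β/q`, `IsFibreFlow`, `fibreCost`, product-state
  fibre data, the duality tool `norm_pairing_sq_le`), `SlabState.lean` (p74796), `TestFunction.lean`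
  (p74920), **`NearMinimiserFalse.lean` (p75366: `fibreConductance_iff`,
  `not_fibreConductanceNearMinimiser`, `not_fibreConductanceWithoutMinimiser`)**, `FreeFloor.lean`
  (p75503: `fibreConductanceWith_zero_const_ge`, `not_fibreConductanceSharp`), `HardCoreVacuity.lean`
  (p74346); `FreeConstantFlow.lean` (p76674: `fibreBoundAt_constState`, complex IBP on the `N`-torus).  ALL NINE FILES ACCEPTED.
  This work file = the union of those files in the `Cruxes…Disproof` namespace.
* **§MAIN NEGATIVE RESULT (new in cycle 2): (H1) is load-bearing in the strongest sense.**
  `not_fibreConductanceNearMinimiser : ¬ FibreConductanceNearMinimiser` — the crux with the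
  exact-minimiser hypothesis `periodicEnergy v Φ = E₀` relaxed to `periodicEnergy v Φ ≤ E₀ + δ` is
  FALSE for EVERY slack `δ > 0`, even when `δ` is chosen by the claimant after `v` and `M` together
  with `ρ₀, C, N₀`.  Witness: `v = 0`; the ultra-dilute corner `L = M²N/4π²`, `n = e₀` of the
  window (`corner`, from `Theorems/GaussianDominationCan/Negative/CruxForms`); the TWO-SLAB PRODUCT
  STATE `slabState` = `(g(y₀)/√Z)^{⊗N}` with `g = σ` on the barriers `{|sin(2πy₀/L)| ≤ 1/2}` and
  `g = 1` on the chambers (`slabProfile`, built from `Real.smoothTransition ∘ cos`):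
  - it is admissible, zero-free, and `δ`-near-minimal for `N` large: excess kinetic energy
    `≤ N · 1024π²K²/L² = 16384π⁶K²/(M⁴N) → 0` (`periodicEnergy_slabState_le`; `K` = a global bound
    on `|smoothTransition'|`, `exists_bound_deriv_smoothTransition`), `E₀(v=0) = 0`
    (`periodicGroundStateEnergy_zero`);
  - `β₀ = 0` because `g` is `L/2`-periodic and `e₀` is an odd harmonic
    (`integral_wave_mul_slabFactor`, `intervalIntegral_exp_ang_mul_eq_zero`), so
    `q = L^{-3/2} e₀(x₀) φ(x₀)` (`fibreCharge_slabState`);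
  - duality with `η = f(x₀₀) ∏_{j≠0} φ(xⱼ)²`, `f = sT(2 sin θ + 1/2)` the chamber selector, which
    varies ONLY where `g = σ` (`deriv_testProfile_sq_mul_slabProfile_sq_le`): dual energy
    `≤ 64π²K²σ²/L²` (`lintegral_dual_le`), pairing `‖∫qη‖ ≥ 1/16` (`norm_pairing_ge`: the chamber
    charge `∫ sin θ g f ≥ L/16` cannot be neutralised without crossing a barrier);
  - hence every admissible flow costs `≥ L²/(16384π²K²σ²)`, which beats `C·L²` once
    `σ < 1/(128πK√C)`: contradiction.
  **Corollary** `not_fibreConductanceWithoutMinimiser` ((H1) dropped; cycle-1 §G2 re-derived as a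
  one-liner).  **Reading for provers/planners**: the fibre bound is a property of the EXACT ground
  state alone — it is not stable under ANY `N`-uniform energy slack (the slab defect costs `O(ρL)`
  per box, invisible at the dilute corner), so no argument of the form "near-minimisers have good
  landscapes" can prove the crux; (H1) must enter through the Euler–Lagrange equation / Harnack
  comparability of `Ψ₀`, exactly as the surviving cards (healing-split, tagged-path-harnack,
  conditional-law-poincare) propose.  Downstream (GDCan for ALL `Φ`; GDTransfer's `δ`-near
  minimisers) may use FibreConductance only AT `Ψ₀`.

## Cycle-1 findings (v5, 2026-08-15T23:09Z; file on the gate host, NOT mounted on the hub — known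
## through its evidence notes) and their status here

* §E `not_fibreConductanceSharp` (no universal `c < 1/4π²`): RE-DERIVED in v6.1 (§Tight below:
  `fibreConductanceWith_zero_const_ge` — ANY constant valid at `v = 0` is `≥ 1/4π²` — and
  `not_fibreConductanceSharp`, as the instance `η = e_{-n}(x₀)`, `w = W/ψ²` of `norm_pairing_sq_le`
  at the constant state).
* §F hard cores self-vacuate the crux: RE-DERIVED in v6.2 (§HardCore below, with the Literature
  `hardCorePotential 1`: `periodicEnergy_hardCore_eq_top` — a zero-free state has infinite
  hard-core energy, `N ≥ 2`; `hardCore_hypotheses_unsatisfiable` — (H1) ∧ (H2) need `E₀ = ⊤`;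
  `hardCore_no_admissible_state` — impossible in the whole LSSY dilute regime by the PROVED fact
  `LSSY2005_upperBound_periodic_holds` with `a = 1`).  Boundedness is NOT the load-bearing
  hypothesis; LANDED as `Theorems/FibreConductance/Negative/HardCoreVacuity.lean` (p74346).
* §G1 the crux HOLDS at `v = 0` for the CONSTANT state with `C = 1/4π²`: RE-DERIVED in v6.3
  (§CanonicalFlow below: complex IBP on the `N`-torus `integral_cellN_fderiv_eq_zero`,
  `integral_cellWave_mul_fderiv`, the potential flow `canonicalFlow = -i(k_l/|k|²)L⁻³e_n(x₀)` with
  `isFibreFlow_canonicalFlow` and cost EXACTLY `L²/(4π²|n|₂²)` ⇒ `fibreBoundAt_constState`); with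
  §Tight the free value `1/4π²` is PINNED (attained and optimal).  §G3 ("free exact minimisers are
  constants" ⇒ the crux holds at `v = 0` for EVERY admissible `Φ`) is NOT re-derived (it needs the
  a.e.-vanishing-gradient ⇒ constant argument; low adversarial value).
* §G2 `not_fibreConductanceWithoutMinimiser`: RE-DERIVED and STRENGTHENED (above).

## Why the crux itself resists (standing assessment, numbers not adjectives)

* Physics: for bounded `v` the Gaussian (beat-sum) correction to the free resistance `1/k²` is
  `O((ρa³)^{1/2})/k²` (charge fluctuation spectrum `a²ŵ(P)²N S(P)`, `Σ_P |P+k|^{-2}` summable in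
  `d = 3`); cages of bounded height `B` cost a factor `e^{2√B R₀}` per crossed layer against a
  probability `(ρR₀³)^{n}` per shell of `n` particles, so the cage series converges for
  `ρ₀(v)` small and gives an `L`-, `N`-INDEPENDENT constant `C(v)`: no kill expected from cages for
  bounded `v` (hard cores are vacuous, cycle 1 §F).  A refutation of the crux at an admissible
  bounded `v` would need control of the EXACT interacting ground state in the thermodynamic limit.
* Structure: `J` is forced a.e.-measurable on `cellN` by the pairing identity tested on
  `η = e^{ip·x₀}`; `W/ψ² = W²/|Φ|²` is bounded above and below for zero-free `C¹` periodic `Φ`, so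
  no junk flow and no junk cost; `n ≠ 0`, `0 < L`, `0 < M` are decoration as for GDCan.
* Attack surface left: (i) §G3 of cycle 1 (every free exact minimiser is constant); (ii) strengthening
  "pointwise-in-bath resistance `sup_X̂ R(X̂) ≤ C/k²`" (expected false by cages even at the exact
  ground state — needs a two-body exact minimiser, `N = 2`, where `Ψ₀` is the periodic zero-energy
  pair function: a computable target); (iii) the near-minimiser refutation with slack
  `δ_N = κ N/L²` for every `κ` (superposition states with rare bad baths; cycle 3 (b): product
  states cannot do it); (iv) NEW (cycle 3): `¬InfraredBound` for some bounded admissible `v` — by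
  `fibreConductance_infrared` this alone kills the crux; it asks for an exact ground state with an
  anomalously occupied mode adjacent to the source mode (`> 2n_{−n} + 8π²CN/‖n‖²` for every `C`).
-/

noncomputable section

namespace Summit.AtomisticToContinuum.BoseEinsteinCondensation.Cruxes.FibreConductance.Disproof

open MeasureTheory
open scoped ENNReal NNReal

/-! ### The smooth step (vanishing of `sT'` off `[0,1]` is reused from
`Literature.Topology.FourManifolds.RadialStretch`) -/

section SmoothStep

open Real

/-- The smooth step is `C¹`. [folklore] -/
theorem contDiff_one_smoothTransition : ContDiff ℝ 1 smoothTransition :=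
  smoothTransition.contDiff (n := 1)

/-- The smooth step is differentiable. [folklore] -/
theorem differentiable_smoothTransition : Differentiable ℝ smoothTransition :=
  contDiff_one_smoothTransition.differentiable one_ne_zero

/-- If the derivative of the smooth step does not vanish at `x` then `x ∈ [0, 1]`. [folklore] -/
theorem mem_Icc_of_deriv_smoothTransition_ne_zero {x : ℝ} (hx : deriv smoothTransition x ≠ 0) :
    x ∈ Set.Icc (0 : ℝ) 1 := by
  by_contra h
  rw [Set.mem_Icc, not_and_or, not_le, not_le] at h
  rcases h with h | h
  · exact hx (Literature.Topology.FourManifolds.deriv_smoothTransition_of_neg h)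
  · exact hx (Literature.Topology.FourManifolds.deriv_smoothTransition_of_one_lt h)

/-- **A global bound on the slope of the smooth step**: `|sT'| ≤ K` (continuity of `sT'` on the
compact `[0,1]`, and `sT' = 0` off it). [folklore] -/
theorem exists_bound_deriv_smoothTransition :
    ∃ K : ℝ, 1 ≤ K ∧ ∀ x, |deriv smoothTransition x| ≤ K := by
  have hc : Continuous (deriv smoothTransition) := contDiff_one_smoothTransition.continuous_deriv_one
  obtain ⟨C, hC⟩ := isCompact_Icc.exists_bound_of_continuousOn (s := Set.Icc (0 : ℝ) 1) hc.continuousOn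
  refine ⟨max C 1, le_max_right _ _, fun x => ?_⟩
  by_cases hx : deriv smoothTransition x = 0
  · rw [hx, abs_zero]; positivity
  · exact ((Real.norm_eq_abs _).symm.le.trans (hC x (mem_Icc_of_deriv_smoothTransition_ne_zero hx))).trans
      (le_max_left _ _)

end SmoothStep

/-! ### The one-dimensional profiles -/

section Profile

open Real

variable {L σ : ℝ}

/-- The angle `θ(t) = 2πt/L`. [folklore] -/
def ang (L t : ℝ) : ℝ := 2 * π * t / L

/-- The barrier indicator `b = sT(2 cos 2θ)`: `1` where `|sin θ| ≤ 1/2`, `0` where `cos 2θ ≤ 0`. [folklore] -/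
def barrier (L t : ℝ) : ℝ := smoothTransition (2 * cos (2 * ang L t))

/-- The two-slab profile `g = 1 - (1-σ) b`: equal to `σ` on the two barriers around `t = 0, L/2`
and to `1` on the two chambers around `t = L/4, 3L/4`. [folklore] -/
def slabProfile (L σ t : ℝ) : ℝ := 1 - (1 - σ) * barrier L t

/-- The chamber selector `f = sT(2 sin θ + 1/2)`: `1` on the chamber around `L/4`, `0` on the
chamber around `3L/4`, varying only inside the barriers. [folklore] -/
def testProfile (L t : ℝ) : ℝ := smoothTransition (2 * sin (ang L t) + 1 / 2)

/-- `0 ≤ b`. [folklore] -/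
theorem barrier_nonneg (L t : ℝ) : 0 ≤ barrier L t := smoothTransition.nonneg _
/-- `b ≤ 1`. [folklore] -/
theorem barrier_le_one (L t : ℝ) : barrier L t ≤ 1 := smoothTransition.le_one _

/-- `cos 2θ = 1 - 2 sin² θ`. [folklore] -/
theorem cos_two_mul_eq_one_sub (x : ℝ) : cos (2 * x) = 1 - 2 * sin x ^ 2 := by
  rw [cos_two_mul, cos_sq']; ring

/-- On `{|sin θ| ≤ 1/2}` the barrier indicator is `1`. [folklore] -/
theorem barrier_eq_one {L t : ℝ} (h : |sin (ang L t)| ≤ 1 / 2) : barrier L t = 1 := by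
  unfold barrier
  apply smoothTransition.one_of_one_le
  rw [cos_two_mul_eq_one_sub]
  have h2 : sin (ang L t) ^ 2 ≤ 1 / 4 := by
    have := (sq_le_sq' (by linarith [abs_le.mp h |>.1]) (abs_le.mp h).2)
    nlinarith [abs_nonneg (sin (ang L t)), sq_abs (sin (ang L t))]
  linarith

/-- `σ ≤ g ≤ 1` for `σ ∈ [0,1]`. [folklore] -/
theorem slabProfile_mem (hσ1 : σ ≤ 1) (L t : ℝ) :
    σ ≤ slabProfile L σ t ∧ slabProfile L σ t ≤ 1 := by
  unfold slabProfile
  have h0 := barrier_nonneg L t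
  have h1 := barrier_le_one L t
  constructor <;> nlinarith

/-- `g > 0` for `σ ∈ (0, 1]`. [folklore] -/
theorem slabProfile_pos (hσ0 : 0 < σ) (hσ1 : σ ≤ 1) (L t : ℝ) : 0 < slabProfile L σ t :=
  hσ0.trans_le (slabProfile_mem hσ1 L t).1

/-- On the barriers `{|sin θ| ≤ 1/2}` the profile equals `σ`. [folklore] -/
theorem slabProfile_eq_of_abs_sin_le {L t : ℝ} (h : |sin (ang L t)| ≤ 1 / 2) :
    slabProfile L σ t = σ := by
  unfold slabProfile; rw [barrier_eq_one h]; ring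

/-- On the chamber `[L/8, 3L/8]` the profile equals `1`. [folklore] -/
theorem slabProfile_eq_one (hL : 0 < L) {t : ℝ} (ht : t ∈ Set.Icc (L / 8) (3 * L / 8)) :
    slabProfile L σ t = 1 := by
  unfold slabProfile barrier
  have hcos : cos (2 * ang L t) ≤ 0 := by
    apply cos_nonpos_of_pi_div_two_le_of_le
    · unfold ang
      rw [show π / 2 = 2 * (2 * π * (L / 8) / L) by field_simp; ring]
      gcongr
      exact ht.1
    · unfold ang
      rw [show π + π / 2 = 2 * (2 * π * (3 * L / 8) / L) by field_simp; ring]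
      gcongr
      exact ht.2
  rw [smoothTransition.zero_of_nonpos (by linarith)]
  ring

/-- `g` is `L/2`-periodic (hence `L`-periodic). [folklore] -/
theorem slabProfile_add_half (hL : L ≠ 0) (σ t : ℝ) :
    slabProfile L σ (t + L / 2) = slabProfile L σ t := by
  unfold slabProfile barrier ang
  have : 2 * (2 * π * (t + L / 2) / L) = 2 * (2 * π * t / L) + 2 * π := by field_simp
  rw [this, cos_add_two_pi]

/-- `g` is `L`-periodic. [folklore] -/
theorem slabProfile_add_period (hL : L ≠ 0) (σ t : ℝ) :
    slabProfile L σ (t + L) = slabProfile L σ t := by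
  have h := slabProfile_add_half hL σ (t + L / 2)
  rw [show t + L / 2 + L / 2 = t + L by ring] at h
  rw [h, slabProfile_add_half hL]

/-- `0 ≤ f ≤ 1`. [folklore] -/
theorem testProfile_mem (L t : ℝ) : 0 ≤ testProfile L t ∧ testProfile L t ≤ 1 :=
  ⟨smoothTransition.nonneg _, smoothTransition.le_one _⟩

/-- `f = 1` where `sin θ ≥ 1/4`. [folklore] -/
theorem testProfile_eq_one {L t : ℝ} (h : 1 / 4 ≤ sin (ang L t)) : testProfile L t = 1 :=
  smoothTransition.one_of_one_le (by linarith)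

/-- `f = 0` where `sin θ ≤ -1/4`. [folklore] -/
theorem testProfile_eq_zero {L t : ℝ} (h : sin (ang L t) ≤ -(1 / 4)) : testProfile L t = 0 :=
  smoothTransition.zero_of_nonpos (by linarith)

/-- `f` is `L`-periodic. [folklore] -/
theorem testProfile_add_period (hL : L ≠ 0) (t : ℝ) :
    testProfile L (t + L) = testProfile L t := by
  unfold testProfile ang
  have : 2 * π * (t + L) / L = 2 * π * t / L + 2 * π := by field_simp
  rw [this, sin_add_two_pi]

/-! #### Derivatives -/

/-- `θ'(t) = 2π/L`. [folklore] -/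
theorem hasDerivAt_ang (L t : ℝ) : HasDerivAt (ang L) (2 * π / L) t := by
  unfold ang
  have := ((hasDerivAt_id t).const_mul (2 * π)).div_const L
  simpa using this

/-- Chain rule for `b = sT(2 cos 2θ)`. [folklore] -/
theorem hasDerivAt_barrier (L t : ℝ) :
    HasDerivAt (barrier L)
      (deriv smoothTransition (2 * cos (2 * ang L t)) *
        (2 * (-sin (2 * ang L t) * (2 * (2 * π / L))))) t := by
  unfold barrier
  have h1 : HasDerivAt (fun t => 2 * ang L t) (2 * (2 * π / L)) t := (hasDerivAt_ang L t).const_mul 2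
  have h2 : HasDerivAt (fun t => cos (2 * ang L t)) (-sin (2 * ang L t) * (2 * (2 * π / L))) t :=
    (hasDerivAt_cos _).comp t h1
  have h3 : HasDerivAt (fun t => 2 * cos (2 * ang L t)) (2 * (-sin (2 * ang L t) * (2 * (2 * π / L)))) t :=
    h2.const_mul 2
  exact (differentiable_smoothTransition _).hasDerivAt.comp t h3

/-- Chain rule for `g = 1 - (1-σ) b`. [folklore] -/
theorem hasDerivAt_slabProfile (L σ t : ℝ) :
    HasDerivAt (slabProfile L σ)
      (-((1 - σ) * (deriv smoothTransition (2 * cos (2 * ang L t)) *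
        (2 * (-sin (2 * ang L t) * (2 * (2 * π / L))))))) t := by
  unfold slabProfile
  have h := ((hasDerivAt_barrier L t).const_mul (1 - σ)).const_sub 1
  simpa using h

/-- Chain rule for `f = sT(2 sin θ + 1/2)`. [folklore] -/
theorem hasDerivAt_testProfile (L t : ℝ) :
    HasDerivAt (testProfile L)
      (deriv smoothTransition (2 * sin (ang L t) + 1 / 2) * (2 * (cos (ang L t) * (2 * π / L)))) t := by
  unfold testProfile
  have h1 : HasDerivAt (fun t => sin (ang L t)) (cos (ang L t) * (2 * π / L)) t :=
    (hasDerivAt_sin _).comp t (hasDerivAt_ang L t)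
  have h2 : HasDerivAt (fun t => 2 * sin (ang L t) + 1 / 2) (2 * (cos (ang L t) * (2 * π / L))) t :=
    (h1.const_mul 2).add_const _
  exact (differentiable_smoothTransition _).hasDerivAt.comp t h2

/-- `θ` is `C¹`. [folklore] -/
theorem contDiff_ang (L : ℝ) : ContDiff ℝ 1 (ang L) := by
  unfold ang; fun_prop

/-- `g` is `C¹`. [folklore] -/
theorem contDiff_slabProfile (L σ : ℝ) : ContDiff ℝ 1 (slabProfile L σ) := by
  unfold slabProfile barrier
  have h : ContDiff ℝ 1 (fun t => 2 * cos (2 * ang L t)) := by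
    have := contDiff_ang L
    fun_prop
  exact contDiff_const.sub (contDiff_const.mul (contDiff_one_smoothTransition.comp h))

/-- `f` is `C¹`. [folklore] -/
theorem contDiff_testProfile (L : ℝ) : ContDiff ℝ 1 (testProfile L) := by
  unfold testProfile
  have h : ContDiff ℝ 1 (fun t => 2 * sin (ang L t) + 1 / 2) := by
    have := contDiff_ang L
    fun_prop
  exact contDiff_one_smoothTransition.comp h

/-- **Slope of the profile**: `|g'| ≤ 16πK/L`. [folklore] -/
theorem abs_deriv_slabProfile_le (hL : 0 < L) (hσ0 : 0 ≤ σ) (hσ1 : σ ≤ 1) {K : ℝ}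
    (hK : ∀ x, |deriv smoothTransition x| ≤ K) (t : ℝ) :
    |deriv (slabProfile L σ) t| ≤ 16 * π * K / L := by
  rw [(hasDerivAt_slabProfile L σ t).deriv, abs_neg, abs_mul, abs_mul]
  have h1 : |1 - σ| ≤ 1 := by rw [abs_of_nonneg (by linarith)]; linarith
  have h2 := hK (2 * cos (2 * ang L t))
  have h3 : |2 * (-sin (2 * ang L t) * (2 * (2 * π / L)))| ≤ 8 * π / L := by
    rw [abs_mul, abs_mul, abs_neg, abs_of_pos (by positivity : (0:ℝ) < 2),
      abs_of_pos (by positivity : (0:ℝ) < 2 * (2 * π / L))]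
    have := abs_sin_le_one (2 * ang L t)
    calc 2 * (|sin (2 * ang L t)| * (2 * (2 * π / L))) ≤ 2 * (1 * (2 * (2 * π / L))) := by gcongr
      _ = 8 * π / L := by ring
  have hK0 : 0 ≤ K := (abs_nonneg _).trans (hK 0)
  calc |1 - σ| * (|deriv smoothTransition (2 * cos (2 * ang L t))| *
        |2 * (-sin (2 * ang L t) * (2 * (2 * π / L)))|)
      ≤ 1 * (K * (8 * π / L)) := by gcongr
    _ = 16 * π * K / L / 2 := by ring
    _ ≤ 16 * π * K / L := by
        have : 0 ≤ 16 * π * K / L := by positivity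
        linarith

/-- **Slope of the selector**: `|f'| ≤ 4πK/L`. [folklore] -/
theorem abs_deriv_testProfile_le (hL : 0 < L) {K : ℝ} (hK : ∀ x, |deriv smoothTransition x| ≤ K)
    (t : ℝ) : |deriv (testProfile L) t| ≤ 4 * π * K / L := by
  rw [(hasDerivAt_testProfile L t).deriv, abs_mul]
  have h2 := hK (2 * sin (ang L t) + 1 / 2)
  have h3 : |2 * (cos (ang L t) * (2 * π / L))| ≤ 4 * π / L := by
    rw [abs_mul, abs_mul, abs_of_pos (by positivity : (0:ℝ) < 2),
      abs_of_pos (by positivity : (0:ℝ) < 2 * π / L)]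
    have := abs_cos_le_one (ang L t)
    calc 2 * (|cos (ang L t)| * (2 * π / L)) ≤ 2 * (1 * (2 * π / L)) := by gcongr
      _ = 4 * π / L := by ring
  have hK0 : 0 ≤ K := (abs_nonneg _).trans (hK 0)
  calc |deriv smoothTransition (2 * sin (ang L t) + 1 / 2)| * |2 * (cos (ang L t) * (2 * π / L))|
      ≤ K * (4 * π / L) := by gcongr
    _ = 4 * π * K / L := by ring

/-- **The selector varies only inside the barriers**: if `f'(t) ≠ 0` then `|sin θ(t)| ≤ 1/4`. [folklore] -/
theorem abs_sin_le_of_deriv_testProfile_ne_zero {L t : ℝ} (h : deriv (testProfile L) t ≠ 0) :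
    |sin (ang L t)| ≤ 1 / 4 := by
  rw [(hasDerivAt_testProfile L t).deriv] at h
  have h1 : deriv smoothTransition (2 * sin (ang L t) + 1 / 2) ≠ 0 := fun h0 => h (by rw [h0, zero_mul])
  have h2 := mem_Icc_of_deriv_smoothTransition_ne_zero h1
  rw [abs_le]
  constructor <;> linarith [h2.1, h2.2]

/-- **Key pointwise bound**: `f'(t)² g(t)² ≤ (4πK/L)² σ²` everywhere. [folklore] -/
theorem deriv_testProfile_sq_mul_slabProfile_sq_le (hL : 0 < L)
    {K : ℝ} (hK : ∀ x, |deriv smoothTransition x| ≤ K) (t : ℝ) :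
    deriv (testProfile L) t ^ 2 * slabProfile L σ t ^ 2 ≤ (4 * π * K / L) ^ 2 * σ ^ 2 := by
  by_cases h : deriv (testProfile L) t = 0
  · rw [h]; simp only [ne_eq, OfNat.ofNat_ne_zero, not_false_eq_true, zero_pow, zero_mul]; positivity
  · have hs := abs_sin_le_of_deriv_testProfile_ne_zero h
    rw [slabProfile_eq_of_abs_sin_le (σ := σ) (hs.trans (by norm_num))]
    have h1 := abs_deriv_testProfile_le hL hK t
    have h2 : deriv (testProfile L) t ^ 2 ≤ (4 * π * K / L) ^ 2 := by
      rw [← sq_abs]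
      exact pow_le_pow_left₀ (abs_nonneg _) h1 2
    exact mul_le_mul_of_nonneg_right h2 (sq_nonneg _)

end Profile


open Literature.MathematicalPhysics.QuantumManyBody.BoseGas hiding e0 prodFun

/-! ### One-dimensional integrals -/

section OneDim

open Real intervalIntegral

variable {L σ : ℝ}

/-- A continuous function that flips sign under the half-period shift integrates to zero over a
period. [folklore] -/
theorem intervalIntegral_eq_zero_of_antiperiodic {F : ℝ → ℂ} (hF : Continuous F)
    (h : ∀ t, F (t + L / 2) = -F t) : ∫ t in (0 : ℝ)..L, F t = 0 := by
  have hi : ∀ a b : ℝ, IntervalIntegrable F volume a b := fun a b => hF.intervalIntegrable a b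
  rw [← integral_add_adjacent_intervals (hi 0 (L / 2)) (hi (L / 2) L)]
  have h2 : ∫ t in (L / 2)..L, F t = -∫ t in (0 : ℝ)..(L / 2), F t := by
    have := integral_comp_add_right (a := 0) (b := L / 2) F (L / 2)
    rw [zero_add, show L / 2 + L / 2 = L by ring] at this
    rw [← this]
    simp_rw [h]
    exact integral_neg
  rw [h2, add_neg_cancel]

/-- `e^{iθ(t + L/2)} = -e^{iθ(t)}`. [folklore] -/
theorem exp_ang_add_half (hL : L ≠ 0) (t : ℝ) :
    Complex.exp (Complex.I * (ang L (t + L / 2) : ℝ)) = -Complex.exp (Complex.I * (ang L t : ℝ)) := by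
  have : ang L (t + L / 2) = ang L t + π := by unfold ang; field_simp
  rw [this, ← Complex.exp_add_pi_mul_I]
  congr 1
  push_cast
  ring

/-- **Odd harmonics of an `L/2`-periodic function vanish**: `∫₀ᴸ e^{2πit/L} G(t) dt = 0` when
`G(t + L/2) = G(t)`. [folklore] -/
theorem intervalIntegral_exp_ang_mul_eq_zero {G : ℝ → ℂ} (hG : Continuous G) (hL : 0 < L)
    (h : ∀ t, G (t + L / 2) = G t) :
    ∫ t in (0 : ℝ)..L, Complex.exp (Complex.I * (ang L t : ℝ)) * G t = 0 := by
  have hc : Continuous (ang L) := (contDiff_ang L).continuous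
  refine intervalIntegral_eq_zero_of_antiperiodic (by fun_prop) (fun t => ?_)
  rw [exp_ang_add_half hL.ne', h, neg_mul]

/-- On the chamber `[L/8, 3L/8]`: `sin θ ≥ 1/2`. [folklore] -/
theorem half_le_sin_ang (hL : 0 < L) {t : ℝ} (ht : t ∈ Set.Icc (L / 8) (3 * L / 8)) :
    1 / 2 ≤ sin (ang L t) := by
  have hθ1 : π / 4 ≤ ang L t := by
    unfold ang; rw [show π / 4 = 2 * π * (L / 8) / L by field_simp; ring]; gcongr; exact ht.1
  have hθ2 : ang L t ≤ 3 * π / 4 := by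
    unfold ang; rw [show 3 * π / 4 = 2 * π * (3 * L / 8) / L by field_simp; ring]; gcongr; exact ht.2
  by_cases hc : ang L t ≤ π / 2
  · calc (1 : ℝ) / 2 = 2 / π * (π / 4) := by field_simp; ring
      _ ≤ 2 / π * ang L t := by gcongr
      _ ≤ sin (ang L t) := mul_le_sin (by linarith [pi_pos]) hc
  · push Not at hc
    rw [← sin_pi_sub]
    calc (1 : ℝ) / 2 = 2 / π * (π / 4) := by field_simp; ring
      _ ≤ 2 / π * (π - ang L t) := by gcongr; linarith
      _ ≤ sin (π - ang L t) := mul_le_sin (by linarith) (by linarith)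

/-- The integrand `sin θ · g · f` is bounded below by `-σ/4` everywhere. [folklore] -/
theorem sin_mul_profiles_ge (hσ0 : 0 ≤ σ) (hσ1 : σ ≤ 1) (L t : ℝ) :
    -(σ / 4) ≤ sin (ang L t) * slabProfile L σ t * testProfile L t := by
  have hg := slabProfile_mem hσ1 L t
  have hf := testProfile_mem L t
  by_cases hs : 0 ≤ sin (ang L t)
  · have : 0 ≤ sin (ang L t) * slabProfile L σ t * testProfile L t :=
      mul_nonneg (mul_nonneg hs (hσ0.trans hg.1)) hf.1
    linarith
  · push Not at hs
    by_cases hs2 : sin (ang L t) ≤ -(1 / 4)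
    · rw [testProfile_eq_zero hs2, mul_zero]; linarith
    · push Not at hs2
      have habs : |sin (ang L t)| ≤ 1 / 2 := by rw [abs_le]; constructor <;> linarith
      rw [slabProfile_eq_of_abs_sin_le habs]
      have h1 : sin (ang L t) * σ ≤ 0 := mul_nonpos_of_nonpos_of_nonneg hs.le hσ0
      have h2 : sin (ang L t) * σ * testProfile L t ≥ sin (ang L t) * σ := by
        have := mul_le_mul_of_nonpos_left hf.2 h1
        linarith [this]
      nlinarith

/-- On the chamber the integrand is `≥ 1/2`. [folklore] -/
theorem sin_mul_profiles_ge_half (hL : 0 < L) {t : ℝ} (ht : t ∈ Set.Icc (L / 8) (3 * L / 8)) :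
    1 / 2 ≤ sin (ang L t) * slabProfile L σ t * testProfile L t := by
  have hs := half_le_sin_ang hL ht
  rw [slabProfile_eq_one hL ht, testProfile_eq_one (by linarith), mul_one, mul_one]
  exact hs

/-- The integrand `sin θ · g · f` is continuous. [folklore] -/
theorem continuous_sin_mul_profiles (L σ : ℝ) :
    Continuous fun t => sin (ang L t) * slabProfile L σ t * testProfile L t := by
  have h1 := (contDiff_ang L).continuous
  have h2 := (contDiff_slabProfile L σ).continuous
  have h3 := (contDiff_testProfile L).continuous
  fun_prop

/-- **The chamber charge is not small**: `∫₀ᴸ sin θ · g · f ≥ L/16` for `σ ≤ 1/3`. [folklore] -/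
theorem intervalIntegral_sin_mul_profiles_ge (hL : 0 < L) (hσ0 : 0 ≤ σ) (hσ : σ ≤ 1 / 3) :
    L / 16 ≤ ∫ t in (0 : ℝ)..L, sin (ang L t) * slabProfile L σ t * testProfile L t := by
  set P : ℝ → ℝ := fun t => sin (ang L t) * slabProfile L σ t * testProfile L t with hP
  have hc : Continuous P := continuous_sin_mul_profiles L σ
  have hi : ∀ a b : ℝ, IntervalIntegrable P volume a b := fun a b => hc.intervalIntegrable a b
  have hσ1 : σ ≤ 1 := hσ.trans (by norm_num)
  have hlow : ∀ a b : ℝ, a ≤ b → (b - a) * (-(σ / 4)) ≤ ∫ t in a..b, P t := by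
    intro a b hab
    have := integral_mono_on hab (intervalIntegrable_const (c := -(σ / 4))) (hi a b)
      (fun t _ => sin_mul_profiles_ge hσ0 hσ1 L t)
    rwa [intervalIntegral.integral_const, smul_eq_mul] at this
  have hmid : (3 * L / 8 - L / 8) * (1 / 2) ≤ ∫ t in (L / 8)..(3 * L / 8), P t := by
    have := integral_mono_on (by linarith) (intervalIntegrable_const (c := 1 / 2)) (hi _ _)
      (fun t ht => sin_mul_profiles_ge_half (σ := σ) hL ht)
    rwa [intervalIntegral.integral_const, smul_eq_mul] at this
  rw [← integral_add_adjacent_intervals (hi 0 (L / 8)) (hi (L / 8) L),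
    ← integral_add_adjacent_intervals (hi (L / 8) (3 * L / 8)) (hi (3 * L / 8) L)]
  have h1 := hlow 0 (L / 8) (by linarith)
  have h3 := hlow (3 * L / 8) L (by linarith)
  nlinarith

end OneDim

/-! ### Functions of the first coordinate -/

section Axis

variable {L : ℝ}

/-- The first-coordinate functional `y ↦ y₀` as a continuous linear map. [folklore] -/
def coord0 : Space →L[ℝ] ℝ := PiLp.proj 2 (fun _ : Fin 3 => ℝ) 0

/-- `coord0 y = y₀`. [folklore] -/
@[simp] theorem coord0_apply (y : Space) : coord0 y = y 0 := rfl

/-- Lift of a real profile to a complex one-body function of the first coordinate. [folklore] -/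
def axisFun (G : ℝ → ℝ) (y : Space) : ℂ := ((G (y 0) : ℝ) : ℂ)

/-- Axis functions of `C¹` profiles are `C¹`. [folklore] -/
theorem contDiff_axisFun {G : ℝ → ℝ} (hG : ContDiff ℝ 1 G) : ContDiff ℝ 1 (axisFun G) := by
  unfold axisFun
  exact Complex.ofRealCLM.contDiff.comp (hG.comp coord0.contDiff)

/-- Axis functions of continuous profiles are continuous. [folklore] -/
theorem continuous_axisFun {G : ℝ → ℝ} (hG : Continuous G) : Continuous (axisFun G) := by
  unfold axisFun
  exact Complex.continuous_ofReal.comp (hG.comp coord0.continuous)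

/-- **Derivative of an axis function**: `∂_l G(y₀) = δ_{l0} G'(y₀)`. [folklore] -/
theorem hasFDerivAt_axisFun {G : ℝ → ℝ} (hG : Differentiable ℝ G) (y : Space) :
    HasFDerivAt (axisFun G) (Complex.ofRealCLM.comp (deriv G (y 0) • coord0)) y := by
  unfold axisFun
  have h1 : HasFDerivAt (fun y : Space => G (y 0)) (deriv G (y 0) • coord0) y :=
    (hG (y 0)).hasDerivAt.comp_hasFDerivAt y coord0.hasFDerivAt
  exact Complex.ofRealCLM.hasFDerivAt.comp y h1

/-- `∂_l G(y₀) = δ_{l0} G'(y₀)`, coordinate form. [folklore] -/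
theorem fderiv_axisFun_single {G : ℝ → ℝ} (hG : Differentiable ℝ G) (y : Space) (l : Fin 3) :
    fderiv ℝ (axisFun G) y (EuclideanSpace.single l 1) =
      if l = 0 then ((deriv G (y 0) : ℝ) : ℂ) else 0 := by
  rw [(hasFDerivAt_axisFun hG y).fderiv, ContinuousLinearMap.comp_apply, smul_apply, coord0_apply]
  by_cases hl : l = 0
  · subst hl; simp
  · rw [if_neg hl]
    have : (EuclideanSpace.single l (1 : ℝ) : Space) 0 = 0 := by
      rw [EuclideanSpace.single, PiLp.single_apply, if_neg (Ne.symm hl)]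
    rw [this, smul_zero, Complex.ofRealCLM_apply, Complex.ofReal_zero]

/-- `Σ_l ‖∂_l G(y₀)‖² = G'(y₀)²`. [folklore] -/
theorem sum_norm_sq_fderiv_axisFun {G : ℝ → ℝ} (hG : Differentiable ℝ G) (y : Space) :
    ∑ l : Fin 3, ‖fderiv ℝ (axisFun G) y (EuclideanSpace.single l 1)‖ ^ 2 = deriv G (y 0) ^ 2 := by
  simp_rw [fderiv_axisFun_single hG]
  rw [Fin.sum_univ_three]
  simp [Complex.norm_real, sq_abs]

/-- `Σ_l ‖∂_l G(y₀)‖₊² = ofReal (G'(y₀)²)` (`ℝ≥0∞` form). [folklore] -/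
theorem sum_nnnorm_sq_fderiv_axisFun {G : ℝ → ℝ} (hG : Differentiable ℝ G) (y : Space) :
    ∑ l : Fin 3, ((‖fderiv ℝ (axisFun G) y (EuclideanSpace.single l 1)‖₊ : ℝ≥0∞) ^ 2) =
      ENNReal.ofReal (deriv G (y 0) ^ 2) := by
  simp_rw [coe_nnnorm_sq_eq_ofReal]
  rw [← ENNReal.ofReal_sum_of_nonneg (fun l _ => by positivity), sum_norm_sq_fderiv_axisFun hG]

/-- Axis functions of `L`-periodic profiles are `Lℤ³`-periodic. [folklore] -/
theorem axisFun_periodic {G : ℝ → ℝ} (hG : ∀ t, G (t + L) = G t) (y : Space) (k : Fin 3) :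
    axisFun G (y + EuclideanSpace.single k L) = axisFun G y := by
  unfold axisFun
  rw [PiLp.add_apply, EuclideanSpace.single, PiLp.single_apply]
  by_cases hk : (0 : Fin 3) = k
  · rw [if_pos hk, hG]
  · rw [if_neg hk, add_zero]

/-- **Cell integral of a function of the first coordinate**:
`∫_{[0,L)³} F(y₀) dy = L² ∫₀ᴸ F`. [folklore] -/
theorem integral_cell_comp_coord0 (hL : 0 ≤ L) (F : ℝ → ℂ) :
    ∫ y in cell L, F (y 0) = ((L : ℂ) ^ 2) * ∫ t in Set.Ico 0 L, F t := by
  have hpre : (WithLp.toLp 2 : (Fin 3 → ℝ) → Space) ⁻¹' cell L = Set.univ.pi fun _ => Set.Ico 0 L := by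
    ext y; simp [cell]
  have hmp := PiLp.volume_preserving_toLp (Fin 3)
  have hme : MeasurableEmbedding (WithLp.toLp 2 : (Fin 3 → ℝ) → Space) :=
    (MeasurableEquiv.toLp 2 (Fin 3 → ℝ)).measurableEmbedding
  rw [← hmp.setIntegral_preimage_emb hme, hpre]
  set g : Fin 3 → ℝ → ℂ := fun c t => if c = 0 then F t else 1 with hg
  have hprod : ∀ y : Fin 3 → ℝ, F ((WithLp.toLp 2 y : Space) 0) = ∏ c, g c (y c) := by
    intro y
    rw [Fin.prod_univ_three, hg]
    simp
  simp_rw [hprod]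
  rw [volume_pi, Measure.restrict_pi_pi, integral_fintype_prod_eq_prod, Fin.prod_univ_three]
  have h0 : g 0 = F := by funext t; simp [hg]
  have h1 : g 1 = fun _ => 1 := by funext t; simp [hg]
  have h2 : g 2 = fun _ => 1 := by funext t; simp [hg]
  rw [h0, h1, h2, setIntegral_const, Measure.real, Real.volume_Ico, sub_zero, ENNReal.toReal_ofReal hL,
    Complex.real_smul, mul_one]
  ring

/-- `ℝ≥0∞` version: `∫⁻_{[0,L)³} F(y₀) dy = L² ∫⁻₀ᴸ F`. [folklore] -/
theorem lintegral_cell_comp_coord0 {F : ℝ → ℝ≥0∞} (hF : Measurable F) :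
    ∫⁻ y in cell L, F (y 0) = ENNReal.ofReal L ^ 2 * ∫⁻ t in Set.Ico 0 L, F t := by
  have hpre : (WithLp.toLp 2 : (Fin 3 → ℝ) → Space) ⁻¹' cell L = Set.univ.pi fun _ => Set.Ico 0 L := by
    ext y; simp [cell]
  have hmp := PiLp.volume_preserving_toLp (Fin 3)
  have hme : MeasurableEmbedding (WithLp.toLp 2 : (Fin 3 → ℝ) → Space) :=
    (MeasurableEquiv.toLp 2 (Fin 3 → ℝ)).measurableEmbedding
  rw [← hmp.setLIntegral_comp_preimage_emb hme, hpre]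
  set g : Fin 3 → ℝ → ℝ≥0∞ := fun c t => if c = 0 then F t else 1 with hg
  have hprod : ∀ y : Fin 3 → ℝ, F ((WithLp.toLp 2 y : Space) 0) = ∏ c, g c (y c) := by
    intro y
    rw [Fin.prod_univ_three, hg]
    simp
  simp_rw [hprod]
  have hgm : ∀ c, Measurable (g c) := fun c => by
    show Measurable (fun t => if c = 0 then F t else 1)
    split_ifs
    exacts [hF, measurable_const]
  rw [volume_pi, Measure.restrict_pi_pi,
    Literature.Probability.Distributions.lintegral_fin_nat_prod_eq_prod _ g hgm, Fin.prod_univ_three]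
  have h0 : g 0 = F := by funext t; simp [hg]
  have h1 : g 1 = fun _ => 1 := by funext t; simp [hg]
  have h2 : g 2 = fun _ => 1 := by funext t; simp [hg]
  rw [h0, h1, h2, setLIntegral_const, Real.volume_Ico, sub_zero]
  ring

end Axis

/-! ### Fibre data of a real product state -/

section ProductFibre

open Summit.AtomisticToContinuum.BoseEinsteinCondensation.Theorems.GaussianDominationCan.Negative

variable {m : ℕ} {L : ℝ}

/-- The bath weight `W(X) = ∫_cell |φ(y, X̂)|² dy` (the crux's `W`). [folklore] -/
def fibreW (L : ℝ) (φ : Config (m + 1) → ℂ) (X : Config (m + 1)) : ℝ :=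
  ∫ y in cell L, ‖φ (Function.update X 0 y)‖ ^ 2

/-- The conditional amplitude `ψ = |φ|/√W` of particle `0` given the bath (the crux's `ψ`). [folklore] -/
def fibrePsi (L : ℝ) (φ : Config (m + 1) → ℂ) (X : Config (m + 1)) : ℝ :=
  ‖φ X‖ / Real.sqrt (fibreW L φ X)

/-- The crux's one-body phase `e^{ik·y}`, `k = 2πn/L`, literally as typed. [folklore] -/
def wave (L : ℝ) (n : Fin 3 → ℤ) (y : Space) : ℂ :=
  Complex.exp (Complex.I * ↑(2 * Real.pi / L * ∑ j, (n j : ℝ) * y j))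

/-- `β(X̂) = ∫_cell e^{ik·y} ψ(y, X̂) dy` (the crux's `β`). [folklore] -/
def fibreBeta (L : ℝ) (n : Fin 3 → ℤ) (φ : Config (m + 1) → ℂ) (X : Config (m + 1)) : ℂ :=
  ∫ y in cell L, wave L n y * (fibrePsi L φ (Function.update X 0 y) : ℂ)

/-- The fibre-neutral charge `q = L^{-3/2}(e^{ik·x₀} ψ - β ψ²)` (the crux's `q`). [folklore] -/
def fibreCharge (L : ℝ) (n : Fin 3 → ℤ) (φ : Config (m + 1) → ℂ) (X : Config (m + 1)) : ℂ :=
  ((Real.sqrt (L ^ 3))⁻¹ : ℂ) *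
    (wave L n (X 0) * (fibrePsi L φ X : ℂ) - fibreBeta L n φ X * (fibrePsi L φ X : ℂ) ^ 2)

/-- `J` is a flow in the `x₀`-fibre with weak divergence `q` on the torus:
`∫ J·∇₀η = -∫ q η` for every `C¹`, `Lℤ³`-periodic `η` (the crux's first conjunct). [folklore] -/
def IsFibreFlow (m : ℕ) (L : ℝ) (q : Config (m + 1) → ℂ) (J : Config (m + 1) → Fin 3 → ℂ) : Prop :=
  ∀ η : Config (m + 1) → ℂ, ContDiff ℝ 1 η →
    (∀ (X : Config (m + 1)) (i : Fin (m + 1)) (l : Fin 3),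
      η (X + Pi.single i (EuclideanSpace.single l L)) = η X) →
    ∫ X in cellN (m + 1) L, ∑ l : Fin 3, J X l * fderiv ℝ η X (Pi.single 0 (EuclideanSpace.single l (1 : ℝ)))
      = - ∫ X in cellN (m + 1) L, q X * η X

/-- The bath-averaged fibre resistance (Thomson energy) `∫ |J|² W/ψ²` (the crux's cost). [folklore] -/
def fibreCost (L : ℝ) (φ : Config (m + 1) → ℂ) (J : Config (m + 1) → Fin 3 → ℂ) : ℝ≥0∞ :=
  ∫⁻ X in cellN (m + 1) L, ENNReal.ofReal ((∑ l : Fin 3, ‖J X l‖ ^ 2) * fibreW L φ X / fibrePsi L φ X ^ 2)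

/-- The crux's phase is the plane wave `e_n`. [folklore] -/
theorem wave_eq_cellWave (L : ℝ) (n : Fin 3 → ℤ) (y : Space) : wave L n y = cellWave L n y := by
  rw [wave, cellWave_apply]
  congr 1
  push_cast
  ring

/-- For `n = e₀` the phase is `e^{iθ(y₀)}`. [folklore] -/
theorem wave_e0 (L : ℝ) (y : Space) : wave L e0 y = Complex.exp (Complex.I * (ang L (y 0) : ℝ)) := by
  unfold wave ang e0
  congr 2
  rw [Fin.sum_univ_three]
  simp
  ring

/-- The real product state `Φ(X) = ∏ⱼ φ(xⱼ)` of a real one-body factor. [folklore] -/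
def realProd (m : ℕ) (φ : Space → ℝ) : Config (m + 1) → ℂ :=
  prodFun fun _ : Fin (m + 1) => fun y => ((φ y : ℝ) : ℂ)

/-- The bath factor `∏_{j ≠ 0} φ(xⱼ)²`. [folklore] -/
def bathProd (φ : Space → ℝ) (X : Config (m + 1)) : ℝ :=
  ∏ j ∈ Finset.univ.erase (0 : Fin (m + 1)), φ (X j) ^ 2

variable {φ : Space → ℝ}

/-- The bath factor of a positive profile is positive. [folklore] -/
theorem bathProd_pos (hφ : ∀ y, 0 < φ y) (X : Config (m + 1)) : 0 < bathProd φ X :=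
  Finset.prod_pos fun _ _ => pow_pos (hφ _) 2

/-- `‖∏ φ(xⱼ)‖ = ∏ φ(xⱼ)` for a positive factor. [folklore] -/
theorem norm_realProd (hφ : ∀ y, 0 < φ y) (X : Config (m + 1)) :
    ‖realProd m φ X‖ = ∏ j, φ (X j) := by
  unfold realProd prodFun
  rw [norm_prod]
  refine Finset.prod_congr rfl fun j _ => ?_
  rw [Complex.norm_real, Real.norm_of_nonneg (hφ _).le]

/-- `‖Φ(y, X̂)‖ = φ(y) ∏_{j≠0} φ(xⱼ)`. [folklore] -/
theorem norm_realProd_update (hφ : ∀ y, 0 < φ y) (X : Config (m + 1)) (y : Space) :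
    ‖realProd m φ (Function.update X 0 y)‖ = φ y * ∏ j ∈ Finset.univ.erase (0 : Fin (m + 1)), φ (X j) := by
  unfold realProd prodFun
  rw [prod_update_eq (fun _ : Fin (m + 1) => fun y => ((φ y : ℝ) : ℂ)) X 0 y, norm_mul, norm_prod,
    Complex.norm_real, Real.norm_of_nonneg (hφ _).le]
  congr 1
  refine Finset.prod_congr rfl fun j _ => ?_
  rw [Complex.norm_real, Real.norm_of_nonneg (hφ _).le]

/-- `‖Φ(X)‖ = φ(x₀) ∏_{j≠0} φ(xⱼ)`. [folklore] -/
theorem norm_realProd_eq_mul (hφ : ∀ y, 0 < φ y) (X : Config (m + 1)) :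
    ‖realProd m φ X‖ = φ (X 0) * ∏ j ∈ Finset.univ.erase (0 : Fin (m + 1)), φ (X j) := by
  have h := norm_realProd_update hφ X (X 0)
  rwa [Function.update_eq_self] at h

/-- `(∏_{j≠0} φ(xⱼ))² = bathProd φ X`. [folklore] -/
theorem prod_erase_sq (φ : Space → ℝ) (X : Config (m + 1)) :
    (∏ j ∈ Finset.univ.erase (0 : Fin (m + 1)), φ (X j)) ^ 2 = bathProd φ X := by
  unfold bathProd
  rw [← Finset.prod_pow]

/-- **`W` of a real product state**: `W(X) = ∏_{j≠0} φ(xⱼ)²` (with `∫φ² = 1`). [folklore] -/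
theorem fibreW_realProd (hφ : ∀ y, 0 < φ y) (hn : ∫ y in cell L, φ y ^ 2 = 1) (X : Config (m + 1)) :
    fibreW L (realProd m φ) X = bathProd φ X := by
  unfold fibreW
  simp_rw [norm_realProd_update hφ, mul_pow, prod_erase_sq]
  rw [integral_mul_const, hn, one_mul]

/-- **`ψ` of a real product state**: `ψ(X) = φ(x₀)`. [folklore] -/
theorem fibrePsi_realProd (hφ : ∀ y, 0 < φ y) (hn : ∫ y in cell L, φ y ^ 2 = 1) (X : Config (m + 1)) :
    fibrePsi L (realProd m φ) X = φ (X 0) := by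
  unfold fibrePsi
  rw [fibreW_realProd hφ hn, norm_realProd_eq_mul hφ, ← prod_erase_sq,
    Real.sqrt_sq (Finset.prod_nonneg fun j _ => (hφ _).le), mul_div_assoc,
    div_self (Finset.prod_pos fun j _ => hφ _).ne', mul_one]

/-- **`β` of a real product state**: the constant `β₀ = ∫_cell e_n φ`. [folklore] -/
theorem fibreBeta_realProd (hφ : ∀ y, 0 < φ y) (hn : ∫ y in cell L, φ y ^ 2 = 1) (n : Fin 3 → ℤ)
    (X : Config (m + 1)) :
    fibreBeta L n (realProd m φ) X = ∫ y in cell L, wave L n y * (φ y : ℂ) := by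
  unfold fibreBeta
  refine setIntegral_congr_fun (measurableSet_cell L) fun y _ => ?_
  rw [fibrePsi_realProd hφ hn, Function.update_self]

/-- **`q` of a real product state**: `q(X) = L^{-3/2}(e_n(x₀)φ(x₀) - β₀ φ(x₀)²)`. [folklore] -/
theorem fibreCharge_realProd (hφ : ∀ y, 0 < φ y) (hn : ∫ y in cell L, φ y ^ 2 = 1) (n : Fin 3 → ℤ)
    (X : Config (m + 1)) :
    fibreCharge L n (realProd m φ) X = ((Real.sqrt (L ^ 3))⁻¹ : ℂ) *
      (wave L n (X 0) * (φ (X 0) : ℂ) - (∫ y in cell L, wave L n y * (φ y : ℂ)) * (φ (X 0) : ℂ) ^ 2) := by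
  unfold fibreCharge
  rw [fibrePsi_realProd hφ hn, fibreBeta_realProd hφ hn]

/-- The cost weight of a real product state: `W/ψ² = ∏_{j≠0}φ(xⱼ)² / φ(x₀)²`. [folklore] -/
theorem fibreCost_realProd (hφ : ∀ y, 0 < φ y) (hn : ∫ y in cell L, φ y ^ 2 = 1)
    (J : Config (m + 1) → Fin 3 → ℂ) :
    fibreCost L (realProd m φ) J = ∫⁻ X in cellN (m + 1) L,
      ENNReal.ofReal ((∑ l : Fin 3, ‖J X l‖ ^ 2) * (bathProd φ X / φ (X 0) ^ 2)) := by
  unfold fibreCost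
  refine lintegral_congr fun X => ?_
  rw [fibreW_realProd hφ hn, fibrePsi_realProd hφ hn, mul_div_assoc]

end ProductFibre

/-! ### Thomson duality: every fibre flow pays for every test function -/

section Duality

variable {m : ℕ} {L : ℝ}

/-- `2a ≤ tK + D/t` for all `t > 0` forces `a² ≤ K D`. [folklore] -/
theorem sq_le_of_forall_two_mul_le {a K D : ℝ} (ha : 0 ≤ a) (hK : 0 ≤ K) (hD : 0 ≤ D)
    (h : ∀ t : ℝ, 0 < t → 2 * a ≤ t * K + D / t) : a ^ 2 ≤ K * D := by
  rcases ha.eq_or_lt with ha0 | ha0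
  · rw [← ha0]; simp only [ne_eq, OfNat.ofNat_ne_zero, not_false_eq_true, zero_pow]; positivity
  rcases hD.eq_or_lt with hD0 | hD0
  · -- `D = 0`: `2a ≤ tK` for all small `t` forces `a = 0`
    exfalso
    rcases hK.eq_or_lt with hK0 | hK0
    · have := h 1 one_pos
      rw [← hK0, ← hD0] at this
      simp at this
      linarith
    · have := h (a / K) (div_pos ha0 hK0)
      rw [← hD0, zero_div, add_zero, div_mul_cancel₀ _ hK0.ne'] at this
      linarith
  · have := h (D / a) (div_pos hD0 ha0)
    rw [div_div_cancel₀ hD0.ne'] at this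
    have h2 : a ≤ D / a * K := by linarith
    have h3 : a * a ≤ D / a * K * a := mul_le_mul_of_nonneg_right h2 ha0.le
    have h4 : D / a * K * a = K * D := by field_simp
    nlinarith [h3, h4]

/-- Weighted Young inequality for a finite pairing:
`‖Σ aₗbₗ‖ ≤ (c/2) Σ‖aₗ‖² + (1/2c) Σ‖bₗ‖²`. [folklore] -/
theorem norm_sum_mul_le_young {a b : Fin 3 → ℂ} {c : ℝ} (hc : 0 < c) :
    ‖∑ l, a l * b l‖ ≤ c / 2 * ∑ l, ‖a l‖ ^ 2 + 1 / (2 * c) * ∑ l, ‖b l‖ ^ 2 := by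
  calc ‖∑ l, a l * b l‖ ≤ ∑ l, ‖a l * b l‖ := norm_sum_le _ _
    _ = ∑ l, ‖a l‖ * ‖b l‖ := by simp_rw [norm_mul]
    _ ≤ ∑ l, (c / 2 * ‖a l‖ ^ 2 + 1 / (2 * c) * ‖b l‖ ^ 2) := by
        refine Finset.sum_le_sum fun l _ => ?_
        have h1 : 0 ≤ (c * ‖a l‖ - ‖b l‖) ^ 2 := sq_nonneg _
        have key : 2 * c * (‖a l‖ * ‖b l‖) ≤ c ^ 2 * ‖a l‖ ^ 2 + ‖b l‖ ^ 2 := by nlinarith [h1]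
        rw [show c / 2 * ‖a l‖ ^ 2 + 1 / (2 * c) * ‖b l‖ ^ 2 =
          (c ^ 2 * ‖a l‖ ^ 2 + ‖b l‖ ^ 2) / (2 * c) by field_simp]
        rw [le_div_iff₀ (by positivity)]
        linarith
    _ = c / 2 * ∑ l, ‖a l‖ ^ 2 + 1 / (2 * c) * ∑ l, ‖b l‖ ^ 2 := by
        rw [Finset.sum_add_distrib, Finset.mul_sum, Finset.mul_sum]

/-- The directional derivatives of a `C¹` function are continuous in the base point. [folklore] -/
theorem continuous_fderiv_apply_const {η : Config (m + 1) → ℂ} (hη : ContDiff ℝ 1 η)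
    (v : Config (m + 1)) : Continuous fun X => fderiv ℝ η X v :=
  (ContinuousLinearMap.apply ℝ ℂ v).continuous.comp (hη.continuous_fderiv one_ne_zero)

/-- **Thomson duality (the disprover's calibration tool).** If `J` is a fibre flow with weak
divergence `q`, then for every `C¹` periodic test function `η`, every positive measurable
weight `w`, and real `K, D` with `∫ |J|² w ≤ K` and `∫ |∇₀η|²/w ≤ D`:
`|∫ q η|² ≤ K · D`.  (Cauchy–Schwarz through the pairing `∫ J·∇₀η = -∫ qη`; junk-proof: a
non-integrable pairing has Bochner integral `0`.) [folklore] -/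
theorem norm_pairing_sq_le {q : Config (m + 1) → ℂ} {J : Config (m + 1) → Fin 3 → ℂ}
    (hJ : IsFibreFlow m L q J) {η : Config (m + 1) → ℂ} (hη : ContDiff ℝ 1 η)
    (hper : ∀ (X : Config (m + 1)) (i : Fin (m + 1)) (l : Fin 3),
      η (X + Pi.single i (EuclideanSpace.single l L)) = η X)
    {w : Config (m + 1) → ℝ} (hw : ∀ X, 0 < w X) (hwm : Measurable w) {K D : ℝ} (hK : 0 ≤ K)
    (hD : 0 ≤ D)
    (hcost : ∫⁻ X in cellN (m + 1) L, ENNReal.ofReal ((∑ l : Fin 3, ‖J X l‖ ^ 2) * w X) ≤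
      ENNReal.ofReal K)
    (hdual : ∫⁻ X in cellN (m + 1) L, ENNReal.ofReal
      ((∑ l : Fin 3, ‖fderiv ℝ η X (Pi.single 0 (EuclideanSpace.single l (1 : ℝ)))‖ ^ 2) / w X) ≤
      ENNReal.ofReal D) :
    ‖∫ X in cellN (m + 1) L, q X * η X‖ ^ 2 ≤ K * D := by
  set F : Config (m + 1) → ℂ := fun X =>
    ∑ l : Fin 3, J X l * fderiv ℝ η X (Pi.single 0 (EuclideanSpace.single l (1 : ℝ))) with hF
  have hpair : ∫ X in cellN (m + 1) L, F X = -∫ X in cellN (m + 1) L, q X * η X := hJ η hη hper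
  have hnorm : ‖∫ X in cellN (m + 1) L, q X * η X‖ = ‖∫ X in cellN (m + 1) L, F X‖ := by
    rw [hpair, norm_neg]
  rw [hnorm]
  refine sq_le_of_forall_two_mul_le (norm_nonneg _) hK hD fun t ht => ?_
  -- pointwise Young bound
  set S₁ : Config (m + 1) → ℝ := fun X => (∑ l : Fin 3, ‖J X l‖ ^ 2) * w X
  set S₂ : Config (m + 1) → ℝ := fun X =>
    (∑ l : Fin 3, ‖fderiv ℝ η X (Pi.single 0 (EuclideanSpace.single l (1 : ℝ)))‖ ^ 2) / w X
  have hpt : ∀ X, ‖F X‖ ≤ t / 2 * S₁ X + 1 / (2 * t) * S₂ X := by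
    intro X
    have h := norm_sum_mul_le_young (a := fun l => J X l)
      (b := fun l => fderiv ℝ η X (Pi.single 0 (EuclideanSpace.single l (1 : ℝ))))
      (c := t * w X) (mul_pos ht (hw X))
    have e1 : t * w X / 2 * ∑ l : Fin 3, ‖J X l‖ ^ 2 = t / 2 * S₁ X := by
      simp only [S₁]; ring
    have e2 : 1 / (2 * (t * w X)) *
        ∑ l : Fin 3, ‖fderiv ℝ η X (Pi.single 0 (EuclideanSpace.single l (1 : ℝ)))‖ ^ 2 =
        1 / (2 * t) * S₂ X := by
      simp only [S₂]
      have := (hw X).ne'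
      field_simp
    rw [e1, e2] at h
    exact h
  have hS₁ : ∀ X, 0 ≤ S₁ X := fun X =>
    mul_nonneg (Finset.sum_nonneg fun l _ => by positivity) (hw X).le
  have hS₂ : ∀ X, 0 ≤ S₂ X := fun X =>
    div_nonneg (Finset.sum_nonneg fun l _ => by positivity) (hw X).le
  have hS₂m : Measurable fun X => ENNReal.ofReal (1 / (2 * t) * S₂ X) := by
    refine (Measurable.const_mul ?_ _).ennreal_ofReal
    refine Measurable.div (Finset.measurable_sum _ fun l _ => ?_) hwm
    exact ((continuous_fderiv_apply_const hη _).norm.pow 2).measurable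
  -- integrate
  have h1 : ‖∫ X in cellN (m + 1) L, F X‖ ≤
      (∫⁻ X in cellN (m + 1) L, ENNReal.ofReal ‖F X‖).toReal :=
    norm_integral_le_lintegral_norm F
  have h2 : ∫⁻ X in cellN (m + 1) L, ENNReal.ofReal ‖F X‖ ≤
      ENNReal.ofReal (t / 2) * ENNReal.ofReal K + ENNReal.ofReal (1 / (2 * t)) * ENNReal.ofReal D := by
    calc ∫⁻ X in cellN (m + 1) L, ENNReal.ofReal ‖F X‖
        ≤ ∫⁻ X in cellN (m + 1) L,
            (ENNReal.ofReal (t / 2 * S₁ X) + ENNReal.ofReal (1 / (2 * t) * S₂ X)) := by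
          refine lintegral_mono fun X => ?_
          rw [← ENNReal.ofReal_add (mul_nonneg (by positivity) (hS₁ X))
            (mul_nonneg (by positivity) (hS₂ X))]
          exact ENNReal.ofReal_le_ofReal (hpt X)
      _ = (∫⁻ X in cellN (m + 1) L, ENNReal.ofReal (t / 2 * S₁ X)) +
            ∫⁻ X in cellN (m + 1) L, ENNReal.ofReal (1 / (2 * t) * S₂ X) :=
          lintegral_add_right _ hS₂m
      _ = ENNReal.ofReal (t / 2) * (∫⁻ X in cellN (m + 1) L, ENNReal.ofReal (S₁ X)) +
            ENNReal.ofReal (1 / (2 * t)) * ∫⁻ X in cellN (m + 1) L, ENNReal.ofReal (S₂ X) := by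
          rw [← lintegral_const_mul' _ _ ENNReal.ofReal_ne_top,
            ← lintegral_const_mul' _ _ ENNReal.ofReal_ne_top]
          congr 1
          · refine lintegral_congr fun X => ?_
            rw [ENNReal.ofReal_mul (by positivity)]
          · refine lintegral_congr fun X => ?_
            rw [ENNReal.ofReal_mul (by positivity)]
      _ ≤ ENNReal.ofReal (t / 2) * ENNReal.ofReal K + ENNReal.ofReal (1 / (2 * t)) * ENNReal.ofReal D := by
          gcongr
  have h3 : ENNReal.ofReal (t / 2) * ENNReal.ofReal K + ENNReal.ofReal (1 / (2 * t)) * ENNReal.ofReal D =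
      ENNReal.ofReal (t / 2 * K + 1 / (2 * t) * D) := by
    rw [← ENNReal.ofReal_mul (by positivity), ← ENNReal.ofReal_mul (by positivity),
      ← ENNReal.ofReal_add (by positivity) (by positivity)]
  rw [h3] at h2
  have h4 := ENNReal.toReal_le_of_le_ofReal (by positivity) h2
  have h5 : ‖∫ X in cellN (m + 1) L, F X‖ ≤ t / 2 * K + 1 / (2 * t) * D := h1.trans h4
  have : t / 2 * K + 1 / (2 * t) * D = (t * K + D / t) / 2 := by field_simp
  rw [this] at h5
  linarith

end Duality

/-! ### The two-slab product state -/

section Slab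

open Real intervalIntegral
open Summit.AtomisticToContinuum.BoseEinsteinCondensation.Theorems.GaussianDominationCan.Negative

variable {m : ℕ} {L σ : ℝ}

/-- Real version of `integral_cell_comp_coord0`. [folklore] -/
theorem integral_cell_comp_coord0_real (hL : 0 ≤ L) (F : ℝ → ℝ) :
    ∫ y in cell L, F (y 0) = L ^ 2 * ∫ t in Set.Ico 0 L, F t := by
  have hpre : (WithLp.toLp 2 : (Fin 3 → ℝ) → Space) ⁻¹' cell L = Set.univ.pi fun _ => Set.Ico 0 L := by
    ext y; simp [cell]
  have hmp := PiLp.volume_preserving_toLp (Fin 3)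
  have hme : MeasurableEmbedding (WithLp.toLp 2 : (Fin 3 → ℝ) → Space) :=
    (MeasurableEquiv.toLp 2 (Fin 3 → ℝ)).measurableEmbedding
  rw [← hmp.setIntegral_preimage_emb hme, hpre]
  set g : Fin 3 → ℝ → ℝ := fun c t => if c = 0 then F t else 1 with hg
  have hprod : ∀ y : Fin 3 → ℝ, F ((WithLp.toLp 2 y : Space) 0) = ∏ c, g c (y c) := by
    intro y
    rw [Fin.prod_univ_three, hg]
    simp
  simp_rw [hprod]
  rw [volume_pi, Measure.restrict_pi_pi, integral_fintype_prod_eq_prod, Fin.prod_univ_three]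
  have h0 : g 0 = F := by funext t; simp [hg]
  have h1 : g 1 = fun _ => 1 := by funext t; simp [hg]
  have h2 : g 2 = fun _ => 1 := by funext t; simp [hg]
  rw [h0, h1, h2, setIntegral_const, Measure.real, Real.volume_Ico, sub_zero, ENNReal.toReal_ofReal hL,
    smul_eq_mul, mul_one]
  ring

/-- Set integral over `[0,L)` as an interval integral. [folklore] -/
theorem setIntegral_Ico_eq_intervalIntegral (hL : 0 ≤ L) {E : Type*} [NormedAddCommGroup E]
    [NormedSpace ℝ E] (F : ℝ → E) :
    ∫ t in Set.Ico 0 L, F t = ∫ t in (0 : ℝ)..L, F t := by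
  rw [integral_Ico_eq_integral_Ioc, ← intervalIntegral.integral_of_le hL]

/-- The normalising integral `Z = ∫_cell g(y₀)² dy`. [folklore] -/
def slabZ (L σ : ℝ) : ℝ := ∫ y in cell L, slabProfile L σ (y 0) ^ 2

/-- `Z = L² ∫₀ᴸ g²`. [folklore] -/
theorem slabZ_eq (hL : 0 ≤ L) (σ : ℝ) :
    slabZ L σ = L ^ 2 * ∫ t in (0 : ℝ)..L, slabProfile L σ t ^ 2 := by
  unfold slabZ
  rw [integral_cell_comp_coord0_real hL (fun t => slabProfile L σ t ^ 2),
    setIntegral_Ico_eq_intervalIntegral hL]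

/-- **`L³/4 ≤ Z ≤ L³`.** [folklore] -/
theorem slabZ_bounds (hL : 0 < L) (hσ0 : 0 ≤ σ) (hσ1 : σ ≤ 1) :
    L ^ 3 / 4 ≤ slabZ L σ ∧ slabZ L σ ≤ L ^ 3 := by
  rw [slabZ_eq hL.le]
  have hc : Continuous fun t => slabProfile L σ t ^ 2 := (contDiff_slabProfile L σ).continuous.pow 2
  have hi : ∀ a b : ℝ, IntervalIntegrable (fun t => slabProfile L σ t ^ 2) volume a b :=
    fun a b => hc.intervalIntegrable a b
  have hsq1 : ∀ t, slabProfile L σ t ^ 2 ≤ 1 := fun t => by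
    have h := slabProfile_mem hσ1 L t
    have h0 : 0 ≤ slabProfile L σ t := hσ0.trans h.1
    nlinarith
  have hsq0 : ∀ t, 0 ≤ slabProfile L σ t ^ 2 := fun t => sq_nonneg _
  constructor
  · have h1 : (L / 8 - 0) * 0 ≤ ∫ t in (0 : ℝ)..(L / 8), slabProfile L σ t ^ 2 := by
      have := integral_mono_on (a := 0) (b := L / 8) (by linarith) (intervalIntegrable_const (c := 0))
        (hi _ _) (fun t _ => hsq0 t)
      rwa [intervalIntegral.integral_const, smul_eq_mul] at this
    have h2 : (3 * L / 8 - L / 8) * 1 ≤ ∫ t in (L / 8)..(3 * L / 8), slabProfile L σ t ^ 2 := by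
      have := integral_mono_on (a := L / 8) (b := 3 * L / 8) (by linarith)
        (intervalIntegrable_const (c := 1)) (hi _ _)
        (fun t ht => by rw [slabProfile_eq_one hL ht, one_pow])
      rwa [intervalIntegral.integral_const, smul_eq_mul] at this
    have h3 : (L - 3 * L / 8) * 0 ≤ ∫ t in (3 * L / 8)..L, slabProfile L σ t ^ 2 := by
      have := integral_mono_on (a := 3 * L / 8) (b := L) (by linarith)
        (intervalIntegrable_const (c := 0)) (hi _ _) (fun t _ => hsq0 t)
      rwa [intervalIntegral.integral_const, smul_eq_mul] at this
    rw [← integral_add_adjacent_intervals (hi 0 (L / 8)) (hi (L / 8) L),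
      ← integral_add_adjacent_intervals (hi (L / 8) (3 * L / 8)) (hi (3 * L / 8) L)]
    have hL2 : 0 < L ^ 2 := by positivity
    nlinarith
  · have h1 : ∫ t in (0 : ℝ)..L, slabProfile L σ t ^ 2 ≤ (L - 0) * 1 := by
      have := integral_mono_on (a := 0) (b := L) hL.le (hi _ _) (intervalIntegrable_const (c := 1))
        (fun t _ => hsq1 t)
      rwa [intervalIntegral.integral_const, smul_eq_mul] at this
    have hL2 : 0 < L ^ 2 := by positivity
    nlinarith

/-- `Z > 0`. [folklore] -/
theorem slabZ_pos (hL : 0 < L) (hσ0 : 0 ≤ σ) (hσ1 : σ ≤ 1) : 0 < slabZ L σ :=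
  lt_of_lt_of_le (by positivity) (slabZ_bounds hL hσ0 hσ1).1

/-- The normalised one-dimensional profile `G = g/√Z`. [folklore] -/
def slabG (L σ t : ℝ) : ℝ := slabProfile L σ t / Real.sqrt (slabZ L σ)

/-- The one-body factor `φ(y) = g(y₀)/√Z` of the slab state. [folklore] -/
def slabFactor (L σ : ℝ) (y : Space) : ℝ := slabG L σ (y 0)

/-- `φ > 0`. [folklore] -/
theorem slabFactor_pos (hL : 0 < L) (hσ0 : 0 < σ) (hσ1 : σ ≤ 1) (y : Space) : 0 < slabFactor L σ y :=
  div_pos (slabProfile_pos hσ0 hσ1 L _) (Real.sqrt_pos.2 (slabZ_pos hL hσ0.le hσ1))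

/-- `G` is `C¹`. [folklore] -/
theorem contDiff_slabG (L σ : ℝ) : ContDiff ℝ 1 (slabG L σ) :=
  (contDiff_slabProfile L σ).div_const _

/-- `φ` is continuous. [folklore] -/
theorem continuous_slabFactor (L σ : ℝ) : Continuous (slabFactor L σ) :=
  (contDiff_slabG L σ).continuous.comp coord0.continuous

/-- `G` is `L`-periodic. [folklore] -/
theorem slabG_add_period (hL : L ≠ 0) (t : ℝ) : slabG L σ (t + L) = slabG L σ t := by
  unfold slabG; rw [slabProfile_add_period hL]

/-- `G` is `L/2`-periodic. [folklore] -/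
theorem slabG_add_half (hL : L ≠ 0) (t : ℝ) : slabG L σ (t + L / 2) = slabG L σ t := by
  unfold slabG; rw [slabProfile_add_half hL]

/-- The slab factor, lifted to `ℂ`, is the axis function of `G`. [folklore] -/
theorem slabFactor_coe (L σ : ℝ) :
    (fun y : Space => ((slabFactor L σ y : ℝ) : ℂ)) = axisFun (slabG L σ) := rfl

/-- `∫_cell φ² = 1`. [folklore] -/
theorem integral_sq_slabFactor (hL : 0 < L) (hσ0 : 0 ≤ σ) (hσ1 : σ ≤ 1) :
    ∫ y in cell L, slabFactor L σ y ^ 2 = 1 := by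
  have hZ := slabZ_pos hL hσ0 hσ1
  unfold slabFactor slabG
  simp_rw [div_pow, Real.sq_sqrt hZ.le]
  rw [MeasureTheory.integral_div]
  exact div_self hZ.ne'

/-- `∫⁻_cell ‖φ‖₊² = 1`. [folklore] -/
theorem lintegral_nnnorm_sq_slabFactor (hL : 0 < L) (hσ0 : 0 ≤ σ) (hσ1 : σ ≤ 1) :
    ∫⁻ y in cell L, ((‖((slabFactor L σ y : ℝ) : ℂ)‖₊ : ℝ≥0∞) ^ 2) = 1 := by
  simp_rw [coe_nnnorm_sq_eq_ofReal, Complex.norm_real, Real.norm_eq_abs, sq_abs]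
  rw [← ofReal_integral_eq_lintegral_ofReal
      (integrableOn_cell (f := fun y : Space => slabFactor L σ y ^ 2) ((continuous_slabFactor L σ).pow 2))
      (Filter.Eventually.of_forall fun y => sq_nonneg _),
    integral_sq_slabFactor hL hσ0 hσ1, ENNReal.ofReal_one]

/-- `∫⁻_cell ofReal φ² = 1`. [folklore] -/
theorem lintegral_ofReal_sq_slabFactor (hL : 0 < L) (hσ0 : 0 ≤ σ) (hσ1 : σ ≤ 1) :
    ∫⁻ y in cell L, ENNReal.ofReal (slabFactor L σ y ^ 2) = 1 := by
  rw [← ofReal_integral_eq_lintegral_ofReal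
      (integrableOn_cell (f := fun y : Space => slabFactor L σ y ^ 2) ((continuous_slabFactor L σ).pow 2))
      (Filter.Eventually.of_forall fun y => sq_nonneg _),
    integral_sq_slabFactor hL hσ0 hσ1, ENNReal.ofReal_one]

/-- `∫_cell φ² = 1` (complex form). [folklore] -/
theorem integral_sq_slabFactor_complex (hL : 0 < L) (hσ0 : 0 ≤ σ) (hσ1 : σ ≤ 1) :
    ∫ y in cell L, (((slabFactor L σ y ^ 2 : ℝ)) : ℂ) = 1 := by
  rw [integral_complex_ofReal, integral_sq_slabFactor hL hσ0 hσ1, Complex.ofReal_one]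

/-- **The slab state** `Φ = φ^{⊗N}`, an admissible periodic Bose trial state. [folklore] -/
def slabState (m : ℕ) (hL : 0 < L) (hσ0 : 0 < σ) (hσ1 : σ ≤ 1) : PeriodicTrialState (m + 1) L where
  ψ := realProd m (slabFactor L σ)
  contDiff := contDiff_prodFun fun _ => by
    rw [slabFactor_coe]; exact contDiff_axisFun (contDiff_slabG L σ)
  periodic X i k := prodFun_periodic (fun _ y k =>
    axisFun_periodic (G := slabG L σ) (slabG_add_period hL.ne') y k) X i k
  symm σ' X := prodFun_const_symm _ σ' X
  norm_eq := by
    show ∫⁻ X in cellN (m + 1) L,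
      (‖prodFun (fun _ : Fin (m + 1) => fun y => ((slabFactor L σ y : ℝ) : ℂ)) X‖₊ : ℝ≥0∞) ^ 2 = 1
    rw [lintegral_nnnorm_sq_prodFun (g := fun _ : Fin (m + 1) => fun y => ((slabFactor L σ y : ℝ) : ℂ))
      (fun _ => Complex.continuous_ofReal.comp (continuous_slabFactor L σ))]
    simp only [lintegral_nnnorm_sq_slabFactor hL hσ0.le hσ1, Finset.prod_const_one]

/-- Unfolding lemma for the slab state. [folklore] -/
@[simp] theorem slabState_ψ (hL : 0 < L) (hσ0 : 0 < σ) (hσ1 : σ ≤ 1) :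
    (slabState m hL hσ0 hσ1).ψ = realProd m (slabFactor L σ) := rfl

/-- The slab state has no zeros. [folklore] -/
theorem slabState_ne_zero (hL : 0 < L) (hσ0 : 0 < σ) (hσ1 : σ ≤ 1) (X : Config (m + 1)) :
    (slabState m hL hσ0 hσ1).ψ X ≠ 0 := by
  rw [slabState_ψ, ← norm_pos_iff, norm_realProd (slabFactor_pos hL hσ0 hσ1)]
  exact Finset.prod_pos fun j _ => slabFactor_pos hL hσ0 hσ1 _

/-- **The free ground-state energy vanishes** (the constant state has zero energy). [folklore] -/
theorem periodicGroundStateEnergy_zero (m : ℕ) (hL : 0 < L) :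
    periodicGroundStateEnergy 0 (m + 1) L = 0 := by
  have hc : ((Real.sqrt (L ^ 3))⁻¹) ^ 2 * L ^ 3 = 1 := by
    rw [inv_pow, Real.sq_sqrt (by positivity), inv_mul_cancel₀ (by positivity)]
  refine le_antisymm ?_ bot_le
  calc periodicGroundStateEnergy 0 (m + 1) L ≤ periodicEnergy 0 (constState m hL _ hc) :=
        periodicGroundStateEnergy_le _ _
    _ = 0 := periodicEnergy_constState hL hc

/-- **Slope of the normalised profile**: `G'² ≤ (16πK/L)² · 4/L³`. [folklore] -/
theorem deriv_slabG_sq_le (hL : 0 < L) (hσ0 : 0 ≤ σ) (hσ1 : σ ≤ 1) {K : ℝ}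
    (hK : ∀ x, |deriv smoothTransition x| ≤ K) (t : ℝ) :
    deriv (slabG L σ) t ^ 2 ≤ (16 * π * K / L) ^ 2 * (4 / L ^ 3) := by
  have hZ := slabZ_pos hL hσ0 hσ1
  have hZb := (slabZ_bounds hL hσ0 hσ1).1
  have hd : deriv (slabG L σ) t = deriv (slabProfile L σ) t / Real.sqrt (slabZ L σ) := by
    unfold slabG; rw [deriv_div_const]
  rw [hd, div_pow, Real.sq_sqrt hZ.le]
  have h1 := abs_deriv_slabProfile_le hL hσ0 hσ1 hK t
  have h2 : deriv (slabProfile L σ) t ^ 2 ≤ (16 * π * K / L) ^ 2 := by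
    rw [← sq_abs]; exact pow_le_pow_left₀ (abs_nonneg _) h1 2
  have h3 : 1 / slabZ L σ ≤ 4 / L ^ 3 := by
    rw [div_le_div_iff₀ hZ (by positivity)]; linarith
  calc deriv (slabProfile L σ) t ^ 2 / slabZ L σ = deriv (slabProfile L σ) t ^ 2 * (1 / slabZ L σ) := by ring
    _ ≤ (16 * π * K / L) ^ 2 * (4 / L ^ 3) := by gcongr

/-- **Energy of the slab state**: `E(Φ) ≤ N · 1024π²K²/L²` for the free gas. [folklore] -/
theorem periodicEnergy_slabState_le (hL : 0 < L) (hσ0 : 0 < σ) (hσ1 : σ ≤ 1) {K : ℝ}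
    (hK : ∀ x, |deriv smoothTransition x| ≤ K) :
    periodicEnergy 0 (slabState m hL hσ0 hσ1) ≤
      ENNReal.ofReal (((m + 1 : ℕ) : ℝ) * (1024 * π ^ 2 * K ^ 2 / L ^ 2)) := by
  set B : ℝ := (16 * π * K / L) ^ 2 * (4 / L ^ 3) with hB
  have hB0 : 0 ≤ B := by positivity
  set g : Fin (m + 1) → Space → ℂ := fun _ y => ((slabFactor L σ y : ℝ) : ℂ) with hg
  have hgd : ∀ i, Differentiable ℝ (g i) := fun _ => by
    rw [hg, slabFactor_coe]; exact (contDiff_axisFun (contDiff_slabG L σ)).differentiable one_ne_zero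
  have hF : Measurable fun y : Space => ((‖g 0 y‖₊ : ℝ≥0∞) ^ 2) :=
    (Complex.continuous_ofReal.comp (continuous_slabFactor L σ)).measurable.nnnorm.coe_nnreal_ennreal.pow_const _
  have hI : ∫⁻ y in cell L, ((‖g 0 y‖₊ : ℝ≥0∞) ^ 2) = 1 := lintegral_nnnorm_sq_slabFactor hL hσ0.le hσ1
  unfold periodicEnergy
  simp only [periodicInteraction_zero, zero_mul, add_zero]
  show ∫⁻ X in cellN (m + 1) L, kineticDensity (prodFun g) X ≤ _
  -- pointwise bound on the kinetic density
  have hpt : ∀ X, kineticDensity (prodFun g) X ≤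
      ∑ i : Fin (m + 1), ENNReal.ofReal B * ∏ j ∈ Finset.univ.erase i, ((‖g j (X j)‖₊ : ℝ≥0∞) ^ 2) := by
    intro X
    rw [kineticDensity_prodFun hgd]
    refine Finset.sum_le_sum fun i _ => ?_
    rw [mul_comm]
    gcongr
    rw [hg, slabFactor_coe, sum_nnnorm_sq_fderiv_axisFun ((contDiff_slabG L σ).differentiable one_ne_zero)]
    exact ENNReal.ofReal_le_ofReal (deriv_slabG_sq_le hL hσ0.le hσ1 hK _)
  have hmeas : ∀ i : Fin (m + 1), Measurable (fun X : Config (m + 1) =>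
      ENNReal.ofReal B * ∏ j ∈ Finset.univ.erase i, ((‖g j (X j)‖₊ : ℝ≥0∞) ^ 2)) := fun i =>
    measurable_const.mul (Finset.measurable_prod _ fun j _ => hF.comp (measurable_pi_apply j))
  calc ∫⁻ X in cellN (m + 1) L, kineticDensity (prodFun g) X
      ≤ ∫⁻ X in cellN (m + 1) L, ∑ i : Fin (m + 1),
          ENNReal.ofReal B * ∏ j ∈ Finset.univ.erase i, ((‖g j (X j)‖₊ : ℝ≥0∞) ^ 2) :=
        lintegral_mono hpt
    _ = ∑ i : Fin (m + 1), ∫⁻ X in cellN (m + 1) L,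
          ENNReal.ofReal B * ∏ j ∈ Finset.univ.erase i, ((‖g j (X j)‖₊ : ℝ≥0∞) ^ 2) :=
        lintegral_finsetSum _ (fun i _ => hmeas i)
    _ = ∑ _i : Fin (m + 1), ENNReal.ofReal (B * L ^ 3) := by
        refine Finset.sum_congr rfl fun i _ => ?_
        rw [lintegral_const_mul' _ _ ENNReal.ofReal_ne_top, lintegral_prod_erase i hF]
        simp only [hI, Finset.prod_const_one, mul_one]
        rw [← ENNReal.ofReal_pow hL.le, ← ENNReal.ofReal_mul hB0]
    _ = ENNReal.ofReal (((m + 1 : ℕ) : ℝ) * (1024 * π ^ 2 * K ^ 2 / L ^ 2)) := by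
        rw [Finset.sum_const, Finset.card_univ, Fintype.card_fin, nsmul_eq_mul,
          ← ENNReal.ofReal_natCast (m + 1), ← ENNReal.ofReal_mul (Nat.cast_nonneg _)]
        congr 1
        rw [hB]
        field_simp
        ring

/-- **`β₀ = 0` for the slab state**: the first harmonic of the `L/2`-periodic profile vanishes. [folklore] -/
theorem integral_wave_mul_slabFactor (hL : 0 < L) (σ : ℝ) :
    ∫ y in cell L, wave L e0 y * ((slabFactor L σ y : ℝ) : ℂ) = 0 := by
  have h : ∀ y : Space, wave L e0 y * ((slabFactor L σ y : ℝ) : ℂ) =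
      (fun t : ℝ => Complex.exp (Complex.I * (ang L t : ℝ)) * ((slabG L σ t : ℝ) : ℂ)) (y 0) := by
    intro y; rw [wave_e0]; rfl
  simp_rw [h]
  have key := integral_cell_comp_coord0 hL.le
    (fun t : ℝ => Complex.exp (Complex.I * (ang L t : ℝ)) * ((slabG L σ t : ℝ) : ℂ))
  simp only at key
  rw [key, setIntegral_Ico_eq_intervalIntegral hL.le,
    intervalIntegral_exp_ang_mul_eq_zero (G := fun t => ((slabG L σ t : ℝ) : ℂ))
      (Complex.continuous_ofReal.comp (contDiff_slabG L σ).continuous)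
      hL (fun t => by simp only [slabG_add_half hL.ne']), mul_zero]

/-- The fibre charge of the slab state: `q(X) = L^{-3/2} e_{e₀}(x₀) φ(x₀)`. [folklore] -/
theorem fibreCharge_slabState (hL : 0 < L) (hσ0 : 0 < σ) (hσ1 : σ ≤ 1) (X : Config (m + 1)) :
    fibreCharge L e0 (realProd m (slabFactor L σ)) X =
      ((Real.sqrt (L ^ 3))⁻¹ : ℂ) * (wave L e0 (X 0) * ((slabFactor L σ (X 0) : ℝ) : ℂ)) := by
  rw [fibreCharge_realProd (slabFactor_pos hL hσ0 hσ1) (integral_sq_slabFactor hL hσ0.le hσ1),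
    integral_wave_mul_slabFactor hL, zero_mul, sub_zero]

end Slab

/-! ### The test function and the refutation -/

section Main

open Real intervalIntegral
open Summit.AtomisticToContinuum.BoseEinsteinCondensation.Theorems.GaussianDominationCan.Negative

variable {m : ℕ} {L σ : ℝ}

/-- The factors of the test function `η(X) = f(x₀₀) ∏_{j≠0} φ(xⱼ)²`. [folklore] -/
def etaFactors (m : ℕ) (L σ : ℝ) : Fin (m + 1) → Space → ℂ := fun j =>
  if j = 0 then axisFun (testProfile L) else axisFun fun t => slabG L σ t ^ 2

/-- The test function `η = f(x₀₀) ∏_{j≠0} φ(xⱼ)²` (chamber selector times the bath density). [folklore] -/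
def eta (m : ℕ) (L σ : ℝ) : Config (m + 1) → ℂ := prodFun (etaFactors m L σ)

/-- The `0`-th factor of `η` is the chamber selector `f(y₀)`. [folklore] -/
theorem etaFactors_zero : etaFactors m L σ 0 = axisFun (testProfile L) := by
  simp [etaFactors]

/-- The bath factors of `η` are `φ² = G(y₀)²`. [folklore] -/
theorem etaFactors_of_ne {j : Fin (m + 1)} (hj : j ≠ 0) :
    etaFactors m L σ j = axisFun fun t => slabG L σ t ^ 2 := by
  simp [etaFactors, hj]

/-- The bath factors of `η`, evaluated. [folklore] -/
theorem etaFactors_of_ne_apply {j : Fin (m + 1)} (hj : j ≠ 0) (y : Space) :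
    etaFactors m L σ j y = (((slabFactor L σ y) ^ 2 : ℝ) : ℂ) := by
  rw [etaFactors_of_ne hj]; rfl

/-- Every factor of `η` is `C¹`. [folklore] -/
theorem contDiff_etaFactors (j : Fin (m + 1)) : ContDiff ℝ 1 (etaFactors m L σ j) := by
  by_cases hj : j = 0
  · subst hj; rw [etaFactors_zero]; exact contDiff_axisFun (contDiff_testProfile L)
  · rw [etaFactors_of_ne hj]; exact contDiff_axisFun ((contDiff_slabG L σ).pow 2)

/-- Every factor of `η` is differentiable. [folklore] -/
theorem differentiable_etaFactors (j : Fin (m + 1)) : Differentiable ℝ (etaFactors m L σ j) :=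
  (contDiff_etaFactors j).differentiable one_ne_zero

/-- Every factor of `η` is continuous. [folklore] -/
theorem continuous_etaFactors (j : Fin (m + 1)) : Continuous (etaFactors m L σ j) :=
  (contDiff_etaFactors j).continuous

/-- Every factor of `η` is `Lℤ³`-periodic. [folklore] -/
theorem etaFactors_periodic (hL : L ≠ 0) (j : Fin (m + 1)) (y : Space) (k : Fin 3) :
    etaFactors m L σ j (y + EuclideanSpace.single k L) = etaFactors m L σ j y := by
  by_cases hj : j = 0
  · subst hj; rw [etaFactors_zero]; exact axisFun_periodic (testProfile_add_period hL) y k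
  · rw [etaFactors_of_ne hj]
    exact axisFun_periodic (G := fun t => slabG L σ t ^ 2) (fun t => by simp only [slabG_add_period hL]) y k

/-- `η` is `C¹`. [folklore] -/
theorem contDiff_eta : ContDiff ℝ 1 (eta m L σ) := contDiff_prodFun contDiff_etaFactors

/-- `η` is `Lℤ³`-periodic in every particle (an admissible test function). [folklore] -/
theorem eta_periodic (hL : L ≠ 0) (X : Config (m + 1)) (i : Fin (m + 1)) (k : Fin 3) :
    eta m L σ (X + Pi.single i (EuclideanSpace.single k L)) = eta m L σ X :=
  prodFun_periodic (fun j y k => etaFactors_periodic hL j y k) X i k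

/-- The bath part of `η`: `∏_{j≠0} η_j(xⱼ) = bathProd φ X` (as a complex number). [folklore] -/
theorem prod_erase_etaFactors (X : Config (m + 1)) :
    ∏ j ∈ Finset.univ.erase (0 : Fin (m + 1)), etaFactors m L σ j (X j) =
      ((bathProd (slabFactor L σ) X : ℝ) : ℂ) := by
  unfold bathProd
  push_cast
  refine Finset.prod_congr rfl fun j hj => ?_
  rw [etaFactors_of_ne_apply (Finset.ne_of_mem_erase hj)]
  push_cast
  ring

/-- **The dual energy density of `η`**: `Σₗ |∂_{0,l} η|² = bathProd² · f'(x₀₀)²`. [folklore] -/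
theorem sum_norm_sq_fderiv_eta (X : Config (m + 1)) :
    ∑ l : Fin 3, ‖fderiv ℝ (eta m L σ) X (Pi.single 0 (EuclideanSpace.single l (1 : ℝ)))‖ ^ 2 =
      bathProd (slabFactor L σ) X ^ 2 * deriv (testProfile L) ((X 0) 0) ^ 2 := by
  unfold eta
  simp_rw [fderiv_prodFun differentiable_etaFactors X 0, norm_mul, mul_pow, prod_erase_etaFactors,
    Complex.norm_real, Real.norm_eq_abs, sq_abs]
  rw [← Finset.mul_sum, etaFactors_zero,
    sum_norm_sq_fderiv_axisFun ((contDiff_testProfile L).differentiable one_ne_zero)]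

/-- **Pointwise dual bound**: `Σₗ|∂_{0,l}η|² / (W/ψ²) ≤ bathProd · (4πK/L)²σ²/Z`. [folklore] -/
theorem dual_density_le (hL : 0 < L) (hσ0 : 0 < σ) (hσ1 : σ ≤ 1) {K : ℝ}
    (hK : ∀ x, |deriv smoothTransition x| ≤ K) (X : Config (m + 1)) :
    (∑ l : Fin 3, ‖fderiv ℝ (eta m L σ) X (Pi.single 0 (EuclideanSpace.single l (1 : ℝ)))‖ ^ 2) /
        (bathProd (slabFactor L σ) X / slabFactor L σ (X 0) ^ 2) ≤
      bathProd (slabFactor L σ) X * ((4 * π * K / L) ^ 2 * σ ^ 2 / slabZ L σ) := by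
  have hB := bathProd_pos (slabFactor_pos hL hσ0 hσ1) X
  have hφ := slabFactor_pos hL hσ0 hσ1 (X 0)
  have hZ := slabZ_pos hL hσ0.le hσ1
  rw [sum_norm_sq_fderiv_eta, div_div_eq_mul_div, div_le_iff₀ hB]
  have key : deriv (testProfile L) ((X 0) 0) ^ 2 * slabFactor L σ (X 0) ^ 2 ≤
      (4 * π * K / L) ^ 2 * σ ^ 2 / slabZ L σ := by
    have h := deriv_testProfile_sq_mul_slabProfile_sq_le (σ := σ) hL hK ((X 0) 0)
    unfold slabFactor slabG
    rw [div_pow, Real.sq_sqrt hZ.le, ← mul_div_assoc, div_le_div_iff_of_pos_right hZ]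
    exact h
  calc bathProd (slabFactor L σ) X ^ 2 * deriv (testProfile L) ((X 0) 0) ^ 2 * slabFactor L σ (X 0) ^ 2
      = (bathProd (slabFactor L σ) X * bathProd (slabFactor L σ) X) *
          (deriv (testProfile L) ((X 0) 0) ^ 2 * slabFactor L σ (X 0) ^ 2) := by ring
    _ ≤ (bathProd (slabFactor L σ) X * bathProd (slabFactor L σ) X) *
          ((4 * π * K / L) ^ 2 * σ ^ 2 / slabZ L σ) := by gcongr
    _ = bathProd (slabFactor L σ) X * ((4 * π * K / L) ^ 2 * σ ^ 2 / slabZ L σ) *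
          bathProd (slabFactor L σ) X := by ring

/-- `bathProd` in `ℝ≥0∞`: `ofReal (∏ φ²) = ∏ ofReal φ²`. [folklore] -/
theorem ofReal_bathProd (X : Config (m + 1)) :
    ENNReal.ofReal (bathProd (slabFactor L σ) X) =
      ∏ j ∈ Finset.univ.erase (0 : Fin (m + 1)), ENNReal.ofReal (slabFactor L σ (X j) ^ 2) := by
  unfold bathProd
  rw [ENNReal.ofReal_prod_of_nonneg fun j _ => sq_nonneg _]

/-- **The dual energy of `η` is small**: `∫ Σₗ|∂_{0,l}η|² ψ²/W ≤ 64π²K²σ²/L²`. [folklore] -/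
theorem lintegral_dual_le (hL : 0 < L) (hσ0 : 0 < σ) (hσ1 : σ ≤ 1) {K : ℝ}
    (hK : ∀ x, |deriv smoothTransition x| ≤ K) :
    ∫⁻ X in cellN (m + 1) L, ENNReal.ofReal
      ((∑ l : Fin 3, ‖fderiv ℝ (eta m L σ) X (Pi.single 0 (EuclideanSpace.single l (1 : ℝ)))‖ ^ 2) /
        (bathProd (slabFactor L σ) X / slabFactor L σ (X 0) ^ 2)) ≤
      ENNReal.ofReal (64 * π ^ 2 * K ^ 2 * σ ^ 2 / L ^ 2) := by
  have hZ := slabZ_pos hL hσ0.le hσ1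
  have hZb := (slabZ_bounds hL hσ0.le hσ1).1
  set c₁ : ℝ := (4 * π * K / L) ^ 2 * σ ^ 2 / slabZ L σ with hc₁
  have hc₁0 : 0 ≤ c₁ := by positivity
  have hF : Measurable fun y : Space => ENNReal.ofReal (slabFactor L σ y ^ 2) :=
    ((continuous_slabFactor L σ).pow 2).measurable.ennreal_ofReal
  calc ∫⁻ X in cellN (m + 1) L, ENNReal.ofReal
        ((∑ l : Fin 3, ‖fderiv ℝ (eta m L σ) X (Pi.single 0 (EuclideanSpace.single l (1 : ℝ)))‖ ^ 2) /
          (bathProd (slabFactor L σ) X / slabFactor L σ (X 0) ^ 2))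
      ≤ ∫⁻ X in cellN (m + 1) L, ENNReal.ofReal (bathProd (slabFactor L σ) X * c₁) :=
        lintegral_mono fun X => ENNReal.ofReal_le_ofReal (dual_density_le hL hσ0 hσ1 hK X)
    _ = ∫⁻ X in cellN (m + 1) L,
          (∏ j ∈ Finset.univ.erase (0 : Fin (m + 1)), ENNReal.ofReal (slabFactor L σ (X j) ^ 2)) *
            ENNReal.ofReal c₁ := by
        refine lintegral_congr fun X => ?_
        rw [ENNReal.ofReal_mul (bathProd_pos (slabFactor_pos hL hσ0 hσ1) X).le, ofReal_bathProd]
    _ = ENNReal.ofReal L ^ 3 * ENNReal.ofReal c₁ := by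
        rw [lintegral_mul_const' _ _ ENNReal.ofReal_ne_top, lintegral_prod_erase 0 hF]
        simp only [lintegral_ofReal_sq_slabFactor hL hσ0.le hσ1, Finset.prod_const_one, mul_one]
    _ = ENNReal.ofReal (L ^ 3 * c₁) := by
        rw [← ENNReal.ofReal_pow hL.le, ← ENNReal.ofReal_mul (by positivity)]
    _ ≤ ENNReal.ofReal (64 * π ^ 2 * K ^ 2 * σ ^ 2 / L ^ 2) := by
        apply ENNReal.ofReal_le_ofReal
        rw [hc₁]
        have h3 : 1 / slabZ L σ ≤ 4 / L ^ 3 := by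
          rw [div_le_div_iff₀ hZ (by positivity)]; linarith
        calc L ^ 3 * ((4 * π * K / L) ^ 2 * σ ^ 2 / slabZ L σ)
            = L ^ 3 * ((4 * π * K / L) ^ 2 * σ ^ 2) * (1 / slabZ L σ) := by ring
          _ ≤ L ^ 3 * ((4 * π * K / L) ^ 2 * σ ^ 2) * (4 / L ^ 3) := by gcongr
          _ = 64 * π ^ 2 * K ^ 2 * σ ^ 2 / L ^ 2 := by field_simp; ring

/-- The one-dimensional pairing integrand `e^{iθ} G f`. [folklore] -/
def pairingFun (L σ t : ℝ) : ℂ :=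
  Complex.exp ((ang L t : ℂ) * Complex.I) * ((slabG L σ t * testProfile L t : ℝ) : ℂ)

/-- The pairing integrand is continuous. [folklore] -/
theorem continuous_pairingFun (L σ : ℝ) : Continuous (pairingFun L σ) := by
  unfold pairingFun
  have h1 := (contDiff_ang L).continuous
  have h2 := (contDiff_slabG L σ).continuous
  have h3 := (contDiff_testProfile L).continuous
  fun_prop

/-- `Im(e^{iθ} G f) = sin θ · G f`. [folklore] -/
theorem im_pairingFun (L σ t : ℝ) :
    (pairingFun L σ t).im = sin (ang L t) * (slabG L σ t * testProfile L t) := by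
  unfold pairingFun
  rw [Complex.im_mul_ofReal, Complex.exp_ofReal_mul_I_im]

/-- **The chamber charge seen by `η`**: `‖∫₀ᴸ e^{iθ} G f‖ ≥ (L/16)/√Z`. [folklore] -/
theorem norm_intervalIntegral_pairingFun_ge (hL : 0 < L) (hσ0 : 0 < σ) (hσ : σ ≤ 1 / 3) :
    L / 16 / Real.sqrt (slabZ L σ) ≤ ‖∫ t in (0 : ℝ)..L, pairingFun L σ t‖ := by
  have hσ1 : σ ≤ 1 := hσ.trans (by norm_num)
  have hZ := slabZ_pos hL hσ0.le hσ1
  have hint : IntervalIntegrable (pairingFun L σ) volume 0 L :=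
    (continuous_pairingFun L σ).intervalIntegrable 0 L
  have him : (∫ t in (0 : ℝ)..L, pairingFun L σ t).im =
      ∫ t in (0 : ℝ)..L, sin (ang L t) * slabProfile L σ t * testProfile L t / Real.sqrt (slabZ L σ) := by
    have h := (Complex.imCLM.intervalIntegral_comp_comm hint).symm
    simp only [Complex.imCLM_apply] at h
    rw [h]
    refine intervalIntegral.integral_congr fun t _ => ?_
    simp only [im_pairingFun, slabG]
    ring
  rw [intervalIntegral.integral_div] at him
  have hlow := intervalIntegral_sin_mul_profiles_ge hL hσ0.le hσ
  calc L / 16 / Real.sqrt (slabZ L σ)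
      ≤ (∫ t in (0 : ℝ)..L, sin (ang L t) * slabProfile L σ t * testProfile L t) / Real.sqrt (slabZ L σ) := by
        gcongr
    _ = (∫ t in (0 : ℝ)..L, pairingFun L σ t).im := him.symm
    _ ≤ ‖∫ t in (0 : ℝ)..L, pairingFun L σ t‖ := Complex.im_le_norm _

/-- **The pairing of the slab charge with `η`**:
`∫ q η = L^{-3/2} · L² · ∫₀ᴸ e^{iθ} G f`. [folklore] -/
theorem pairing_eq (hL : 0 < L) (hσ0 : 0 < σ) (hσ1 : σ ≤ 1) :
    ∫ X in cellN (m + 1) L, fibreCharge L e0 (realProd m (slabFactor L σ)) X * eta m L σ X =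
      ((Real.sqrt (L ^ 3))⁻¹ : ℂ) * (((L : ℂ) ^ 2) * ∫ t in (0 : ℝ)..L, pairingFun L σ t) := by
  set F := etaFactors m L σ with hF
  set h : Space → ℂ := fun y => wave L e0 y * ((slabFactor L σ y : ℝ) : ℂ) * F 0 y with hh
  have hpt : ∀ X : Config (m + 1),
      fibreCharge L e0 (realProd m (slabFactor L σ)) X * eta m L σ X =
        ((Real.sqrt (L ^ 3))⁻¹ : ℂ) * prodFun (Function.update F 0 h) X := by
    intro X
    rw [fibreCharge_slabState hL hσ0 hσ1, eta, prodFun_update_fun, ← hF, prodFun_eq_mul_erase F 0 X, hh]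
    ring
  simp_rw [hpt]
  rw [MeasureTheory.integral_const_mul]
  congr 1
  -- product integral
  have hprod : ∫ X in cellN (m + 1) L, prodFun (Function.update F 0 h) X =
      ∏ j, ∫ y in cell L, Function.update F 0 h j y := integral_cellN_prod _
  have hupd : ∀ j, (∫ y in cell L, Function.update F 0 h j y) =
      Function.update (fun j => ∫ y in cell L, F j y) 0 (∫ y in cell L, h y) j := fun j =>
    Function.apply_update (fun _ (g : Space → ℂ) => ∫ y in cell L, g y) F 0 h j
  rw [hprod]
  simp_rw [hupd]
  rw [Finset.prod_update_of_mem (Finset.mem_univ _), Finset.sdiff_singleton_eq_erase]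
  have hones : ∀ j ∈ Finset.univ.erase (0 : Fin (m + 1)), ∫ y in cell L, F j y = 1 := by
    intro j hj
    simp_rw [hF, etaFactors_of_ne_apply (Finset.ne_of_mem_erase hj)]
    exact integral_sq_slabFactor_complex hL hσ0.le hσ1
  rw [Finset.prod_congr rfl hones, Finset.prod_const_one, mul_one]
  -- the one-body integral
  have hh1 : ∀ y : Space, h y = pairingFun L σ (y 0) := by
    intro y
    rw [hh, hF, etaFactors_zero]
    simp only [pairingFun, wave_e0, axisFun, slabFactor]
    rw [mul_comm (Complex.I) _]
    push_cast
    ring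
  simp_rw [hh1]
  have key := integral_cell_comp_coord0 hL.le (pairingFun L σ)
  rw [key, setIntegral_Ico_eq_intervalIntegral hL.le]

/-- **Lower bound on the pairing**: `‖∫ q η‖ ≥ 1/16`. [folklore] -/
theorem norm_pairing_ge (hL : 0 < L) (hσ0 : 0 < σ) (hσ : σ ≤ 1 / 3) :
    (1 : ℝ) / 16 ≤
      ‖∫ X in cellN (m + 1) L, fibreCharge L e0 (realProd m (slabFactor L σ)) X * eta m L σ X‖ := by
  have hσ1 : σ ≤ 1 := hσ.trans (by norm_num)
  have hZ := slabZ_pos hL hσ0.le hσ1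
  have hZb := (slabZ_bounds hL hσ0.le hσ1).2
  have hL3 : 0 < L ^ 3 := by positivity
  rw [pairing_eq hL hσ0 hσ1, norm_mul, norm_mul, norm_inv, Complex.norm_real,
    Real.norm_of_nonneg (Real.sqrt_nonneg _), norm_pow, Complex.norm_real, Real.norm_of_nonneg hL.le]
  have h1 := norm_intervalIntegral_pairingFun_ge hL hσ0 hσ
  have hsq : Real.sqrt (slabZ L σ) ≤ Real.sqrt (L ^ 3) := Real.sqrt_le_sqrt hZb
  have hs3 : 0 < Real.sqrt (L ^ 3) := Real.sqrt_pos.2 hL3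
  have h2 : L / 16 / Real.sqrt (L ^ 3) ≤ ‖∫ t in (0 : ℝ)..L, pairingFun L σ t‖ :=
    le_trans (by gcongr) h1
  have hL3ne : L ^ 3 ≠ 0 := hL3.ne'
  have hinv : (Real.sqrt (L ^ 3))⁻¹ * (Real.sqrt (L ^ 3))⁻¹ = (L ^ 3)⁻¹ := by
    rw [← mul_inv, Real.mul_self_sqrt hL3.le]
  calc (1 : ℝ) / 16 = (L ^ 3 / 16) * (L ^ 3)⁻¹ := by field_simp
    _ = (L ^ 3 / 16) * ((Real.sqrt (L ^ 3))⁻¹ * (Real.sqrt (L ^ 3))⁻¹) := by rw [hinv]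
    _ = (Real.sqrt (L ^ 3))⁻¹ * (L ^ 2 * (L / 16 / Real.sqrt (L ^ 3))) := by ring
    _ ≤ (Real.sqrt (L ^ 3))⁻¹ * (L ^ 2 * ‖∫ t in (0 : ℝ)..L, pairingFun L σ t‖) := by gcongr

/-! #### The statements -/

/-- The crux's conclusion at fixed data `(L, n, Φ, C)`. -/
def FibreBoundAt (L : ℝ) (n : Fin 3 → ℤ) (Φ : PeriodicTrialState (m + 1) L) (C : ℝ) : Prop :=
  ∃ J : Config (m + 1) → Fin 3 → ℂ, IsFibreFlow m L (fibreCharge L n Φ.ψ) J ∧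
    fibreCost L Φ.ψ J ≤ ENNReal.ofReal (C * L ^ 2 / ‖(fun j => (n j : ℝ))‖ ^ 2)

/-- The crux with its constants exposed, for fixed `v`, `M`. -/
def FibreConductanceWith (ρ₀ C : ℝ) (N₀ : ℕ) (v : ℝ → ℝ≥0∞) (M : ℝ) : Prop :=
  ∀ m : ℕ, N₀ ≤ m + 1 → ∀ L : ℝ, 0 < L → ((m + 1 : ℕ) : ℝ) ≤ ρ₀ * L ^ 3 →
    ∀ n : Fin 3 → ℤ, n ≠ 0 → InWindow M m L n →
      ∀ Φ : PeriodicTrialState (m + 1) L,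
        periodicEnergy v Φ = periodicGroundStateEnergy v (m + 1) L → (∀ X, Φ.ψ X ≠ 0) →
          FibreBoundAt L n Φ C

/-- **The crux, verbatim, in named vocabulary** (definitional unfolding only). [folklore] -/
theorem fibreConductance_iff :
    Summit.AtomisticToContinuum.BoseEinsteinCondensation.Theses.BECThomsonPrinciple.FibreConductance ↔
      ∀ v : ℝ → ℝ≥0∞, IsRepulsiveFiniteRange v → (∃ B : ℝ, ∀ r, v r ≤ ENNReal.ofReal B) →
        ∀ M : ℝ, 0 < M → ∃ ρ₀ C : ℝ, 0 < ρ₀ ∧ 0 < C ∧ ∃ N₀ : ℕ, FibreConductanceWith ρ₀ C N₀ v M :=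
  Iff.rfl

/-- **(H1) relaxed to near-minimality.** The crux with `periodicEnergy v Φ = E₀` replaced by
`periodicEnergy v Φ ≤ E₀ + δ`, the slack `δ > 0` being at the disposal of the claimant together with
`ρ₀, C, N₀` (the weakest near-minimiser form of the crux). -/
def FibreConductanceNearMinimiser : Prop :=
  ∀ v : ℝ → ℝ≥0∞, IsRepulsiveFiniteRange v → (∃ B : ℝ, ∀ r, v r ≤ ENNReal.ofReal B) →
    ∀ M : ℝ, 0 < M → ∃ ρ₀ C : ℝ, 0 < ρ₀ ∧ 0 < C ∧ ∃ N₀ : ℕ, ∃ δ : ℝ≥0∞, 0 < δ ∧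
      ∀ m : ℕ, N₀ ≤ m + 1 → ∀ L : ℝ, 0 < L → ((m + 1 : ℕ) : ℝ) ≤ ρ₀ * L ^ 3 →
        ∀ n : Fin 3 → ℤ, n ≠ 0 → InWindow M m L n →
          ∀ Φ : PeriodicTrialState (m + 1) L,
            periodicEnergy v Φ ≤ periodicGroundStateEnergy v (m + 1) L + δ → (∀ X, Φ.ψ X ≠ 0) →
              FibreBoundAt L n Φ C

/-- **(H1) dropped.** The crux for all zero-free admissible states. -/
def FibreConductanceWithoutMinimiser : Prop :=
  ∀ v : ℝ → ℝ≥0∞, IsRepulsiveFiniteRange v → (∃ B : ℝ, ∀ r, v r ≤ ENNReal.ofReal B) →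
    ∀ M : ℝ, 0 < M → ∃ ρ₀ C : ℝ, 0 < ρ₀ ∧ 0 < C ∧ ∃ N₀ : ℕ,
      ∀ m : ℕ, N₀ ≤ m + 1 → ∀ L : ℝ, 0 < L → ((m + 1 : ℕ) : ℝ) ≤ ρ₀ * L ^ 3 →
        ∀ n : Fin 3 → ℤ, n ≠ 0 → InWindow M m L n →
          ∀ Φ : PeriodicTrialState (m + 1) L, (∀ X, Φ.ψ X ≠ 0) → FibreBoundAt L n Φ C

/-- Dropping (H1) is stronger than relaxing it. [folklore] -/
theorem fibreConductanceNearMinimiser_of_without (h : FibreConductanceWithoutMinimiser) :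
    FibreConductanceNearMinimiser := by
  intro v hv hB M hM
  obtain ⟨ρ₀, C, hρ, hC, N₀, hmain⟩ := h v hv hB M hM
  exact ⟨ρ₀, C, hρ, hC, N₀, 1, one_pos, fun m hm L hL hd n hn hw Φ _ hz => hmain m hm L hL hd n hn hw Φ hz⟩

/-- Relaxing (H1) is stronger than the crux. [folklore] -/
theorem fibreConductance_of_nearMinimiser (h : FibreConductanceNearMinimiser) :
    Summit.AtomisticToContinuum.BoseEinsteinCondensation.Theses.BECThomsonPrinciple.FibreConductance := by
  rw [fibreConductance_iff]
  intro v hv hB M hM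
  obtain ⟨ρ₀, C, hρ, hC, N₀, δ, _, hmain⟩ := h v hv hB M hM
  exact ⟨ρ₀, C, hρ, hC, N₀, fun m hm L hL hd n hn hw Φ hE hz =>
    hmain m hm L hL hd n hn hw Φ (hE ▸ le_self_add) hz⟩

/-- **MAIN NEGATIVE RESULT (cycle 2).** The exact-minimiser hypothesis (H1) of `FibreConductance`
cannot be relaxed to `δ`-near-minimality for ANY slack `δ > 0`, even one chosen after `v` and `M`:
for the free gas `v = 0` (admissible, bounded), at the ultra-dilute corner `L = M²N/4π²`, `n = e₀`
of the parameter window, the two-slab product state `Φ = φ^{⊗N}` (`φ = g(y₀)/√Z`, `g = σ` on the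
two barriers `{|sin 2πy₀/L| ≤ 1/2}`, `g = 1` on the chambers) is zero-free, has excess energy
`≤ N·1024π²K²/L² = O(1/N) → 0` (so it is `δ`-near-minimal for `N` large), its fibre charge is
`L^{-3/2} e₀(x₀)φ(x₀)` (`β₀ = 0` by `L/2`-periodicity), and Thomson duality with the test function
`η = f(x₀₀)∏_{j≠0}φ(xⱼ)²` (`f` = chamber selector, varying only inside the barriers) gives every
admissible flow the cost `≥ L²/(16384 π²K²σ²)`, which beats `C L²` for `σ` small. [folklore] -/
theorem not_fibreConductanceNearMinimiser : ¬ FibreConductanceNearMinimiser := by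
  intro h
  obtain ⟨K, hK1, hK⟩ := exists_bound_deriv_smoothTransition
  have hK0 : 0 < K := by linarith
  obtain ⟨ρ₀, C, hρ, hC, N₀, δ, hδ, hmain⟩ :=
    h 0 isRepulsiveFiniteRange_zero ⟨0, fun r => by simp⟩ 1 one_pos
  -- choice of `N`
  set T₂ : ℝ := if δ = ⊤ then 0 else 16384 * π ^ 6 * K ^ 2 / δ.toReal with hT₂
  obtain ⟨m, hmN, hmT⟩ := exists_large N₀ (max (64 * π ^ 6 / (ρ₀ * 1 ^ 6)) T₂)
  obtain ⟨hL, hdens, hwin⟩ := corner one_pos hρ m ((le_max_left _ _).trans hmT)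
  set L : ℝ := 1 ^ 2 * ((m + 1 : ℕ) : ℝ) / (4 * π ^ 2) with hLdef
  set N : ℝ := ((m + 1 : ℕ) : ℝ) with hNdef
  have hN1 : (1 : ℝ) ≤ N := by rw [hNdef]; exact_mod_cast Nat.succ_le_succ (Nat.zero_le m)
  have hNpos : 0 < N := by linarith
  -- choice of the depth `σ`
  set σ : ℝ := min (1 / 3) (1 / (200 * π * K * (C + 1))) with hσdef
  have hσ0 : 0 < σ := lt_min (by norm_num) (by positivity)
  have hσ3 : σ ≤ 1 / 3 := min_le_left _ _
  have hσ1 : σ ≤ 1 := hσ3.trans (by norm_num)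
  have hσC : σ ≤ 1 / (200 * π * K * (C + 1)) := min_le_right _ _
  -- the state
  set Φ := slabState m hL hσ0 hσ1 with hΦ
  have hE : periodicEnergy 0 Φ ≤ periodicGroundStateEnergy 0 (m + 1) L + δ := by
    rw [periodicGroundStateEnergy_zero m hL, zero_add]
    refine (periodicEnergy_slabState_le hL hσ0 hσ1 hK).trans ?_
    by_cases hδt : δ = ⊤
    · rw [hδt]; exact le_top
    · have hδr : 0 < δ.toReal := ENNReal.toReal_pos hδ.ne' hδt
      have hT : 16384 * π ^ 6 * K ^ 2 / δ.toReal ≤ N := by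
        have := (le_max_right _ _).trans hmT
        rwa [hT₂, if_neg hδt] at this
      rw [← ENNReal.ofReal_toReal hδt]
      apply ENNReal.ofReal_le_ofReal
      rw [← hNdef]
      have hLN : L = N / (4 * π ^ 2) := by rw [hLdef]; ring
      have e : N * (1024 * π ^ 2 * K ^ 2 / L ^ 2) = 16384 * π ^ 6 * K ^ 2 / N := by
        rw [hLN]; field_simp; ring
      rw [e, div_le_iff₀ hNpos]
      have h' := (div_le_iff₀ hδr).mp hT
      nlinarith [h']
  have hz : ∀ X, Φ.ψ X ≠ 0 := slabState_ne_zero hL hσ0 hσ1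
  obtain ⟨J, hJ, hcost⟩ := hmain m hmN L hL hdens e0 e0_ne_zero hwin Φ hE hz
  -- the cost in the form of the duality tool
  rw [norm_e0, one_pow, div_one] at hcost
  have hφpos := slabFactor_pos hL hσ0 hσ1
  have hcost' : ∫⁻ X in cellN (m + 1) L, ENNReal.ofReal ((∑ l : Fin 3, ‖J X l‖ ^ 2) *
      (bathProd (slabFactor L σ) X / slabFactor L σ (X 0) ^ 2)) ≤ ENNReal.ofReal (C * L ^ 2) := by
    rw [← fibreCost_realProd hφpos (integral_sq_slabFactor hL hσ0.le hσ1)]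
    exact hcost
  have hw : ∀ X : Config (m + 1), 0 < bathProd (slabFactor L σ) X / slabFactor L σ (X 0) ^ 2 :=
    fun X => div_pos (bathProd_pos hφpos X) (pow_pos (hφpos _) 2)
  have hwm : Measurable fun X : Config (m + 1) => bathProd (slabFactor L σ) X / slabFactor L σ (X 0) ^ 2 := by
    refine Measurable.div (Finset.measurable_prod _ fun j _ => ?_) ?_
    · exact ((continuous_slabFactor L σ).pow 2).measurable.comp (measurable_pi_apply j)
    · exact ((continuous_slabFactor L σ).pow 2).measurable.comp (measurable_pi_apply 0)
  have key := norm_pairing_sq_le hJ (contDiff_eta (σ := σ)) (eta_periodic hL.ne') hw hwm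
    (by positivity) (by positivity) hcost' (lintegral_dual_le hL hσ0 hσ1 hK)
  have low := norm_pairing_ge (m := m) hL hσ0 hσ3
  -- contradiction: (1/16)² ≤ C L² · 64π²K²σ²/L² = 64π²K²Cσ² < 1/256
  have h1 : (1 / 16 : ℝ) ^ 2 ≤ C * L ^ 2 * (64 * π ^ 2 * K ^ 2 * σ ^ 2 / L ^ 2) :=
    (pow_le_pow_left₀ (by norm_num) low 2).trans key
  have h2 : C * L ^ 2 * (64 * π ^ 2 * K ^ 2 * σ ^ 2 / L ^ 2) = 64 * π ^ 2 * K ^ 2 * C * σ ^ 2 := by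
    field_simp
  rw [h2] at h1
  have h3 : σ * (200 * π * K * (C + 1)) ≤ 1 := by
    rwa [le_div_iff₀ (by positivity)] at hσC
  have h4 : 64 * π ^ 2 * K ^ 2 * C * σ ^ 2 < (1 / 16 : ℝ) ^ 2 := by
    have h5 : (σ * (200 * π * K * (C + 1))) ^ 2 ≤ 1 := by
      have := pow_le_pow_left₀ (by positivity) h3 2; rwa [one_pow] at this
    have hC1 : C < (C + 1) ^ 2 := by nlinarith
    nlinarith [h5, hC1, Real.pi_pos, hK0, hσ0]
  linarith

/-- **Corollary (cycle-1 §G2 re-derived, now a one-liner).** (H1) cannot be dropped. [folklore] -/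
theorem not_fibreConductanceWithoutMinimiser : ¬ FibreConductanceWithoutMinimiser :=
  fun h => not_fibreConductanceNearMinimiser (fibreConductanceNearMinimiser_of_without h)

end Main

/-! ### Tightness: at `v = 0` no constant below `1/4π²` works -/

section Tight

open Real
open Summit.AtomisticToContinuum.BoseEinsteinCondensation.Theorems.GaussianDominationCan.Negative

variable {m : ℕ} {L : ℝ} {n : Fin 3 → ℤ}

/-- The factors of the plane-wave test function `η(X) = e_{-n}(x₀)`. [folklore] -/
def waveTestFactors (m : ℕ) (L : ℝ) (n : Fin 3 → ℤ) : Fin (m + 1) → Space → ℂ := fun j =>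
  if j = 0 then oneBody L (-n) 0 1 else fun _ => 1

/-- The plane-wave test function `η(X) = e_{-n}(x₀)` as a product function. [folklore] -/
def waveTest (m : ℕ) (L : ℝ) (n : Fin 3 → ℤ) : Config (m + 1) → ℂ := prodFun (waveTestFactors m L n)

/-- The `0`-th factor is `e_{-n}`. [folklore] -/
theorem waveTestFactors_zero : waveTestFactors m L n 0 = oneBody L (-n) 0 1 := by
  simp [waveTestFactors]

/-- The other factors are `1`. [folklore] -/
theorem waveTestFactors_of_ne {j : Fin (m + 1)} (hj : j ≠ 0) : waveTestFactors m L n j = fun _ => 1 := by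
  simp [waveTestFactors, hj]

/-- `e_{-n} = 0 + 1·e_{-n}` evaluated. [folklore] -/
theorem oneBody_zero_one (L : ℝ) (n : Fin 3 → ℤ) (x : Space) : oneBody L (-n) 0 1 x = cellWave L (-n) x := by
  unfold oneBody; push_cast; ring

/-- Every factor is `C¹`. [folklore] -/
theorem contDiff_waveTestFactors (j : Fin (m + 1)) : ContDiff ℝ 1 (waveTestFactors m L n j) := by
  by_cases hj : j = 0
  · subst hj; rw [waveTestFactors_zero]; exact contDiff_oneBody L (-n) 0 1
  · rw [waveTestFactors_of_ne hj]; exact contDiff_const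

/-- Every factor is differentiable. [folklore] -/
theorem differentiable_waveTestFactors (j : Fin (m + 1)) : Differentiable ℝ (waveTestFactors m L n j) :=
  (contDiff_waveTestFactors j).differentiable one_ne_zero

/-- `η` is `C¹`. [folklore] -/
theorem contDiff_waveTest : ContDiff ℝ 1 (waveTest m L n) := contDiff_prodFun contDiff_waveTestFactors

/-- `η` is `Lℤ³`-periodic in every particle. [folklore] -/
theorem waveTest_periodic (hL : L ≠ 0) (X : Config (m + 1)) (i : Fin (m + 1)) (k : Fin 3) :
    waveTest m L n (X + Pi.single i (EuclideanSpace.single k L)) = waveTest m L n X := by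
  refine prodFun_periodic (fun j y k => ?_) X i k
  by_cases hj : j = 0
  · subst hj; rw [waveTestFactors_zero]; exact oneBody_periodic hL 0 1 y k
  · rw [waveTestFactors_of_ne hj]

/-- The bath part of `η` is `1`. [folklore] -/
theorem prod_erase_waveTestFactors (X : Config (m + 1)) :
    ∏ j ∈ Finset.univ.erase (0 : Fin (m + 1)), waveTestFactors m L n j (X j) = 1 :=
  Finset.prod_eq_one fun j hj => by rw [waveTestFactors_of_ne (Finset.ne_of_mem_erase hj)]

/-- `η(X) = e_{-n}(x₀)`. [folklore] -/
theorem waveTest_apply (X : Config (m + 1)) : waveTest m L n X = cellWave L (-n) (X 0) := by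
  rw [waveTest, prodFun_eq_mul_erase _ 0, prod_erase_waveTestFactors, mul_one, waveTestFactors_zero,
    oneBody_zero_one]

/-- **Dual energy density of the plane-wave test**: `Σₗ |∂_{0,l} e_{-n}(x₀)|² = 4π²|n|²/L²`. [folklore] -/
theorem sum_norm_sq_fderiv_waveTest (hL : 0 < L) (X : Config (m + 1)) :
    ∑ l : Fin 3, ‖fderiv ℝ (waveTest m L n) X (Pi.single 0 (EuclideanSpace.single l (1 : ℝ)))‖ ^ 2 =
      4 * π ^ 2 * nsq n / L ^ 2 := by
  unfold waveTest
  have hn : ∀ l : Fin 3,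
      ‖fderiv ℝ (prodFun (waveTestFactors m L n)) X (Pi.single 0 (EuclideanSpace.single l (1 : ℝ)))‖ =
        2 * π * |(n l : ℝ)| / L := by
    intro l
    rw [fderiv_prodFun differentiable_waveTestFactors X 0, prod_erase_waveTestFactors, one_mul,
      waveTestFactors_zero, fderiv_oneBody_single, norm_mul, norm_mul, norm_waveCoeff (n := -n) hL l,
      norm_cellWave, Complex.norm_real, norm_one, one_mul, mul_one, Pi.neg_apply, Int.cast_neg, abs_neg]
  simp_rw [hn, div_pow, mul_pow, sq_abs]
  unfold nsq
  rw [Finset.mul_sum, Finset.sum_div]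
  refine Finset.sum_congr rfl fun l _ => ?_
  ring

/-- `∫_cell c² = c² L³`. [folklore] -/
theorem integral_cell_const_sq (hL : 0 ≤ L) (c : ℝ) : ∫ _y in cell L, c ^ 2 = c ^ 2 * L ^ 3 := by
  rw [setIntegral_const, volume_real_cell hL, smul_eq_mul, mul_comm]

/-- The constant state is the real product of the constant factor. [folklore] -/
theorem constState_ψ_eq_realProd (hL : 0 < L) {c : ℝ} (hc : c ^ 2 * L ^ 3 = 1) :
    (constState m hL c hc).ψ = realProd m (fun _ => c) := rfl

/-- The bath factor of the constant profile: `∏_{j≠0} c² = (c²)^m`. [folklore] -/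
theorem bathProd_const (c : ℝ) (X : Config (m + 1)) : bathProd (fun _ : Space => c) X = (c ^ 2) ^ m := by
  unfold bathProd
  rw [Finset.prod_const, Finset.card_erase_of_mem (Finset.mem_univ _), Finset.card_univ, Fintype.card_fin,
    Nat.add_sub_cancel]

/-- `∫⁻_{cell^N} r = r · L^{3N}` (`ℝ≥0∞`). [folklore] -/
theorem setLIntegral_cellN_const' (hL : 0 ≤ L) (r : ℝ≥0∞) :
    ∫⁻ _X in cellN (m + 1) L, r = r * ENNReal.ofReal ((L ^ 3) ^ (m + 1)) := by
  rw [setLIntegral_const, volume_cellN, ← ENNReal.ofReal_pow hL, ← ENNReal.ofReal_pow (by positivity)]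

/-- `∫_{cell^N} c = L^{3N} c` (complex). [folklore] -/
theorem setIntegral_cellN_const' (hL : 0 ≤ L) (c : ℂ) :
    ∫ _X in cellN (m + 1) L, c = (((L ^ 3) ^ (m + 1) : ℝ) : ℂ) * c := by
  rw [setIntegral_const, Measure.real, volume_cellN, ← ENNReal.ofReal_pow hL,
    ← ENNReal.ofReal_pow (pow_nonneg hL 3), ENNReal.toReal_ofReal (by positivity), Complex.real_smul]

/-- **TIGHTNESS AT THE FREE GAS.** Any constant `C` for which the crux's conclusion holds at
`v = 0` (for some `ρ₀ > 0`, `N₀`, and a window parameter `M > 0`) satisfies `C ≥ 1/4π²`: at the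
constant state (an exact zero-free minimiser) the charge is `q = L^{-3} e_n(x₀)`, and Thomson
duality with the test function `η = e_{-n}(x₀)` gives every admissible flow the cost
`≥ L²/(4π²|n|₂²)`, i.e. `≥ L²/4π²` at `n = e₀` — the free value `1/k²` is the FLOOR of the
bath-averaged fibre resistance; interactions can only push `C` up. [folklore] -/
theorem fibreConductanceWith_zero_const_ge {ρ₀ C M : ℝ} {N₀ : ℕ} (hM : 0 < M) (hρ : 0 < ρ₀) (hC : 0 ≤ C)
    (h : FibreConductanceWith ρ₀ C N₀ 0 M) : 1 / (4 * π ^ 2) ≤ C := by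
  obtain ⟨m, hmN, hmT⟩ := exists_large N₀ (64 * π ^ 6 / (ρ₀ * M ^ 6))
  obtain ⟨hL, hdens, hwin⟩ := corner hM hρ m hmT
  set L : ℝ := M ^ 2 * ((m + 1 : ℕ) : ℝ) / (4 * π ^ 2) with hLdef
  have hL3 : 0 < L ^ 3 := by positivity
  -- the constant state
  set c : ℝ := (Real.sqrt (L ^ 3))⁻¹ with hcdef
  have hcpos : 0 < c := inv_pos.2 (Real.sqrt_pos.2 hL3)
  have hc2 : c ^ 2 = (L ^ 3)⁻¹ := by rw [hcdef, inv_pow, Real.sq_sqrt hL3.le]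
  have hc : c ^ 2 * L ^ 3 = 1 := by rw [hc2, inv_mul_cancel₀ hL3.ne']
  set Φ := constState m hL c hc with hΦ
  have hE : periodicEnergy 0 Φ = periodicGroundStateEnergy 0 (m + 1) L := by
    rw [periodicEnergy_constState hL hc, periodicGroundStateEnergy_zero m hL]
  have hz : ∀ X, Φ.ψ X ≠ 0 := by
    intro X
    rw [hΦ, constState_ψ_eq_realProd hL hc, ← norm_pos_iff, norm_realProd (fun _ => hcpos)]
    exact Finset.prod_pos fun _ _ => hcpos
  obtain ⟨J, hJ, hcost⟩ := h m hmN L hL hdens e0 e0_ne_zero hwin Φ hE hz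
  rw [norm_e0, one_pow, div_one] at hcost
  -- cost in duality form
  have hnorm1 : ∫ y in cell L, (fun _ : Space => c) y ^ 2 = 1 := by
    show ∫ _y in cell L, c ^ 2 = 1
    rw [integral_cell_const_sq hL.le, hc]
  have hφpos : ∀ y : Space, 0 < (fun _ : Space => c) y := fun _ => hcpos
  have hcost' : ∫⁻ X in cellN (m + 1) L, ENNReal.ofReal ((∑ l : Fin 3, ‖J X l‖ ^ 2) *
      (bathProd (fun _ : Space => c) X / (fun _ : Space => c) (X 0) ^ 2)) ≤ ENNReal.ofReal (C * L ^ 2) := by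
    rw [← fibreCost_realProd hφpos hnorm1]
    exact hcost
  have hw : ∀ X : Config (m + 1), 0 < bathProd (fun _ : Space => c) X / (fun _ : Space => c) (X 0) ^ 2 :=
    fun X => div_pos (bathProd_pos hφpos X) (pow_pos hcpos 2)
  have hwm : Measurable fun X : Config (m + 1) =>
      bathProd (fun _ : Space => c) X / (fun _ : Space => c) (X 0) ^ 2 := by
    simp_rw [bathProd_const]
    exact measurable_const
  -- the dual energy of `η = e_{-e₀}(x₀)`
  set D : ℝ := 4 * π ^ 2 / L ^ 2 * (c ^ 2 / (c ^ 2) ^ m) * (L ^ 3) ^ (m + 1) with hD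
  have hD0 : 0 ≤ D := by positivity
  have hdual : ∫⁻ X in cellN (m + 1) L, ENNReal.ofReal
      ((∑ l : Fin 3, ‖fderiv ℝ (waveTest m L e0) X (Pi.single 0 (EuclideanSpace.single l (1 : ℝ)))‖ ^ 2) /
        (bathProd (fun _ : Space => c) X / (fun _ : Space => c) (X 0) ^ 2)) ≤ ENNReal.ofReal D := by
    simp_rw [sum_norm_sq_fderiv_waveTest hL, nsq_e0, bathProd_const]
    rw [setLIntegral_cellN_const' hL.le, ← ENNReal.ofReal_mul (by positivity), hD]
    apply le_of_eq
    congr 1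
    field_simp
  -- the pairing `∫ q η = L^{-3/2} c L^{3N}`
  have hβ : ∫ y in cell L, wave L e0 y * (((fun _ : Space => c) y : ℝ) : ℂ) = 0 := by
    show ∫ y in cell L, wave L e0 y * (c : ℂ) = 0
    simp_rw [wave_eq_cellWave]
    rw [integral_mul_const, integral_cell_cellWave_eq_zero hL e0_ne_zero, zero_mul]
  have hpair : ∫ X in cellN (m + 1) L, fibreCharge L e0 (realProd m (fun _ : Space => c)) X * waveTest m L e0 X =
      ((Real.sqrt (L ^ 3))⁻¹ : ℂ) * (c : ℂ) * ((((L ^ 3) ^ (m + 1) : ℝ)) : ℂ) := by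
    have hpt : ∀ X : Config (m + 1),
        fibreCharge L e0 (realProd m (fun _ : Space => c)) X * waveTest m L e0 X =
          ((Real.sqrt (L ^ 3))⁻¹ : ℂ) * (c : ℂ) := by
      intro X
      rw [fibreCharge_realProd hφpos hnorm1, hβ, zero_mul, sub_zero, waveTest_apply, wave_eq_cellWave]
      have h1 : cellWave L e0 (X 0) * cellWave L (-e0) (X 0) = 1 := by
        rw [← cellWave_add_index, add_neg_cancel, cellWave_zero]
      calc ((Real.sqrt (L ^ 3))⁻¹ : ℂ) * (cellWave L e0 (X 0) * (((fun _ : Space => c) (X 0) : ℝ) : ℂ)) *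
            cellWave L (-e0) (X 0)
          = ((Real.sqrt (L ^ 3))⁻¹ : ℂ) * (c : ℂ) * (cellWave L e0 (X 0) * cellWave L (-e0) (X 0)) := by ring
        _ = ((Real.sqrt (L ^ 3))⁻¹ : ℂ) * (c : ℂ) := by rw [h1, mul_one]
    simp_rw [hpt]
    rw [setIntegral_cellN_const' hL.le]
    ring
  have key := norm_pairing_sq_le hJ (contDiff_waveTest (n := e0)) (waveTest_periodic hL.ne') hw hwm
    (by positivity) hD0 hcost' hdual
  have hpair' : ∫ X in cellN (m + 1) L, fibreCharge L e0 Φ.ψ X * waveTest m L e0 X =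
      ((Real.sqrt (L ^ 3))⁻¹ : ℂ) * (c : ℂ) * ((((L ^ 3) ^ (m + 1) : ℝ)) : ℂ) := hpair
  rw [hpair'] at key
  -- evaluate both sides
  set V : ℝ := (L ^ 3) ^ (m + 1) with hV
  have hVpos : 0 < V := by positivity
  have hA : ‖((Real.sqrt (L ^ 3))⁻¹ : ℂ) * (c : ℂ) * ((V : ℝ) : ℂ)‖ ^ 2 = c ^ 2 * c ^ 2 * V ^ 2 := by
    rw [norm_mul, norm_mul, norm_inv, Complex.norm_real, Complex.norm_real, Complex.norm_real,
      Real.norm_of_nonneg (Real.sqrt_nonneg _), Real.norm_of_nonneg hcpos.le, Real.norm_of_nonneg hVpos.le,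
      ← hcdef]
    ring
  rw [hA, hD] at key
  -- `c² c² V² ≤ C L² · 4π²/L² · c²/(c²)^m · V`, and `(c²)^m · L³... = V⁻¹ L³`: reduce to `1 ≤ 4π² C`
  have hc2m : (c ^ 2) ^ m * V = L ^ 3 := by
    rw [hc2, hV, inv_pow, pow_succ (L ^ 3) m, ← mul_assoc, inv_mul_cancel₀ (by positivity), one_mul]
  have hc2pos : 0 < c ^ 2 := by positivity
  have hcm : 0 < (c ^ 2) ^ m := by positivity
  have key2 : c ^ 2 * c ^ 2 * V ^ 2 * (c ^ 2) ^ m ≤ C * (4 * π ^ 2) * c ^ 2 * V := by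
    have := mul_le_mul_of_nonneg_right key hcm.le
    have e : C * L ^ 2 * (4 * π ^ 2 / L ^ 2 * (c ^ 2 / (c ^ 2) ^ m) * V) * (c ^ 2) ^ m =
        C * (4 * π ^ 2) * c ^ 2 * V := by
      field_simp
    linarith [this, e.le, e.ge]
  -- substitute `(c²)^m V = L³` and `c² L³ = 1`
  have key3 : c ^ 2 * V * (c ^ 2 * ((c ^ 2) ^ m * V)) ≤ C * (4 * π ^ 2) * (c ^ 2 * V) := by
    nlinarith [key2]
  rw [hc2m, hc, mul_one] at key3
  have hcV : 0 < c ^ 2 * V := by positivity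
  have : 1 ≤ C * (4 * π ^ 2) := le_of_mul_le_mul_right (by linarith [key3]) hcV
  rw [div_le_iff₀ (by positivity)]
  linarith

/-- **The sharp-constant strengthening.** The crux with a UNIVERSAL constant `c < 1/4π²`
(one `c` for all admissible bounded `v` and all `M`, the rest of the quantifiers as in the crux). -/
def FibreConductanceSharp : Prop :=
  ∃ c : ℝ, c < 1 / (4 * π ^ 2) ∧
    ∀ v : ℝ → ℝ≥0∞, IsRepulsiveFiniteRange v → (∃ B : ℝ, ∀ r, v r ≤ ENNReal.ofReal B) →
      ∀ M : ℝ, 0 < M → ∃ ρ₀ : ℝ, 0 < ρ₀ ∧ ∃ N₀ : ℕ, FibreConductanceWith ρ₀ c N₀ v M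

/-- **No universal constant below `1/4π²`** (cycle-1 §E re-derived from the duality tool): the
free gas already needs `C ≥ 1/4π²`. [folklore] -/
theorem not_fibreConductanceSharp : ¬ FibreConductanceSharp := by
  rintro ⟨c, hc, h⟩
  obtain ⟨ρ₀, hρ, N₀, hW⟩ := h 0 isRepulsiveFiniteRange_zero ⟨0, fun r => by simp⟩ 1 one_pos
  by_cases hc0 : 0 ≤ c
  · exact absurd (fibreConductanceWith_zero_const_ge one_pos hρ hc0 hW) (not_le.2 hc)
  · -- a negative constant makes the cost bound `≤ ofReal (negative) = 0`; still `≥ 1/4π²` is violated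
    push Not at hc0
    have hW' : FibreConductanceWith ρ₀ 0 N₀ 0 1 := by
      intro m hm L hL hd n hn hw Φ hE hz
      obtain ⟨J, hJ, hcost⟩ := hW m hm L hL hd n hn hw Φ hE hz
      refine ⟨J, hJ, hcost.trans (ENNReal.ofReal_le_ofReal ?_)⟩
      exact div_le_div_of_nonneg_right (mul_le_mul_of_nonneg_right hc0.le (sq_nonneg _)) (sq_nonneg _)
    have := fibreConductanceWith_zero_const_ge one_pos hρ le_rfl hW'
    have hπ : 0 < 1 / (4 * π ^ 2) := by positivity
    linarith

end Tight

/-! ### The free constant is attained: the canonical flow at the constant state -/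

section CanonicalFlow

open Real
open Summit.AtomisticToContinuum.BoseEinsteinCondensation.Theorems.GaussianDominationCan.Negative
variable {m : ℕ} {L : ℝ} {n : Fin 3 → ℤ}

/-- Chain rule for slices (complex-valued): the `e_k`-derivative of `y ↦ G(insertNth i y Y)` is the
`(i,k)` partial derivative of `G`. [folklore] -/
theorem fderiv_slice_apply_complex {N : ℕ} {G : Config (N + 1) → ℂ} (hG : Differentiable ℝ G)
    (i : Fin (N + 1)) (k : Fin 3) (Y : Fin N → Space) (x : Space) :
    fderiv ℝ (fun y : Space => G (Fin.insertNth (α := fun _ => Space) i y Y)) x (EuclideanSpace.single k 1) =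
      fderiv ℝ G (Fin.insertNth (α := fun _ => Space) i x Y) (Pi.single i (EuclideanSpace.single k 1)) := by
  have h := ((hG _).hasFDerivAt.comp x
    (hasFDerivAt_insertNth i Y x)).fderiv
  rw [show (fun y : Space => G (Fin.insertNth (α := fun _ => Space) i y Y)) =
      G ∘ fun y : Space => (Fin.insertNth (α := fun _ => Space) i y Y : Config (N + 1)) from rfl, h,
    ContinuousLinearMap.comp_apply, pi_single_id_apply]

/-- **Integration by parts on the `N`-particle torus, complex form**: `∫_{[0,L)^{3N}} ∂_{i,k} G = 0`
for a `C¹` complex function that is `Lℤ³`-periodic in every particle (Fubini in particle `i`, then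
the one-particle `integral_cell_fderiv_eq_zero`). [folklore] -/
theorem integral_cellN_fderiv_eq_zero {N : ℕ} (hL : 0 < L) {G : Config (N + 1) → ℂ} (hG : ContDiff ℝ 1 G)
    (hper : ∀ (X : Config (N + 1)) (j : Fin (N + 1)) (l : Fin 3),
      G (X + Pi.single j (EuclideanSpace.single l L)) = G X)
    (i : Fin (N + 1)) (k : Fin 3) :
    ∫ X in cellN (N + 1) L, fderiv ℝ G X (Pi.single i (EuclideanSpace.single k 1)) = 0 := by
  have hGd : Differentiable ℝ G := hG.differentiable one_ne_zero
  set P : Config (N + 1) → ℂ := fun X => fderiv ℝ G X (Pi.single i (EuclideanSpace.single k 1)) with hP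
  have hPc : Continuous P := (hG.continuous_fderiv one_ne_zero).clm_apply continuous_const
  set e := MeasurableEquiv.piFinSuccAbove (fun _ : Fin (N + 1) => Space) i with he
  have hmp : MeasurePreserving e.symm (volume.prod volume) volume :=
    (volume_preserving_piFinSuccAbove (fun _ : Fin (N + 1) => Space) i).symm
  have hesymm : ∀ z : Space × (Fin N → Space),
      e.symm z = Fin.insertNth (α := fun _ => Space) i z.1 z.2 := by
    intro z
    rw [he, MeasurableEquiv.piFinSuccAbove_symm_apply]
    funext j
    exact Fin.insertNthEquiv_apply _ _ _ _
  have hpre : e.symm ⁻¹' cellN (N + 1) L = cell L ×ˢ cellN N L := by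
    ext ⟨x, Y⟩
    simp only [Set.mem_preimage, hesymm, Set.mem_prod, cellN, Set.mem_setOf_eq]
    rw [Fin.forall_iff_succAbove i]
    simp [Fin.insertNth_apply_same, Fin.insertNth_apply_succAbove]
  have h1 : ∫ X in cellN (N + 1) L, P X =
      ∫ z in cell L ×ˢ cellN N L, P (Fin.insertNth (α := fun _ => Space) i z.1 z.2) ∂(volume.prod volume) := by
    rw [← hpre, ← hmp.setIntegral_preimage_emb e.symm.measurableEmbedding]
    simp only [hesymm]
  show ∫ X in cellN (N + 1) L, P X = 0
  rw [h1, ← Measure.prod_restrict]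
  have hint : Integrable
      (fun z : Space × (Fin N → Space) => P (Fin.insertNth (α := fun _ => Space) i z.1 z.2))
      ((volume.restrict (cell L)).prod (volume.restrict (cellN N L))) := by
    rw [Measure.prod_restrict, ← hpre]
    have hio : IntegrableOn P (cellN (N + 1) L) volume := integrableOn_cellN hPc L
    have h2 := (hmp.integrableOn_comp_preimage e.symm.measurableEmbedding).2 hio
    simpa only [IntegrableOn, Function.comp_def, hesymm] using h2
  rw [integral_prod_symm _ hint]
  refine integral_eq_zero_of_ae (Filter.Eventually.of_forall fun Y => ?_)
  have hg : ContDiff ℝ 1 (fun y : Space => G (Fin.insertNth (α := fun _ => Space) i y Y)) :=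
    hG.comp (contDiff_insertNth i Y)
  have hgper : ∀ (y : Space) (l : Fin 3),
      G (Fin.insertNth (α := fun _ => Space) i (y + EuclideanSpace.single l L) Y) =
        G (Fin.insertNth (α := fun _ => Space) i y Y) := by
    intro y l
    rw [insertNth_add_eq, hper]
  have h0 := integral_cell_fderiv_eq_zero hL hg hgper k
  simp_rw [fderiv_slice_apply_complex hGd i k Y] at h0
  exact h0

/-- **Moving a derivative off the test function**: for `C¹` periodic `η`,
`∫ e_n(x₀) ∂_{0,l}η = -(2πi n_l/L) ∫ e_n(x₀) η`. [folklore] -/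
theorem integral_cellWave_mul_fderiv (hL : 0 < L) {η : Config (m + 1) → ℂ} (hη : ContDiff ℝ 1 η)
    (hper : ∀ (X : Config (m + 1)) (j : Fin (m + 1)) (l : Fin 3),
      η (X + Pi.single j (EuclideanSpace.single l L)) = η X) (l : Fin 3) :
    ∫ X in cellN (m + 1) L, cellWave L n (X 0) * fderiv ℝ η X (Pi.single 0 (EuclideanSpace.single l 1)) =
      -(2 * π * Complex.I * (n l) / L) * ∫ X in cellN (m + 1) L, cellWave L n (X 0) * η X := by
  -- the product `G = e_n(x₀) η`
  set w : Config (m + 1) → ℂ := fun X => cellWave L n (X 0) with hw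
  have hwd : ContDiff ℝ 1 w :=
    ((contDiff_cellWave L n).of_le (mod_cast le_top)).comp (contDiff_apply ℝ Space 0)
  have hG : ContDiff ℝ 1 (fun X => w X * η X) := hwd.mul hη
  have hGper : ∀ (X : Config (m + 1)) (j : Fin (m + 1)) (l : Fin 3),
      w (X + Pi.single j (EuclideanSpace.single l L)) * η (X + Pi.single j (EuclideanSpace.single l L)) =
        w X * η X := by
    intro X j l'
    rw [hper]
    congr 1
    simp only [hw, Pi.add_apply]
    by_cases hj : j = 0
    · subst hj; rw [Pi.single_eq_same, cellWave_periodic hL.ne']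
    · rw [Pi.single_eq_of_ne (Ne.symm hj), add_zero]
  have hIBP := integral_cellN_fderiv_eq_zero hL hG hGper 0 l
  -- product rule
  have hwderiv : ∀ X : Config (m + 1), fderiv ℝ w X (Pi.single 0 (EuclideanSpace.single l 1)) =
      (2 * π * Complex.I * (n l) / L) * cellWave L n (X 0) := by
    intro X
    have hc := ((contDiff_cellWave L n).differentiable (by simp) (X 0)).hasFDerivAt.comp X
      (hasFDerivAt_apply (𝕜 := ℝ) 0 X)
    rw [show w = cellWave L n ∘ (fun f : Config (m + 1) => f 0) from rfl, hc.fderiv,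
      ContinuousLinearMap.comp_apply]
    show fderiv ℝ (cellWave L n) (X 0) ((Pi.single 0 (EuclideanSpace.single l (1 : ℝ)) : Config (m + 1)) 0) = _
    rw [Pi.single_eq_same, fderiv_cellWave_apply_single]
  have hprod : ∀ X : Config (m + 1), fderiv ℝ (fun X => w X * η X) X (Pi.single 0 (EuclideanSpace.single l 1)) =
      (2 * π * Complex.I * (n l) / L) * cellWave L n (X 0) * η X +
        cellWave L n (X 0) * fderiv ℝ η X (Pi.single 0 (EuclideanSpace.single l 1)) := by
    intro X
    have h := (((hwd.differentiable one_ne_zero) X).hasFDerivAt.mul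
      ((hη.differentiable one_ne_zero) X).hasFDerivAt).fderiv
    show (fderiv ℝ (w * η) X) (Pi.single 0 (EuclideanSpace.single l 1)) = _
    rw [h, _root_.add_apply, smul_apply, smul_apply, hwderiv, smul_eq_mul, smul_eq_mul]
    simp only [hw]
    ring
  simp_rw [hprod] at hIBP
  have hi1 : Integrable (fun X => (2 * π * Complex.I * (n l) / L) * cellWave L n (X 0) * η X)
      (volume.restrict (cellN (m + 1) L)) := by
    refine integrableOn_cellN ?_ L
    exact (continuous_const.mul (hwd.continuous)).mul hη.continuous
  have hi2 : Integrable (fun X => cellWave L n (X 0) * fderiv ℝ η X (Pi.single 0 (EuclideanSpace.single l 1)))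
      (volume.restrict (cellN (m + 1) L)) := by
    refine integrableOn_cellN ?_ L
    exact hwd.continuous.mul ((hη.continuous_fderiv one_ne_zero).clm_apply continuous_const)
  rw [integral_add hi1 hi2] at hIBP
  simp_rw [mul_assoc] at hIBP
  rw [integral_const_mul] at hIBP
  linear_combination hIBP

/-- The wave-number components `k_l = 2πn_l/L`. [folklore] -/
def kcomp (L : ℝ) (n : Fin 3 → ℤ) (l : Fin 3) : ℝ := 2 * π * (n l) / L

/-- `|k|² = 4π²|n|²/L²`. [folklore] -/
def ksq (L : ℝ) (n : Fin 3 → ℤ) : ℝ := 4 * π ^ 2 * nsq n / L ^ 2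

/-- `Σ_l k_l² = |k|²`. [folklore] -/
theorem sum_kcomp_sq (L : ℝ) (n : Fin 3 → ℤ) : ∑ l, kcomp L n l ^ 2 = ksq L n := by
  unfold kcomp ksq nsq
  rw [Finset.mul_sum, Finset.sum_div]
  refine Finset.sum_congr rfl fun l _ => ?_
  ring

/-- `|n|² ≥ 1 > 0` for `n ≠ 0`. [folklore] -/
theorem nsq_pos (hn : n ≠ 0) : 0 < nsq n := by
  obtain ⟨j, hj⟩ := Function.ne_iff.1 hn
  have h1 : (1 : ℝ) ≤ (n j : ℝ) ^ 2 := by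
    have : (1 : ℤ) ≤ n j ^ 2 := by nlinarith [Int.one_le_abs hj, sq_abs (n j)]
    exact_mod_cast this
  exact lt_of_lt_of_le one_pos (h1.trans (Finset.single_le_sum (f := fun j => (n j : ℝ) ^ 2)
    (fun i _ => sq_nonneg _) (Finset.mem_univ j)))

/-- `|k|² > 0` for `n ≠ 0`. [folklore] -/
theorem ksq_pos (hL : 0 < L) (hn : n ≠ 0) : 0 < ksq L n := by
  unfold ksq; have := nsq_pos hn; positivity

/-- `‖n‖∞² ≤ |n|₂²`. [folklore] -/
theorem norm_sq_le_nsq (n : Fin 3 → ℤ) : ‖(fun j => (n j : ℝ))‖ ^ 2 ≤ nsq n := by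
  have h : ‖(fun j => (n j : ℝ))‖ ≤ Real.sqrt (nsq n) := by
    refine (pi_norm_le_iff_of_nonneg (Real.sqrt_nonneg _)).2 fun j => ?_
    rw [Real.norm_eq_abs, ← Real.sqrt_sq_eq_abs]
    exact Real.sqrt_le_sqrt (Finset.single_le_sum (f := fun j => (n j : ℝ) ^ 2)
      (fun i _ => sq_nonneg _) (Finset.mem_univ j))
  calc ‖(fun j => (n j : ℝ))‖ ^ 2 ≤ Real.sqrt (nsq n) ^ 2 := pow_le_pow_left₀ (norm_nonneg _) h 2
    _ = nsq n := Real.sq_sqrt (nsq_nonneg n)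

/-- **The canonical (free) flow** `J_l(X) = -i (k_l/|k|²) L⁻³ e_n(x₀)` — potential flow of the free
charge `L⁻³e_n(x₀)` along `k̂`. [folklore] -/
def canonicalFlow (m : ℕ) (L : ℝ) (n : Fin 3 → ℤ) : Config (m + 1) → Fin 3 → ℂ := fun X l =>
  ((-(kcomp L n l / ksq L n / L ^ 3) : ℝ) : ℂ) * Complex.I * cellWave L n (X 0)

/-- **The canonical flow has weak `x₀`-divergence `L⁻³e_n(x₀)`.** [folklore] -/
theorem isFibreFlow_canonicalFlow (hL : 0 < L) (hn : n ≠ 0) :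
    IsFibreFlow m L (fun X => (((L ^ 3)⁻¹ : ℝ) : ℂ) * cellWave L n (X 0)) (canonicalFlow m L n) := by
  intro η hη hper
  have hk := ksq_pos hL hn
  have hstep : ∀ l : Fin 3, ∫ X in cellN (m + 1) L,
      canonicalFlow m L n X l * fderiv ℝ η X (Pi.single 0 (EuclideanSpace.single l 1)) =
        (((kcomp L n l / ksq L n / L ^ 3) : ℝ) : ℂ) * Complex.I * (2 * π * Complex.I * (n l) / L) *
          ∫ X in cellN (m + 1) L, cellWave L n (X 0) * η X := by
    intro l
    unfold canonicalFlow
    simp_rw [mul_assoc]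
    rw [integral_const_mul, integral_const_mul, integral_cellWave_mul_fderiv hL hη hper l]
    push_cast
    ring
  -- `Σ_l (k_l/|k|²L³) i (2πi n_l/L) = -L⁻³`
  have hsum : ∑ l : Fin 3, (((kcomp L n l / ksq L n / L ^ 3) : ℝ) : ℂ) * Complex.I *
      (2 * π * Complex.I * (n l) / L) = -((((L ^ 3)⁻¹ : ℝ)) : ℂ) := by
    have e : ∀ l : Fin 3, (((kcomp L n l / ksq L n / L ^ 3) : ℝ) : ℂ) * Complex.I *
        (2 * π * Complex.I * (n l) / L) = -((((kcomp L n l ^ 2 / ksq L n / L ^ 3) : ℝ)) : ℂ) := by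
      intro l
      have hI : Complex.I * Complex.I = -1 := Complex.I_mul_I
      unfold kcomp
      push_cast
      linear_combination ((2 * π * (n l : ℂ) / L) / (ksq L n : ℂ) / (L : ℂ) ^ 3 * (2 * π * (n l : ℂ) / L)) * hI
    simp_rw [e]
    rw [Finset.sum_neg_distrib, ← Complex.ofReal_sum, ← Finset.sum_div, ← Finset.sum_div, sum_kcomp_sq,
      div_self hk.ne', one_div]
  rw [integral_finsetSum _ (fun l _ => ?_)]
  · simp_rw [hstep]
    rw [← Finset.sum_mul, hsum]
    simp_rw [mul_assoc]
    rw [MeasureTheory.integral_const_mul]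
    ring
  · unfold canonicalFlow
    refine integrableOn_cellN ?_ L
    refine Continuous.mul ?_ ((hη.continuous_fderiv one_ne_zero).clm_apply continuous_const)
    exact continuous_const.mul ((continuous_cellWave L n).comp (continuous_apply 0))

/-- `Σ_l |J_l|² = L⁻⁶/|k|²` (constant). [folklore] -/
theorem sum_norm_sq_canonicalFlow (hL : 0 < L) (hn : n ≠ 0) (X : Config (m + 1)) :
    ∑ l : Fin 3, ‖canonicalFlow m L n X l‖ ^ 2 = (L ^ 3)⁻¹ ^ 2 / ksq L n := by
  have hk := ksq_pos hL hn
  have hl : ∀ l : Fin 3, ‖canonicalFlow m L n X l‖ ^ 2 = kcomp L n l ^ 2 * ((ksq L n)⁻¹ / L ^ 3) ^ 2 := by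
    intro l
    unfold canonicalFlow
    rw [norm_mul, norm_mul, Complex.norm_I, norm_cellWave, mul_one, mul_one, Complex.norm_real,
      Real.norm_eq_abs, sq_abs]
    ring
  simp_rw [hl]
  rw [← Finset.sum_mul, sum_kcomp_sq]
  field_simp

/-- **The free fibre bound at the constant state**: for `v = 0`, the constant state (an exact
zero-free minimiser) and any `n ≠ 0`, the canonical flow realises the crux's conclusion with
`C = 1/4π²`: its weak divergence is the fibre charge and its cost is EXACTLY `L²/(4π²|n|₂²) ≤
(1/4π²) L²/‖n‖∞²`.  With `fibreConductanceWith_zero_const_ge` (the floor `C ≥ 1/4π²`), the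
free value is pinned. [folklore] -/
theorem fibreBoundAt_constState (hL : 0 < L) (hn : n ≠ 0) {c : ℝ} (hcdef : c = (Real.sqrt (L ^ 3))⁻¹)
    (hc : c ^ 2 * L ^ 3 = 1) :
    FibreBoundAt L n (constState m hL c hc) (1 / (4 * π ^ 2)) := by
  have hL3 : 0 < L ^ 3 := by positivity
  have hcpos : 0 < c := by rw [hcdef]; exact inv_pos.2 (Real.sqrt_pos.2 hL3)
  have hc2 : c ^ 2 = (L ^ 3)⁻¹ := by rw [hcdef, inv_pow, Real.sq_sqrt hL3.le]
  have hk := ksq_pos hL hn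
  have hφpos : ∀ y : Space, 0 < (fun _ : Space => c) y := fun _ => hcpos
  have hnorm1 : ∫ y in cell L, (fun _ : Space => c) y ^ 2 = 1 := by
    show ∫ _y in cell L, c ^ 2 = 1
    rw [integral_cell_const_sq hL.le, hc]
  -- the fibre charge of the constant state is `L⁻³ e_n(x₀)`
  have hβ : ∫ y in cell L, wave L n y * (((fun _ : Space => c) y : ℝ) : ℂ) = 0 := by
    show ∫ y in cell L, wave L n y * (c : ℂ) = 0
    simp_rw [wave_eq_cellWave]
    rw [integral_mul_const, integral_cell_cellWave_eq_zero hL hn, zero_mul]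
  have hcc : ((Real.sqrt (L ^ 3))⁻¹ : ℂ) * (c : ℂ) = (((L ^ 3)⁻¹ : ℝ) : ℂ) := by
    rw [hcdef, ← Complex.ofReal_inv, ← Complex.ofReal_mul, ← sq, inv_pow, Real.sq_sqrt hL3.le]
  have hq : fibreCharge L n (constState m hL c hc).ψ = fun X => (((L ^ 3)⁻¹ : ℝ) : ℂ) * cellWave L n (X 0) := by
    funext X
    rw [constState_ψ_eq_realProd hL hc, fibreCharge_realProd hφpos hnorm1, hβ, zero_mul, sub_zero,
      wave_eq_cellWave]
    linear_combination (cellWave L n (X 0)) * hcc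
  refine ⟨canonicalFlow m L n, hq ▸ isFibreFlow_canonicalFlow hL hn, ?_⟩
  -- the cost
  rw [constState_ψ_eq_realProd hL hc, fibreCost_realProd hφpos hnorm1]
  simp_rw [sum_norm_sq_canonicalFlow hL hn, bathProd_const]
  rw [setLIntegral_cellN_const' hL.le, ← ENNReal.ofReal_mul (by positivity)]
  apply ENNReal.ofReal_le_ofReal
  -- `(L⁻³)²/|k|² · ((c²)^m/c²) · (L³)^(m+1) = 1/|k|² ≤ (1/4π²) L²/‖n‖∞²`
  have hc2m : (c ^ 2) ^ m * (L ^ 3) ^ (m + 1) = L ^ 3 := by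
    rw [hc2, inv_pow, pow_succ (L ^ 3) m, ← mul_assoc, inv_mul_cancel₀ (by positivity), one_mul]
  have hval : (L ^ 3)⁻¹ ^ 2 / ksq L n * ((c ^ 2) ^ m / c ^ 2) * (L ^ 3) ^ (m + 1) = 1 / ksq L n := by
    calc (L ^ 3)⁻¹ ^ 2 / ksq L n * ((c ^ 2) ^ m / c ^ 2) * (L ^ 3) ^ (m + 1)
        = (L ^ 3)⁻¹ ^ 2 / ksq L n / c ^ 2 * ((c ^ 2) ^ m * (L ^ 3) ^ (m + 1)) := by ring
      _ = (L ^ 3)⁻¹ ^ 2 / ksq L n / (L ^ 3)⁻¹ * L ^ 3 := by rw [hc2m, hc2]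
      _ = 1 / ksq L n := by field_simp
  rw [hval]
  have hnn : 0 < ‖(fun j => (n j : ℝ))‖ := lt_of_lt_of_le one_pos (one_le_norm_intVec hn)
  unfold ksq
  rw [div_le_div_iff₀ (by have := nsq_pos hn; positivity) (by positivity), one_mul,
    show 1 / (4 * π ^ 2) * L ^ 2 * (4 * π ^ 2 * nsq n / L ^ 2) = nsq n by field_simp]
  exact norm_sq_le_nsq n

end CanonicalFlow

/-! ### Hard cores self-vacuate the crux (boundedness of `v` is NOT the load-bearing hypothesis) -/

section HardCore

open Summit.AtomisticToContinuum.BoseEinsteinCondensation.Theorems.GaussianDominationCan.Negative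

variable {m : ℕ} {L : ℝ}

/-- Inside the small cube `[0,s)^{3N}`, `s ≤ 1/2`, particles `0` and `1` overlap: `‖x₀ - x₁‖ < 1`.
[folklore] -/
theorem norm_sub_lt_one_of_mem_cellN {s : ℝ} (hs : s ≤ 1 / 2) {X : Config (m + 2)}
    (hX : X ∈ cellN (m + 2) s) : ‖X 0 - X 1‖ < 1 := by
  have hk : ∀ k : Fin 3, ‖(X 0 - X 1) k‖ ^ 2 ≤ (1 / 2) ^ 2 := by
    intro k
    have h0 := (hX 0) k
    have h1 := (hX 1) k
    rw [Set.mem_Ico] at h0 h1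
    rw [PiLp.sub_apply, Real.norm_eq_abs, sq_abs]
    have : |X 0 k - X 1 k| ≤ 1 / 2 := by rw [abs_le]; constructor <;> linarith
    nlinarith [abs_nonneg (X 0 k - X 1 k), sq_abs (X 0 k - X 1 k)]
  have hsq : ‖X 0 - X 1‖ ^ 2 ≤ 3 / 4 := by
    rw [EuclideanSpace.norm_eq, Real.sq_sqrt (Finset.sum_nonneg fun k _ => by positivity),
      Fin.sum_univ_three]
    linarith [hk 0, hk 1, hk 2]
  nlinarith [norm_nonneg (X 0 - X 1)]

/-- Overlapping hard cores have infinite interaction: `‖x₀ - x₁‖ < 1 ⇒ Σ_{i<j} v^per(xᵢ-xⱼ) = ⊤`.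
[folklore] -/
theorem periodicInteraction_hardCore_eq_top {X : Config (m + 2)} (h : ‖X 0 - X 1‖ < 1) :
    periodicInteraction (hardCorePotential 1) L X = ⊤ := by
  unfold periodicInteraction
  refine eq_top_iff.2 ?_
  have h01 : periodizedPotential (hardCorePotential 1) L (X 0 - X 1) = ⊤ := by
    refine eq_top_iff.2 ((le_of_eq ?_).trans (le_periodizedPotential _ L _))
    exact (hardCorePotential_of_lt h).symm
  calc (⊤ : ℝ≥0∞) = periodizedPotential (hardCorePotential 1) L (X 0 - X 1) := h01.symm
    _ ≤ ∑ j ∈ Finset.univ.filter (fun j : Fin (m + 2) => (0 : Fin (m + 2)) < j),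
          periodizedPotential (hardCorePotential 1) L (X 0 - X j) :=
        Finset.single_le_sum (f := fun j => periodizedPotential (hardCorePotential 1) L (X 0 - X j))
          (fun j _ => zero_le) (Finset.mem_filter.2 ⟨Finset.mem_univ _, Fin.zero_lt_one⟩)
    _ ≤ ∑ i : Fin (m + 2), ∑ j ∈ Finset.univ.filter (fun j : Fin (m + 2) => i < j),
          periodizedPotential (hardCorePotential 1) L (X i - X j) :=
        Finset.single_le_sum (f := fun i : Fin (m + 2) => ∑ j ∈ Finset.univ.filter (fun j => i < j),
          periodizedPotential (hardCorePotential 1) L (X i - X j)) (fun i _ => zero_le) (Finset.mem_univ 0)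

/-- **A zero-free state has infinite hard-core energy** (`N ≥ 2`): the Born weight is positive on
the overlap region, where the interaction is `⊤`. So for hard cores the crux's hypotheses
(H1) `periodicEnergy v Φ = E₀` and (H2) `Φ ≠ 0 everywhere` force `E₀ = ⊤`. [folklore] -/
theorem periodicEnergy_hardCore_eq_top (hL : 0 < L) (Φ : PeriodicTrialState (m + 2) L)
    (hz : ∀ X, Φ.ψ X ≠ 0) : periodicEnergy (hardCorePotential 1) Φ = ⊤ := by
  set s : ℝ := min L (1 / 2) with hsdef
  have hs0 : 0 < s := lt_min hL (by norm_num)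
  have hsL : s ≤ L := min_le_left _ _
  have hs2 : s ≤ 1 / 2 := min_le_right _ _
  have hsub : cellN (m + 2) s ⊆ cellN (m + 2) L := fun X hX i k =>
    ⟨((hX i) k).1, ((hX i) k).2.trans_le hsL⟩
  have hvol : volume (cellN (m + 2) s) ≠ 0 := by
    rw [volume_cellN]; exact pow_ne_zero _ (pow_ne_zero _ (by rwa [ne_eq, ENNReal.ofReal_eq_zero, not_le]))
  unfold periodicEnergy
  refine eq_top_iff.2 ?_
  calc (⊤ : ℝ≥0∞) = ⊤ * volume (cellN (m + 2) s) := (ENNReal.top_mul hvol).symm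
    _ = ∫⁻ _X in cellN (m + 2) s, ⊤ := (setLIntegral_const _ _).symm
    _ ≤ ∫⁻ X in cellN (m + 2) s, kineticDensity Φ.ψ X +
          periodicInteraction (hardCorePotential 1) L X * ((‖Φ.ψ X‖₊ : ℝ≥0∞) ^ 2) := by
        refine setLIntegral_mono' (measurableSet_cellN _ _) fun X hX => ?_
        rw [periodicInteraction_hardCore_eq_top (norm_sub_lt_one_of_mem_cellN hs2 hX), ENNReal.top_mul]
        · exact le_add_self
        · exact pow_ne_zero _ (by simpa using hz X)
    _ ≤ ∫⁻ X in cellN (m + 2) L, kineticDensity Φ.ψ X +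
          periodicInteraction (hardCorePotential 1) L X * ((‖Φ.ψ X‖₊ : ℝ≥0∞) ^ 2) :=
        lintegral_mono_set hsub

/-- **The crux is vacuous at hard cores whenever `E₀ < ⊤`**: no `Φ` satisfies (H1) ∧ (H2). [folklore] -/
theorem hardCore_hypotheses_unsatisfiable (hL : 0 < L)
    (hE : periodicGroundStateEnergy (hardCorePotential 1) (m + 2) L ≠ ⊤) (Φ : PeriodicTrialState (m + 2) L) :
    ¬ (periodicEnergy (hardCorePotential 1) Φ = periodicGroundStateEnergy (hardCorePotential 1) (m + 2) L ∧
        ∀ X, Φ.ψ X ≠ 0) := fun ⟨h1, h2⟩ =>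
  hE (h1 ▸ periodicEnergy_hardCore_eq_top hL Φ h2)

/-- **… which is the whole LSSY dilute regime**: by Dyson's upper bound (the PROVED Literature theorem
`LSSY2005_upperBound_periodic_holds`, with `a = 1` from `scatteringLength_hardCorePotential`) there is
`c > 0` such that `E₀^per(N, L) < ⊤` for all `N ≥ 2`, `L > 2` with `a/b ≤ c`
(`b = (4πρ₁/3)^{-1/3}`, `ρ₁ = (N-1)/L³`); there the hard-core crux has NO admissible `Φ`.  Hence
dropping the boundedness hypothesis `∃ B, v ≤ B` cannot be refuted at hard cores (the statement is
vacuously true there): boundedness is not the load-bearing hypothesis, (H1) is. [folklore] -/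
theorem hardCore_no_admissible_state :
    ∃ c : ℝ, 0 < c ∧ ∀ (m : ℕ) (L : ℝ), 0 < L → 2 < L →
      1 / (4 * Real.pi * ((((m + 2 : ℕ) : ℝ) - 1) / L ^ 3) / 3) ^ (-(1 : ℝ) / 3) ≤ c →
        ∀ Φ : PeriodicTrialState (m + 2) L,
          ¬ (periodicEnergy (hardCorePotential 1) Φ =
              periodicGroundStateEnergy (hardCorePotential 1) (m + 2) L ∧ ∀ X, Φ.ψ X ≠ 0) := by
  have hfr : ∀ r, (1 : ℝ) < r → hardCorePotential 1 r = 0 := fun r hr => hardCorePotential_of_le hr.le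
  have ha : scatteringLength (hardCorePotential 1) ≠ ⊤ := by
    rw [scatteringLength_hardCorePotential]; exact ENNReal.ofReal_ne_top
  obtain ⟨C, c, hC, hc, hmain⟩ :=
    LSSY2005_upperBound_periodic_holds (hardCorePotential 1) 1 (measurable_hardCorePotential 1) hfr ha
  refine ⟨c, hc, fun m L hL hL2 hab Φ => hardCore_hypotheses_unsatisfiable hL ?_ Φ⟩
  have h := hmain (m + 2) L (by omega) hL (by linarith)
  simp only [toReal_scatteringLength_hardCorePotential zero_le_one] at h
  exact ne_top_of_le_ne_top ENNReal.ofReal_ne_top (h hab)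

end HardCore

/-! ### §Infrared (cycle 3): INFRARED NECESSITY — what every admissible fibre flow pays on the beat
modes (mirror of `Theorems/FibreConductance/Negative/InfraredBridge|InfraredTestFunction|InfraredNecessity.lean`) -/

section Infrared

open Literature.MathematicalPhysics.QuantumManyBody.BoseGas
open Summit.AtomisticToContinuum.BoseEinsteinCondensation.Theorems.GaussianDominationCan.Negative (InWindow)
open scoped ComplexConjugate

variable {m : ℕ} {L : ℝ}


/-! ### Bridge to the line's fibre interface (`BECThomsonPrincipleDefs`: same objects, bundled state) -/

section Bridge

open Summit.AtomisticToContinuum.BoseEinsteinCondensation.Cruxes.FibreConductance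

/-- The line's `fibreW` is the crux's `W`. [folklore] -/
theorem psb_fibreW (Φ : PeriodicTrialState (m + 1) L) :
    ParsevalShellBootstrap.fibreW Φ = fibreW L Φ.ψ := rfl

/-- The line's `fibrePsi` is the crux's `ψ`. [folklore] -/
theorem psb_fibrePsi (Φ : PeriodicTrialState (m + 1) L) :
    ParsevalShellBootstrap.fibrePsi Φ = fibrePsi L Φ.ψ := rfl

/-- The line's `fibreBeta` is the crux's `β`. [folklore] -/
theorem psb_fibreBeta (n : Fin 3 → ℤ) (Φ : PeriodicTrialState (m + 1) L) :
    ParsevalShellBootstrap.fibreBeta n Φ = fibreBeta L n Φ.ψ := rfl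

variable (hL : 0 < L) (Φ : PeriodicTrialState (m + 1) L) (hΦ : ∀ X, Φ.ψ X ≠ 0)

include hL hΦ in
/-- `W > 0` (zero-free state). [folklore] -/
theorem fibreW_pos' (X : Config (m + 1)) : 0 < fibreW L Φ.ψ X :=
  ParsevalShellBootstrap.fibreW_pos hL Φ hΦ X

/-- `W ≥ 0`. [folklore] -/
theorem fibreW_nonneg' (X : Config (m + 1)) : 0 ≤ fibreW L Φ.ψ X :=
  ParsevalShellBootstrap.fibreW_nonneg Φ X

/-- `W` is periodic in every particle. [folklore] -/
theorem fibreW_periodic' (X : Config (m + 1)) (i : Fin (m + 1)) (k : Fin 3) :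
    fibreW L Φ.ψ (X + Pi.single i (EuclideanSpace.single k L)) = fibreW L Φ.ψ X :=
  ParsevalShellBootstrap.fibreW_periodic Φ X i k

/-- `W` is `C¹`. [folklore] -/
theorem contDiff_fibreW' : ContDiff ℝ 1 (fibreW L Φ.ψ) :=
  ParsevalShellBootstrap.contDiff_fibreW Φ

/-- `W` is continuous. [folklore] -/
theorem continuous_fibreW' : Continuous (fibreW L Φ.ψ) :=
  ParsevalShellBootstrap.continuous_fibreW Φ

/-- `W` is measurable. [folklore] -/
theorem measurable_fibreW' : Measurable (fibreW L Φ.ψ) :=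
  ParsevalShellBootstrap.measurable_fibreW Φ

include hL hΦ in
/-- `ψ > 0` (zero-free state). [folklore] -/
theorem fibrePsi_pos' (X : Config (m + 1)) : 0 < fibrePsi L Φ.ψ X :=
  ParsevalShellBootstrap.fibrePsi_pos hL Φ hΦ X

/-- `ψ` is periodic in every particle. [folklore] -/
theorem fibrePsi_periodic' (X : Config (m + 1)) (i : Fin (m + 1)) (k : Fin 3) :
    fibrePsi L Φ.ψ (X + Pi.single i (EuclideanSpace.single k L)) = fibrePsi L Φ.ψ X :=
  ParsevalShellBootstrap.fibrePsi_periodic Φ X i k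

include hL hΦ in
/-- `ψ` is `C¹`. [folklore] -/
theorem contDiff_fibrePsi' : ContDiff ℝ 1 (fibrePsi L Φ.ψ) :=
  ParsevalShellBootstrap.contDiff_fibrePsi hL Φ hΦ

include hL hΦ in
/-- `ψ` is continuous. [folklore] -/
theorem continuous_fibrePsi' : Continuous (fibrePsi L Φ.ψ) :=
  ParsevalShellBootstrap.continuous_fibrePsi hL Φ hΦ

include hL hΦ in
/-- `ψ` is measurable. [folklore] -/
theorem measurable_fibrePsi' : Measurable (fibrePsi L Φ.ψ) :=
  ParsevalShellBootstrap.measurable_fibrePsi hL Φ hΦ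

include hL hΦ in
/-- `∫_cell ψ(y|X̂)² dy = 1`. [folklore] -/
theorem integral_fibrePsi_sq' (X : Config (m + 1)) :
    ∫ y in cell L, fibrePsi L Φ.ψ (Function.update X 0 y) ^ 2 = 1 :=
  ParsevalShellBootstrap.integral_fibrePsi_sq hL Φ hΦ X

include hL in
/-- `β` is periodic in every particle. [folklore] -/
theorem fibreBeta_periodic' (n : Fin 3 → ℤ) (X : Config (m + 1)) (i : Fin (m + 1)) (k : Fin 3) :
    fibreBeta L n Φ.ψ (X + Pi.single i (EuclideanSpace.single k L)) = fibreBeta L n Φ.ψ X :=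
  ParsevalShellBootstrap.fibreBeta_periodic hL n Φ X i k

include hL hΦ in
/-- `β` is `C¹`. [folklore] -/
theorem contDiff_fibreBeta' (n : Fin 3 → ℤ) : ContDiff ℝ 1 (fibreBeta L n Φ.ψ) :=
  ParsevalShellBootstrap.contDiff_fibreBeta hL n Φ hΦ

include hL hΦ in
/-- `β` is continuous. [folklore] -/
theorem continuous_fibreBeta' (n : Fin 3 → ℤ) : Continuous (fibreBeta L n Φ.ψ) :=
  ParsevalShellBootstrap.continuous_fibreBeta hL n Φ hΦ

include hL in
/-- `β_p = L³ ĉ_{−p}(ψ(·|X̂))`. [folklore] -/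
theorem fibreBeta_eq_cellFourierCoeff' (n : Fin 3 → ℤ) (X : Config (m + 1)) :
    fibreBeta L n Φ.ψ X = ((L ^ 3 : ℝ) : ℂ) *
      cellFourierCoeff L (fun y => (fibrePsi L Φ.ψ (Function.update X 0 y) : ℂ)) (-n) :=
  ParsevalShellBootstrap.fibreBeta_eq_cellFourierCoeff hL n Φ X

include hL hΦ in
/-- `∫_{cell^N} W |ĉ_q(ψ(·|X̂))|² dX = n_q(|Φ|)/N` (the lead's fibre Fubini). [folklore] -/
theorem lintegral_fibreW_mul_norm_sq_cellFourierCoeff' (q : Fin 3 → ℤ) :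
    ∫⁻ X in cellN (m + 1) L, ENNReal.ofReal
        (fibreW L Φ.ψ X * ‖cellFourierCoeff L (fun y => (fibrePsi L Φ.ψ (Function.update X 0 y) : ℂ)) q‖ ^ 2) =
      cellOccupation (m + 1) L (planeWaveMode L q) (fun X => (‖Φ.ψ X‖ : ℂ)) / (m + 1 : ℝ≥0∞) :=
  ParsevalShellBootstrap.lintegral_fibreW_mul_norm_sq_cellFourierCoeff hL Φ hΦ q

include hL in
/-- Fibre Fubini for a fibre-constant weight (the lead's `lintegral_cellN_eq_fibre_average`). [folklore] -/
theorem lintegral_cellN_eq_fibre_average' {G : Config (m + 1) → ℝ≥0∞} (hG : Measurable G) :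
    ∫⁻ X in cellN (m + 1) L, G X =
      (ENNReal.ofReal (L ^ 3))⁻¹ * ∫⁻ X in cellN (m + 1) L, ∫⁻ y in cell L, G (Function.update X 0 y) :=
  ParsevalShellBootstrap.lintegral_cellN_eq_fibre_average hL hG

/-- The substitution `(y, X) ↦ X[0 ↦ y]` is `C¹`. [folklore] -/
theorem contDiff_update_zero' :
    ContDiff ℝ 1 fun q : Space × Config (m + 1) => Function.update q.2 0 q.1 :=
  ParsevalShellBootstrap.contDiff_update_zero

end Bridge

/-! ### Plane-wave bookkeeping -/

/-- `|e_n| = 1`. [folklore] -/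
theorem norm_wave (L : ℝ) (n : Fin 3 → ℤ) (y : Space) : ‖wave L n y‖ = 1 := by
  rw [wave_eq_cellWave, norm_cellWave]

/-- `e_a e_b = e_{a+b}`. [folklore] -/
theorem wave_mul_wave (L : ℝ) (a b : Fin 3 → ℤ) (y : Space) :
    wave L a y * wave L b y = wave L (a + b) y := by
  unfold wave
  rw [← Complex.exp_add]
  congr 1
  simp only [Pi.add_apply, Int.cast_add, add_mul, Finset.sum_add_distrib]
  push_cast
  ring

/-- `e_{n−e} = e_n e_{−e}`. [folklore] -/
theorem wave_sub (L : ℝ) (n e : Fin 3 → ℤ) (y : Space) :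
    wave L (n - e) y = wave L n y * wave L (-e) y := by
  rw [wave_mul_wave, ← sub_eq_add_neg]

/-- The plane waves are `Lℤ³`-periodic. [folklore] -/
theorem wave_periodic (hL : L ≠ 0) (n : Fin 3 → ℤ) (y : Space) (k : Fin 3) :
    wave L n (y + EuclideanSpace.single k L) = wave L n y := by
  rw [wave_eq_cellWave, wave_eq_cellWave, cellWave_periodic hL]

/-- The plane waves are `C¹`. [folklore] -/
theorem contDiff_wave (L : ℝ) (n : Fin 3 → ℤ) : ContDiff ℝ 1 (wave L n) := by
  have h : wave L n = cellWave L n := funext fun y => wave_eq_cellWave L n y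
  rw [h]
  exact (contDiff_cellWave L n).of_le (mod_cast le_top)

/-- `X ↦ e_p(x₀)` is differentiable. [folklore] -/
theorem differentiable_wave_comp_zero (L : ℝ) (p : Fin 3 → ℤ) :
    Differentiable ℝ fun Y : Config (m + 1) => wave L p (Y 0) :=
  ((contDiff_wave L p).differentiable one_ne_zero).comp (differentiable_apply (0 : Fin (m + 1)))

/-- **Fibre derivative of `e_p(x₀)`**: `∂_{x_{0,l}} e_p(x₀) = (2πi p_l/L) e_p(x₀)`. [folklore] -/
theorem fderiv_wave_comp_zero (L : ℝ) (p : Fin 3 → ℤ) (X : Config (m + 1)) (l : Fin 3) :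
    fderiv ℝ (fun Y : Config (m + 1) => wave L p (Y 0)) X (Pi.single 0 (EuclideanSpace.single l 1)) =
      (2 * Real.pi * Complex.I * (p l) / L) * wave L p (X 0) := by
  have hw : (fun Y : Config (m + 1) => wave L p (Y 0)) = cellWave L p ∘ fun Y : Config (m + 1) => Y 0 :=
    funext fun Y => wave_eq_cellWave L p (Y 0)
  have hcw : Differentiable ℝ (cellWave L p) :=
    ((contDiff_cellWave L p).of_le (mod_cast le_top) : ContDiff ℝ 1 (cellWave L p)).differentiable
      one_ne_zero
  rw [hw, fderiv_comp X (hcw _)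
    (differentiableAt_apply 0 X), (hasFDerivAt_apply (0 : Fin (m + 1)) X).fderiv,
    ContinuousLinearMap.comp_apply, ContinuousLinearMap.proj_apply, Pi.single_eq_same,
    fderiv_cellWave_apply_single, wave_eq_cellWave]

/-- Translating particle `0` is an update of the fibre variable. [folklore] -/
theorem add_single_zero_eq_update (X : Config (m + 1)) (v : Space) :
    X + Pi.single 0 v = Function.update X 0 (X 0 + v) := by
  funext j
  rcases eq_or_ne j 0 with rfl | hj
  · simp
  · simp [hj]

/-- **A fibre constant has zero fibre derivative**: if `G(X[0↦y]) = G(X)` for all `y` and `G` is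
differentiable at `X`, then `∂_{x_0} G(X) = 0` (the line derivative along `e₀ ⊗ u` of a function
constant on that line). [folklore] -/
theorem fderiv_single_zero_of_update_invariant {G : Config (m + 1) → ℂ}
    (hG : ∀ X y, G (Function.update X 0 y) = G X) {X : Config (m + 1)} (hd : DifferentiableAt ℝ G X)
    (u : Space) : fderiv ℝ G X (Pi.single 0 u) = 0 := by
  rw [← hd.lineDeriv_eq_fderiv]
  have h : ∀ t : ℝ, G (X + t • (Pi.single (0 : Fin (m + 1)) u : Config (m + 1))) = G X := by
    intro t
    rw [← Pi.single_smul, add_single_zero_eq_update, hG]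
  unfold lineDeriv
  simp_rw [h]
  exact deriv_const 0 (G X)



/-! ### The beat amplitude and the infrared test function -/

/-- `|k_e|² = (2π/L)² Σ_j e_j²`. [folklore] -/
def ksqOf (L : ℝ) (e : Fin 3 → ℤ) : ℝ := (2 * Real.pi / L) ^ 2 * ∑ j, (e j : ℝ) ^ 2

/-- `|k_e|² ≥ 0`. [folklore] -/
theorem ksqOf_nonneg (L : ℝ) (e : Fin 3 → ℤ) : 0 ≤ ksqOf L e := by
  unfold ksqOf; positivity

/-- Fourier mode `∫_cell e_{−e}(y) ψ(y|X̂)² dy` of the conditional DENSITY `ψ²` (modulus `≤ 1`).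
[folklore] -/
def densMode (L : ℝ) (e : Fin 3 → ℤ) (φ : Config (m + 1) → ℂ) (X : Config (m + 1)) : ℂ :=
  ∫ y in cell L, wave L (-e) y * (fibrePsi L φ (Function.update X 0 y) : ℂ) ^ 2

/-- The BEAT AMPLITUDE `A_e(X̂) = ∫ e_{n−e}ψ dy − β(X̂) ∫ e_{−e}ψ² dy`: `L^{3/2}` times the
`e_{−e}(x₀)`-Fourier mode, along the fibre of `X̂`, of the crux's charge `q`. [folklore] -/
def beatAmp (L : ℝ) (n e : Fin 3 → ℤ) (φ : Config (m + 1) → ℂ) (X : Config (m + 1)) : ℂ :=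
  fibreBeta L (n - e) φ X - fibreBeta L n φ X * densMode L e φ X

/-- The fibre-constant factor `conj(A_e) W` of the test function. [folklore] -/
def irBath (L : ℝ) (n e : Fin 3 → ℤ) (φ : Config (m + 1) → ℂ) (X : Config (m + 1)) : ℂ :=
  conj (beatAmp L n e φ X) * (fibreW L φ X : ℂ)

/-- The INFRARED TEST FUNCTION `η_e(X) = e_{−e}(x₀) conj(A_e(X̂)) W(X̂)`. [folklore] -/
def irTest (L : ℝ) (n e : Fin 3 → ℤ) (φ : Config (m + 1) → ℂ) (X : Config (m + 1)) : ℂ :=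
  wave L (-e) (X 0) * irBath L n e φ X

section Regularity

variable (hL : 0 < L) (Φ : PeriodicTrialState (m + 1) L) (hΦ : ∀ X, Φ.ψ X ≠ 0)


/-! #### Fibre constancy -/

omit hL hΦ in
/-- `W` is a fibre constant. [folklore] -/
theorem fibreW_update' (X : Config (m + 1)) (y : Space) :
    fibreW L Φ.ψ (Function.update X 0 y) = fibreW L Φ.ψ X := by
  simp only [fibreW, Function.update_idem]

omit hL hΦ in
/-- `β` is a fibre constant. [folklore] -/
theorem fibreBeta_update' (n : Fin 3 → ℤ) (X : Config (m + 1)) (y : Space) :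
    fibreBeta L n Φ.ψ (Function.update X 0 y) = fibreBeta L n Φ.ψ X := by
  simp only [fibreBeta, Function.update_idem]

omit hL hΦ in
/-- The density mode is a fibre constant. [folklore] -/
theorem densMode_update (e : Fin 3 → ℤ) (X : Config (m + 1)) (y : Space) :
    densMode L e Φ.ψ (Function.update X 0 y) = densMode L e Φ.ψ X := by
  simp only [densMode, Function.update_idem]

omit hL hΦ in
/-- The beat amplitude is a fibre constant. [folklore] -/
theorem beatAmp_update (n e : Fin 3 → ℤ) (X : Config (m + 1)) (y : Space) :
    beatAmp L n e Φ.ψ (Function.update X 0 y) = beatAmp L n e Φ.ψ X := by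
  simp only [beatAmp, fibreBeta_update', densMode_update]

omit hL hΦ in
/-- The bath factor is a fibre constant. [folklore] -/
theorem irBath_update (n e : Fin 3 → ℤ) (X : Config (m + 1)) (y : Space) :
    irBath L n e Φ.ψ (Function.update X 0 y) = irBath L n e Φ.ψ X := by
  simp only [irBath, beatAmp_update, fibreW_update']

/-! #### Periodicity -/

/-- The density mode is `Lℤ³`-periodic in every particle. [folklore] -/
theorem densMode_periodic (e : Fin 3 → ℤ) (X : Config (m + 1)) (i : Fin (m + 1)) (k : Fin 3) :
    densMode L e Φ.ψ (X + Pi.single i (EuclideanSpace.single k L)) = densMode L e Φ.ψ X := by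
  unfold densMode
  rcases eq_or_ne i 0 with rfl | hi
  · simp only [Cruxes.FibreConductance.ParsevalShellBootstrap.update_add_single_zero]
  · simp only [Cruxes.FibreConductance.ParsevalShellBootstrap.update_add_single_of_ne hi]
    refine setIntegral_congr_fun (measurableSet_cell L) fun y _ => ?_
    rw [fibrePsi_periodic']

include hL in
/-- The beat amplitude is `Lℤ³`-periodic in every particle. [folklore] -/
theorem beatAmp_periodic (n e : Fin 3 → ℤ) (X : Config (m + 1)) (i : Fin (m + 1)) (k : Fin 3) :
    beatAmp L n e Φ.ψ (X + Pi.single i (EuclideanSpace.single k L)) = beatAmp L n e Φ.ψ X := by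
  unfold beatAmp
  rw [densMode_periodic Φ, fibreBeta_periodic' hL, fibreBeta_periodic' hL]

include hL in
/-- The bath factor is `Lℤ³`-periodic in every particle. [folklore] -/
theorem irBath_periodic (n e : Fin 3 → ℤ) (X : Config (m + 1)) (i : Fin (m + 1)) (k : Fin 3) :
    irBath L n e Φ.ψ (X + Pi.single i (EuclideanSpace.single k L)) = irBath L n e Φ.ψ X := by
  unfold irBath
  rw [beatAmp_periodic hL Φ, fibreW_periodic']

include hL in
/-- The infrared test function is `Lℤ³`-periodic in every particle. [folklore] -/
theorem irTest_periodic (n e : Fin 3 → ℤ) (X : Config (m + 1)) (i : Fin (m + 1)) (k : Fin 3) :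
    irTest L n e Φ.ψ (X + Pi.single i (EuclideanSpace.single k L)) = irTest L n e Φ.ψ X := by
  unfold irTest
  rw [irBath_periodic hL Φ]
  rcases eq_or_ne i 0 with rfl | hi
  · simp only [Pi.add_apply, Pi.single_eq_same, wave_periodic hL.ne']
  · simp only [Pi.add_apply, Pi.single_eq_of_ne hi.symm, add_zero]

/-! #### Smoothness -/

include hL hΦ in
/-- The density mode is `C¹` (one derivative under the integral over the bounded cell). [folklore] -/
theorem contDiff_densMode (e : Fin 3 → ℤ) : ContDiff ℝ 1 (densMode L e Φ.ψ) := by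
  have hG : ContDiff ℝ 1 fun q : Space × Config (m + 1) =>
      wave L (-e) q.1 * (fibrePsi L Φ.ψ (Function.update q.2 0 q.1) : ℂ) ^ 2 :=
    ((contDiff_wave L (-e)).comp contDiff_fst).mul
      ((Complex.ofRealCLM.contDiff.comp
        ((contDiff_fibrePsi' hL Φ hΦ).comp contDiff_update_zero')).pow 2)
  exact contDiff_one_parametric_setIntegral_of_isBounded (μ := volume) (isBounded_cell L)
    (measurableSet_cell L) hG

include hL hΦ in
/-- The beat amplitude is `C¹`. [folklore] -/
theorem contDiff_beatAmp (n e : Fin 3 → ℤ) : ContDiff ℝ 1 (beatAmp L n e Φ.ψ) :=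
  (contDiff_fibreBeta' hL Φ hΦ (n - e)).sub
    ((contDiff_fibreBeta' hL Φ hΦ n).mul (contDiff_densMode hL Φ hΦ e))

include hL hΦ in
/-- The bath factor is `C¹`. [folklore] -/
theorem contDiff_irBath (n e : Fin 3 → ℤ) : ContDiff ℝ 1 (irBath L n e Φ.ψ) :=
  (Complex.conjCLE.contDiff.comp (contDiff_beatAmp hL Φ hΦ n e)).mul
    (Complex.ofRealCLM.contDiff.comp (contDiff_fibreW' Φ))

include hL hΦ in
/-- The infrared test function is `C¹`. [folklore] -/
theorem contDiff_irTest (n e : Fin 3 → ℤ) : ContDiff ℝ 1 (irTest L n e Φ.ψ) :=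
  ((contDiff_wave L (-e)).comp (contDiff_apply ℝ Space (0 : Fin (m + 1)))).mul (contDiff_irBath hL Φ hΦ n e)

include hL hΦ in
/-- The beat amplitude is continuous. [folklore] -/
theorem continuous_beatAmp (n e : Fin 3 → ℤ) : Continuous (beatAmp L n e Φ.ψ) :=
  (contDiff_beatAmp hL Φ hΦ n e).continuous

include hL hΦ in
/-- The infrared test function is continuous. [folklore] -/
theorem continuous_irTest (n e : Fin 3 → ℤ) : Continuous (irTest L n e Φ.ψ) :=
  (contDiff_irTest hL Φ hΦ n e).continuous

include hL hΦ in
/-- The crux's charge is continuous for a zero-free state. [folklore] -/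
theorem continuous_fibreCharge (n : Fin 3 → ℤ) : Continuous (fibreCharge L n Φ.ψ) := by
  have hψ : Continuous fun X => (fibrePsi L Φ.ψ X : ℂ) :=
    Complex.continuous_ofReal.comp (continuous_fibrePsi' hL Φ hΦ)
  have hβ : Continuous (fibreBeta L n Φ.ψ) := continuous_fibreBeta' hL Φ hΦ n
  unfold fibreCharge
  exact continuous_const.mul ((((contDiff_wave L n).continuous.comp (continuous_apply 0)).mul hψ).sub
    (hβ.mul (hψ.pow 2)))

/-! #### The fibre gradient of the test function -/

include hL hΦ in
/-- **`∂_{x_{0,l}} η_e = −ik_{e,l} η_e`** (`A_e`, `W` are fibre constants). [folklore] -/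
theorem fderiv_irTest (n e : Fin 3 → ℤ) (X : Config (m + 1)) (l : Fin 3) :
    fderiv ℝ (irTest L n e Φ.ψ) X (Pi.single 0 (EuclideanSpace.single l 1)) =
      (2 * Real.pi * Complex.I * ((-e) l) / L) * irTest L n e Φ.ψ X := by
  have hF : DifferentiableAt ℝ (fun Y : Config (m + 1) => wave L (-e) (Y 0)) X :=
    differentiable_wave_comp_zero L (-e) X
  have hG : DifferentiableAt ℝ (irBath L n e Φ.ψ) X :=
    ((contDiff_irBath hL Φ hΦ n e).differentiable one_ne_zero) X
  have h := fderiv_mul hF hG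
  have hprod : irTest L n e Φ.ψ = (fun Y : Config (m + 1) => wave L (-e) (Y 0)) * irBath L n e Φ.ψ := rfl
  rw [hprod, h]
  simp only [_root_.add_apply, _root_.smul_apply,
    fderiv_single_zero_of_update_invariant (irBath_update Φ n e) hG,
    fderiv_wave_comp_zero, smul_eq_mul, Pi.mul_apply]
  ring

include hL hΦ in
/-- **`Σ_l |∂_{x_{0,l}} η_e|² = |k_e|² |A_e|² W²`.** [folklore] -/
theorem sum_norm_sq_fderiv_irTest (n e : Fin 3 → ℤ) (X : Config (m + 1)) :
    ∑ l : Fin 3, ‖fderiv ℝ (irTest L n e Φ.ψ) X (Pi.single 0 (EuclideanSpace.single l 1))‖ ^ 2 =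
      ksqOf L e * ‖beatAmp L n e Φ.ψ X‖ ^ 2 * fibreW L Φ.ψ X ^ 2 := by
  have hW : 0 ≤ fibreW L Φ.ψ X := fibreW_nonneg' Φ X
  have hη : ‖irTest L n e Φ.ψ X‖ = ‖beatAmp L n e Φ.ψ X‖ * fibreW L Φ.ψ X := by
    rw [irTest, irBath, norm_mul, norm_mul, norm_wave, one_mul, Complex.norm_conj, Complex.norm_real,
      Real.norm_of_nonneg hW]
  have hc : ∀ l : Fin 3, ‖(2 * Real.pi * Complex.I * ((-e) l) / L : ℂ)‖ ^ 2 =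
      (2 * Real.pi / L) ^ 2 * (e l : ℝ) ^ 2 := by
    intro l
    rw [show (2 * Real.pi * Complex.I * ((-e) l) / L : ℂ) =
        ((2 * Real.pi * (((-e) l : ℤ) : ℝ) / L : ℝ) : ℂ) * Complex.I by push_cast; ring,
      norm_mul, Complex.norm_I, mul_one, Complex.norm_real, Real.norm_eq_abs, sq_abs, Pi.neg_apply]
    push_cast
    ring
  simp_rw [fderiv_irTest hL Φ hΦ, norm_mul, mul_pow, hc, hη]
  rw [← Finset.sum_mul, ← Finset.mul_sum, ksqOf]
  ring

end Regularity

/-! ### The pairing and the dual energy of the test function -/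

section Integrals

variable (hL : 0 < L) (n e : Fin 3 → ℤ) (Φ : PeriodicTrialState (m + 1) L) (hΦ : ∀ X, Φ.ψ X ≠ 0)


/-- `S_e = ∫_{cell^N} |A_e|² W dX` (`= L³ E_W|A_e|²`). [folklore] -/
def beatMass (L : ℝ) (n e : Fin 3 → ℤ) (φ : Config (m + 1) → ℂ) : ℝ :=
  ∫ X in cellN (m + 1) L, ‖beatAmp L n e φ X‖ ^ 2 * fibreW L φ X

/-- `S_e ≥ 0`. [folklore] -/
theorem beatMass_nonneg : 0 ≤ beatMass L n e Φ.ψ :=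
  setIntegral_nonneg (measurableSet_cellN _ _) fun X _ =>
    mul_nonneg (sq_nonneg _) (fibreW_nonneg' Φ X)

include hL hΦ in
/-- **The charge pairs with the test function fibre by fibre to `L^{-3/2}|A_e|²W`:**
`∫_cell q(X[0↦y]) η_e(X[0↦y]) dy = L^{-3/2} |A_e(X̂)|² W(X̂)`. [folklore] -/
theorem integral_cell_fibreCharge_mul_irTest (X : Config (m + 1)) :
    ∫ y in cell L, fibreCharge L n Φ.ψ (Function.update X 0 y) * irTest L n e Φ.ψ (Function.update X 0 y) =
      ((Real.sqrt (L ^ 3))⁻¹ : ℂ) * ((‖beatAmp L n e Φ.ψ X‖ ^ 2 * fibreW L Φ.ψ X : ℝ) : ℂ) := by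
  have hψc : Continuous fun y : Space => (fibrePsi L Φ.ψ (Function.update X 0 y) : ℂ) :=
    Complex.continuous_ofReal.comp ((continuous_fibrePsi' hL Φ hΦ).comp
      (continuous_const.update 0 continuous_id))
  set A : ℂ := beatAmp L n e Φ.ψ X with hA
  set W : ℝ := fibreW L Φ.ψ X with hW
  set β : ℂ := fibreBeta L n Φ.ψ X with hβ
  set c : ℂ := ((Real.sqrt (L ^ 3))⁻¹ : ℂ) with hc
  -- the integrand, fibre constants pulled out
  have hpt : ∀ y : Space,
      fibreCharge L n Φ.ψ (Function.update X 0 y) * irTest L n e Φ.ψ (Function.update X 0 y) =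
        c * (conj A * (W : ℂ)) *
          (wave L (n - e) y * (fibrePsi L Φ.ψ (Function.update X 0 y) : ℂ) -
            β * (wave L (-e) y * (fibrePsi L Φ.ψ (Function.update X 0 y) : ℂ) ^ 2)) := by
    intro y
    rw [fibreCharge, irTest, irBath, beatAmp_update, fibreW_update', fibreBeta_update',
      Function.update_self, ← hA, ← hW, ← hβ, ← hc, wave_sub L n e y]
    ring
  simp_rw [hpt]
  have hi1 : IntegrableOn (fun y => wave L (n - e) y * (fibrePsi L Φ.ψ (Function.update X 0 y) : ℂ))
      (cell L) volume := integrableOn_cell (((contDiff_wave L (n - e)).continuous).mul hψc)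
  have hi2 : IntegrableOn
      (fun y => β * (wave L (-e) y * (fibrePsi L Φ.ψ (Function.update X 0 y) : ℂ) ^ 2))
      (cell L) volume :=
    integrableOn_cell (continuous_const.mul (((contDiff_wave L (-e)).continuous).mul (hψc.pow 2)))
  rw [integral_const_mul, integral_sub hi1 hi2, integral_const_mul]
  have h1 : ∫ y in cell L, wave L (n - e) y * (fibrePsi L Φ.ψ (Function.update X 0 y) : ℂ) =
      fibreBeta L (n - e) Φ.ψ X := rfl
  have h2 : ∫ y in cell L, wave L (-e) y * (fibrePsi L Φ.ψ (Function.update X 0 y) : ℂ) ^ 2 =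
      densMode L e Φ.ψ X := rfl
  rw [h1, h2, show fibreBeta L (n - e) Φ.ψ X - β * densMode L e Φ.ψ X = A by rw [hA, hβ, beatAmp],
    mul_assoc, mul_assoc, show conj A * ((W : ℂ) * A) = ((‖A‖ ^ 2 * W : ℝ) : ℂ) by
      rw [mul_left_comm, Complex.conj_mul']; push_cast; ring]

include hL hΦ in
/-- **The pairing**: `∫_{cell^N} q η_e = L^{-9/2} S_e`. [folklore] -/
theorem integral_fibreCharge_mul_irTest :
    ∫ X in cellN (m + 1) L, fibreCharge L n Φ.ψ X * irTest L n e Φ.ψ X =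
      (((L ^ 3)⁻¹ * (Real.sqrt (L ^ 3))⁻¹ * beatMass L n e Φ.ψ : ℝ) : ℂ) := by
  have hcont : Continuous fun X => fibreCharge L n Φ.ψ X * irTest L n e Φ.ψ X :=
    (continuous_fibreCharge hL Φ hΦ n).mul (continuous_irTest hL Φ hΦ n e)
  have h := Literature.MathematicalPhysics.QuantumManyBody.JelliumBoseGas.integral_cellN_integral_cell_update
    (0 : Fin (m + 1)) (integrableOn_cellN hcont L)
  simp_rw [integral_cell_fibreCharge_mul_irTest hL n e Φ hΦ] at h
  rw [integral_const_mul, integral_complex_ofReal] at h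
  have hL3 : (L ^ 3 : ℝ) ≠ 0 := by positivity
  rw [Complex.real_smul] at h
  have e1 : ∫ X in cellN (m + 1) L, fibreCharge L n Φ.ψ X * irTest L n e Φ.ψ X =
      ((L ^ 3 : ℝ) : ℂ)⁻¹ * (((Real.sqrt (L ^ 3))⁻¹ : ℂ) *
        ((∫ X in cellN (m + 1) L, ‖beatAmp L n e Φ.ψ X‖ ^ 2 * fibreW L Φ.ψ X : ℝ) : ℂ)) := by
    rw [h, ← mul_assoc, inv_mul_cancel₀ (by exact_mod_cast hL3), one_mul]
  rw [e1, beatMass]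
  push_cast
  ring

include hL hΦ in
/-- **The dual energy**: `∫_{cell^N} Σ_l|∂_{0,l}η_e|² ψ²/W = L⁻³ |k_e|² S_e`. [folklore] -/
theorem lintegral_dual_irTest :
    ∫⁻ X in cellN (m + 1) L, ENNReal.ofReal
        ((∑ l : Fin 3, ‖fderiv ℝ (irTest L n e Φ.ψ) X (Pi.single 0 (EuclideanSpace.single l (1 : ℝ)))‖ ^ 2) /
          (fibreW L Φ.ψ X / fibrePsi L Φ.ψ X ^ 2)) =
      ENNReal.ofReal ((L ^ 3)⁻¹ * ksqOf L e * beatMass L n e Φ.ψ) := by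
  have hWpos : ∀ X, 0 < fibreW L Φ.ψ X := fun X => fibreW_pos' hL Φ hΦ X
  have hψpos : ∀ X, 0 < fibrePsi L Φ.ψ X := fun X => fibrePsi_pos' hL Φ hΦ X
  -- pointwise form of the integrand
  have hpt : ∀ X, ENNReal.ofReal
      ((∑ l : Fin 3, ‖fderiv ℝ (irTest L n e Φ.ψ) X (Pi.single 0 (EuclideanSpace.single l (1 : ℝ)))‖ ^ 2) /
        (fibreW L Φ.ψ X / fibrePsi L Φ.ψ X ^ 2)) =
      ENNReal.ofReal (ksqOf L e * ‖beatAmp L n e Φ.ψ X‖ ^ 2 * fibreW L Φ.ψ X * fibrePsi L Φ.ψ X ^ 2) := by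
    intro X
    rw [sum_norm_sq_fderiv_irTest hL Φ hΦ]
    congr 1
    field_simp [(hWpos X).ne', (hψpos X).ne']
  simp_rw [hpt]
  -- measurability
  have hAc : Continuous (beatAmp L n e Φ.ψ) := continuous_beatAmp hL Φ hΦ n e
  have hWc : Continuous (fibreW L Φ.ψ) := continuous_fibreW' Φ
  have hψc : Continuous (fibrePsi L Φ.ψ) := continuous_fibrePsi' hL Φ hΦ
  have hmeas : Measurable fun X => ENNReal.ofReal
      (ksqOf L e * ‖beatAmp L n e Φ.ψ X‖ ^ 2 * fibreW L Φ.ψ X * fibrePsi L Φ.ψ X ^ 2) :=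
    (((continuous_const.mul ((hAc.norm).pow 2)).mul hWc).mul (hψc.pow 2)).measurable.ennreal_ofReal
  rw [lintegral_cellN_eq_fibre_average' hL hmeas]
  -- the inner fibre integral: `∫_cell ψ² = 1`
  have hinner : ∀ X, ∫⁻ y in cell L, ENNReal.ofReal
      (ksqOf L e * ‖beatAmp L n e Φ.ψ (Function.update X 0 y)‖ ^ 2 * fibreW L Φ.ψ (Function.update X 0 y) *
        fibrePsi L Φ.ψ (Function.update X 0 y) ^ 2) =
      ENNReal.ofReal (ksqOf L e * ‖beatAmp L n e Φ.ψ X‖ ^ 2 * fibreW L Φ.ψ X) := by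
    intro X
    simp_rw [beatAmp_update, fibreW_update']
    have hnn : 0 ≤ ksqOf L e * ‖beatAmp L n e Φ.ψ X‖ ^ 2 * fibreW L Φ.ψ X :=
      mul_nonneg (mul_nonneg (ksqOf_nonneg L e) (sq_nonneg _)) (hWpos X).le
    simp_rw [ENNReal.ofReal_mul hnn]
    rw [lintegral_const_mul' _ _ ENNReal.ofReal_ne_top]
    have hsl : Continuous fun y : Space => fibrePsi L Φ.ψ (Function.update X 0 y) ^ 2 :=
      (hψc.comp (continuous_const.update 0 continuous_id)).pow 2
    rw [← ofReal_integral_eq_lintegral_ofReal (integrableOn_cell hsl)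
      (Filter.Eventually.of_forall fun y => sq_nonneg _)]
    rw [show (∫ y in cell L, fibrePsi L Φ.ψ (Function.update X 0 y) ^ 2) = 1 from
      integral_fibrePsi_sq' hL Φ hΦ X, ENNReal.ofReal_one, mul_one]
  simp_rw [hinner]
  have hnn' : ∀ X, 0 ≤ ksqOf L e * ‖beatAmp L n e Φ.ψ X‖ ^ 2 * fibreW L Φ.ψ X := fun X =>
    mul_nonneg (mul_nonneg (ksqOf_nonneg L e) (sq_nonneg _)) (hWpos X).le
  have hint : IntegrableOn (fun X => ksqOf L e * ‖beatAmp L n e Φ.ψ X‖ ^ 2 * fibreW L Φ.ψ X)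
      (cellN (m + 1) L) volume :=
    integrableOn_cellN ((continuous_const.mul ((hAc.norm).pow 2)).mul hWc) L
  rw [← ofReal_integral_eq_lintegral_ofReal hint (Filter.Eventually.of_forall hnn')]
  have hL3 : (0 : ℝ) < L ^ 3 := by positivity
  rw [ENNReal.ofReal_pow hL.le, ← ENNReal.ofReal_pow hL.le, ← ENNReal.ofReal_inv_of_pos hL3,
    ← ENNReal.ofReal_mul (inv_nonneg.2 hL3.le)]
  congr 1
  simp_rw [mul_assoc]
  rw [integral_const_mul, beatMass]

end Integrals


/-! ### Infrared necessity -/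

section Main

variable {n e : Fin 3 → ℤ}


/-- **INFRARED NECESSITY (master inequality).** For a zero-free `C¹` periodic state `Φ` on the
torus `(ℝ³/Lℤ³)^{N}` and ANY flow `J` in the `x₀`-fibre with weak divergence the crux's charge
`q = L^{-3/2}(e_n(x₀)ψ − βψ²)` and Thomson cost `∫_{cell^N}|J|²W/ψ² ≤ K`: for every lattice vector
`e`, `∫_{cell^N} |A_e|² W dX ≤ K L⁶ |k_e|²`, `A_e = ∫e_{n−e}ψ − β∫e_{−e}ψ²`, `k_e = 2πe/L`.
(No minimality and no potential enter: it is Cauchy–Schwarz through the pairing with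
`η_e = e_{−e}(x₀)conj(A_e)W`.) [folklore] -/
theorem infraredNecessity (hL : 0 < L) (n e : Fin 3 → ℤ) (Φ : PeriodicTrialState (m + 1) L)
    (hΦ : ∀ X, Φ.ψ X ≠ 0) {J : Config (m + 1) → Fin 3 → ℂ}
    (hJ : IsFibreFlow m L (fibreCharge L n Φ.ψ) J) {K : ℝ} (hK : 0 ≤ K)
    (hcost : fibreCost L Φ.ψ J ≤ ENNReal.ofReal K) :
    beatMass L n e Φ.ψ ≤ K * L ^ 6 * ksqOf L e := by
  have hWpos : ∀ X, 0 < fibreW L Φ.ψ X := fun X => fibreW_pos' hL Φ hΦ X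
  have hψpos : ∀ X, 0 < fibrePsi L Φ.ψ X := fun X => fibrePsi_pos' hL Φ hΦ X
  set S := beatMass L n e Φ.ψ with hS
  have hS0 : 0 ≤ S := beatMass_nonneg n e Φ
  have hL3 : (0 : ℝ) < L ^ 3 := by positivity
  have hk0 := ksqOf_nonneg L e
  -- the weight `w = W/ψ²`
  have hw : ∀ X, 0 < fibreW L Φ.ψ X / fibrePsi L Φ.ψ X ^ 2 := fun X =>
    div_pos (hWpos X) (pow_pos (hψpos X) 2)
  have hwm : Measurable fun X => fibreW L Φ.ψ X / fibrePsi L Φ.ψ X ^ 2 :=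
    (measurable_fibreW' Φ).div ((measurable_fibrePsi' hL Φ hΦ).pow_const 2)
  have hcost' : ∫⁻ X in cellN (m + 1) L, ENNReal.ofReal
      ((∑ l : Fin 3, ‖J X l‖ ^ 2) * (fibreW L Φ.ψ X / fibrePsi L Φ.ψ X ^ 2)) ≤ ENNReal.ofReal K := by
    simpa only [fibreCost, mul_div_assoc] using hcost
  have hD : 0 ≤ (L ^ 3)⁻¹ * ksqOf L e * S := by positivity
  have hdual := (lintegral_dual_irTest hL n e Φ hΦ).le
  have key := norm_pairing_sq_le hJ (contDiff_irTest hL Φ hΦ n e) (irTest_periodic hL Φ n e) hw hwm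
    hK hD hcost' hdual
  rw [integral_fibreCharge_mul_irTest hL n e Φ hΦ, Complex.norm_real, Real.norm_eq_abs, sq_abs] at key
  -- `key : ((L³)⁻¹ (√L³)⁻¹ S)² ≤ K ((L³)⁻¹ |k|² S)`; clear denominators
  have hsq : (Real.sqrt (L ^ 3))⁻¹ ^ 2 = (L ^ 3)⁻¹ := by
    rw [inv_pow, Real.sq_sqrt hL3.le]
  have key' : S * S ≤ (K * L ^ 6 * ksqOf L e) * S := by
    have h1 : ((L ^ 3)⁻¹ * (Real.sqrt (L ^ 3))⁻¹ * S) ^ 2 = (L ^ 3)⁻¹ ^ 3 * (S * S) := by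
      rw [mul_pow, mul_pow, hsq]; ring
    rw [h1] at key
    have h2 : K * ((L ^ 3)⁻¹ * ksqOf L e * S) = (L ^ 3)⁻¹ ^ 3 * ((K * L ^ 6 * ksqOf L e) * S) := by
      field_simp
    rw [h2] at key
    exact le_of_mul_le_mul_left key (by positivity)
  rcases hS0.lt_or_eq with hpos | hzero
  · exact le_of_mul_le_mul_right key' hpos
  · rw [← hzero]; positivity

/-- **`∫_{cell^N} W |∫_cell e_p ψ|² dX = L⁶ n_{−p}(|Φ|)/N`**: the bath expectation of a fibre
Fourier mode of the conditional amplitude is an occupation number of `X ↦ |Φ X|` (the lead's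
`lintegral_fibreW_mul_norm_sq_cellFourierCoeff`, renormalised: `∫e_pψ = L³ĉ_{−p}(ψ)`). [folklore] -/
theorem lintegral_fibreW_mul_norm_sq_fibreBeta (hL : 0 < L) (p : Fin 3 → ℤ)
    (Φ : PeriodicTrialState (m + 1) L) (hΦ : ∀ X, Φ.ψ X ≠ 0) :
    ∫⁻ X in cellN (m + 1) L, ENNReal.ofReal (fibreW L Φ.ψ X * ‖fibreBeta L p Φ.ψ X‖ ^ 2) =
      ENNReal.ofReal (L ^ 6) *
        (cellOccupation (m + 1) L (planeWaveMode L (-p)) (fun X => (‖Φ.ψ X‖ : ℂ)) / (m + 1 : ℝ≥0∞)) := by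
  rw [← lintegral_fibreW_mul_norm_sq_cellFourierCoeff' hL Φ hΦ (-p),
    ← lintegral_const_mul' _ _ ENNReal.ofReal_ne_top]
  refine setLIntegral_congr_fun (measurableSet_cellN _ _) fun X _ => ?_
  rw [fibreBeta_eq_cellFourierCoeff' hL Φ p X, norm_mul, Complex.norm_real,
    Real.norm_of_nonneg (by positivity), mul_pow, ← ENNReal.ofReal_mul (by positivity)]
  congr 1
  ring

/-- `|∫_cell e_{−e} ψ²| ≤ ∫_cell ψ² = 1`. [folklore] -/
theorem norm_densMode_le_one (hL : 0 < L) (e : Fin 3 → ℤ) (Φ : PeriodicTrialState (m + 1) L)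
    (hΦ : ∀ X, Φ.ψ X ≠ 0) (X : Config (m + 1)) : ‖densMode L e Φ.ψ X‖ ≤ 1 := by
  unfold densMode
  refine (norm_integral_le_integral_norm _).trans ?_
  have h : ∀ y, ‖wave L (-e) y * (fibrePsi L Φ.ψ (Function.update X 0 y) : ℂ) ^ 2‖ =
      fibrePsi L Φ.ψ (Function.update X 0 y) ^ 2 := by
    intro y
    rw [norm_mul, norm_wave, one_mul, norm_pow, Complex.norm_real, Real.norm_eq_abs, sq_abs]
  simp_rw [h]
  exact (integral_fibrePsi_sq' hL Φ hΦ X).le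

/-- **INFRARED NECESSITY in occupation numbers.** Under the hypotheses of `infraredNecessity`:
`n_{e−n}(|Φ|) ≤ 2 n_{−n}(|Φ|) + 2 N K |k_e|²` (occupations `cellOccupation` of the plane waves in
`X ↦ |Φ X|`; `|A_e|² ≥ |∫e_{n−e}ψ|²/2 − |β|²` since `|∫e_{−e}ψ²| ≤ 1`). [folklore] -/
theorem infraredNecessity_occupation (hL : 0 < L) (n e : Fin 3 → ℤ) (Φ : PeriodicTrialState (m + 1) L)
    (hΦ : ∀ X, Φ.ψ X ≠ 0) {J : Config (m + 1) → Fin 3 → ℂ}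
    (hJ : IsFibreFlow m L (fibreCharge L n Φ.ψ) J) {K : ℝ} (hK : 0 ≤ K)
    (hcost : fibreCost L Φ.ψ J ≤ ENNReal.ofReal K) :
    cellOccupation (m + 1) L (planeWaveMode L (e - n)) (fun X => (‖Φ.ψ X‖ : ℂ)) ≤
      2 * cellOccupation (m + 1) L (planeWaveMode L (-n)) (fun X => (‖Φ.ψ X‖ : ℂ)) +
        ENNReal.ofReal (2 * (m + 1 : ℕ) * K * ksqOf L e) := by
  have hmain := infraredNecessity hL n e Φ hΦ hJ hK hcost
  have hWnn : ∀ X, 0 ≤ fibreW L Φ.ψ X := fun X => fibreW_nonneg' Φ X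
  -- pointwise: `W|β_{n-e}|² ≤ 2W|A_e|² + 2W|β_n|²`
  have hpt : ∀ X, fibreW L Φ.ψ X * ‖fibreBeta L (n - e) Φ.ψ X‖ ^ 2 ≤
      2 * (‖beatAmp L n e Φ.ψ X‖ ^ 2 * fibreW L Φ.ψ X) + 2 * (fibreW L Φ.ψ X * ‖fibreBeta L n Φ.ψ X‖ ^ 2) := by
    intro X
    have hA : ‖fibreBeta L (n - e) Φ.ψ X‖ ≤ ‖beatAmp L n e Φ.ψ X‖ + ‖fibreBeta L n Φ.ψ X‖ := by
      have h1 : fibreBeta L (n - e) Φ.ψ X = beatAmp L n e Φ.ψ X + fibreBeta L n Φ.ψ X * densMode L e Φ.ψ X := by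
        rw [beatAmp]; ring
      rw [h1]
      calc ‖beatAmp L n e Φ.ψ X + fibreBeta L n Φ.ψ X * densMode L e Φ.ψ X‖
          ≤ ‖beatAmp L n e Φ.ψ X‖ + ‖fibreBeta L n Φ.ψ X * densMode L e Φ.ψ X‖ := norm_add_le _ _
        _ ≤ ‖beatAmp L n e Φ.ψ X‖ + ‖fibreBeta L n Φ.ψ X‖ := by
          gcongr
          rw [norm_mul]
          exact mul_le_of_le_one_right (norm_nonneg _) (norm_densMode_le_one hL e Φ hΦ X)
    have h2 : ‖fibreBeta L (n - e) Φ.ψ X‖ ^ 2 ≤ 2 * ‖beatAmp L n e Φ.ψ X‖ ^ 2 + 2 * ‖fibreBeta L n Φ.ψ X‖ ^ 2 := by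
      nlinarith [hA, norm_nonneg (fibreBeta L (n - e) Φ.ψ X), norm_nonneg (beatAmp L n e Φ.ψ X),
        norm_nonneg (fibreBeta L n Φ.ψ X), sq_nonneg (‖beatAmp L n e Φ.ψ X‖ - ‖fibreBeta L n Φ.ψ X‖)]
    nlinarith [hWnn X, h2]
  -- continuity / measurability
  have hAc : Continuous (beatAmp L n e Φ.ψ) := continuous_beatAmp hL Φ hΦ n e
  have hWc : Continuous (fibreW L Φ.ψ) := continuous_fibreW' Φ
  have hβc : Continuous (fibreBeta L n Φ.ψ) := continuous_fibreBeta' hL Φ hΦ n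
  set fA : Config (m + 1) → ℝ≥0∞ := fun X => ENNReal.ofReal (‖beatAmp L n e Φ.ψ X‖ ^ 2 * fibreW L Φ.ψ X)
    with hfA
  set fB : Config (m + 1) → ℝ≥0∞ := fun X => ENNReal.ofReal (fibreW L Φ.ψ X * ‖fibreBeta L n Φ.ψ X‖ ^ 2)
    with hfB
  have hm1 : Measurable fA := (((hAc.norm).pow 2).mul hWc).measurable.ennreal_ofReal
  have hm2 : Measurable fB := (hWc.mul ((hβc.norm).pow 2)).measurable.ennreal_ofReal
  -- integrate the pointwise bound
  have hI : ∫⁻ X in cellN (m + 1) L, ENNReal.ofReal (fibreW L Φ.ψ X * ‖fibreBeta L (n - e) Φ.ψ X‖ ^ 2) ≤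
      2 * (∫⁻ X in cellN (m + 1) L, fA X) + 2 * (∫⁻ X in cellN (m + 1) L, fB X) := by
    have hadd : ∫⁻ X in cellN (m + 1) L, (2 * fA X + 2 * fB X) =
        (∫⁻ X in cellN (m + 1) L, 2 * fA X) + ∫⁻ X in cellN (m + 1) L, 2 * fB X :=
      lintegral_add_left (hm1.const_mul 2) _
    have h2A : ∫⁻ X in cellN (m + 1) L, 2 * fA X = 2 * ∫⁻ X in cellN (m + 1) L, fA X :=
      lintegral_const_mul 2 hm1
    have h2B : ∫⁻ X in cellN (m + 1) L, 2 * fB X = 2 * ∫⁻ X in cellN (m + 1) L, fB X :=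
      lintegral_const_mul 2 hm2
    rw [← h2A, ← h2B, ← hadd]
    refine lintegral_mono fun X => ?_
    refine (ENNReal.ofReal_le_ofReal (hpt X)).trans ?_
    rw [ENNReal.ofReal_add (mul_nonneg zero_le_two (mul_nonneg (sq_nonneg _) (hWnn X)))
      (mul_nonneg zero_le_two (mul_nonneg (hWnn X) (sq_nonneg _))), ENNReal.ofReal_mul zero_le_two,
      ENNReal.ofReal_mul zero_le_two, ENNReal.ofReal_ofNat]
  -- the beat integral is bounded by the master inequality
  have hSle : ∫⁻ X in cellN (m + 1) L, fA X ≤ ENNReal.ofReal (K * L ^ 6 * ksqOf L e) := by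
    have hint : IntegrableOn (fun X => ‖beatAmp L n e Φ.ψ X‖ ^ 2 * fibreW L Φ.ψ X) (cellN (m + 1) L) volume :=
      integrableOn_cellN (((hAc.norm).pow 2).mul hWc) L
    rw [hfA, ← ofReal_integral_eq_lintegral_ofReal hint
      (Filter.Eventually.of_forall fun X => mul_nonneg (sq_nonneg _) (hWnn X))]
    exact ENNReal.ofReal_le_ofReal hmain
  -- the two `β` integrals are occupations
  rw [hfB, lintegral_fibreW_mul_norm_sq_fibreBeta hL (n - e) Φ hΦ, neg_sub,
    lintegral_fibreW_mul_norm_sq_fibreBeta hL n Φ hΦ] at hI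
  -- bookkeeping in `ℝ≥0∞`
  set a := cellOccupation (m + 1) L (planeWaveMode L (e - n)) (fun X => (‖Φ.ψ X‖ : ℂ)) with ha
  set b := cellOccupation (m + 1) L (planeWaveMode L (-n)) (fun X => (‖Φ.ψ X‖ : ℂ)) with hb
  set c6 := ENNReal.ofReal (L ^ 6) with hc6
  set Nn : ℝ≥0∞ := (m + 1 : ℝ≥0∞) with hNn
  have hL6 : (0 : ℝ) < L ^ 6 := by positivity
  have hc6_0 : c6 ≠ 0 := by rw [hc6, Ne, ENNReal.ofReal_eq_zero, not_le]; exact hL6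
  have hc6_top : c6 ≠ ⊤ := ENNReal.ofReal_ne_top
  have hN0 : Nn ≠ 0 := by simp [hNn]
  have hNtop : Nn ≠ ⊤ := by simp [hNn]
  have hKL6 : ENNReal.ofReal (K * L ^ 6 * ksqOf L e) = c6 * ENNReal.ofReal (K * ksqOf L e) := by
    rw [hc6, ← ENNReal.ofReal_mul hL6.le]; congr 1; ring
  have hI2 : c6 * (a / Nn) ≤ 2 * ENNReal.ofReal (K * L ^ 6 * ksqOf L e) + 2 * (c6 * (b / Nn)) :=
    hI.trans (add_le_add (mul_le_mul' le_rfl hSle) le_rfl)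
  have hI3 : c6 * (a / Nn) ≤ c6 * (2 * ENNReal.ofReal (K * ksqOf L e) + 2 * (b / Nn)) := by
    calc c6 * (a / Nn) ≤ 2 * ENNReal.ofReal (K * L ^ 6 * ksqOf L e) + 2 * (c6 * (b / Nn)) := hI2
      _ = 2 * (c6 * ENNReal.ofReal (K * ksqOf L e)) + 2 * (c6 * (b / Nn)) := by rw [hKL6]
      _ = c6 * (2 * ENNReal.ofReal (K * ksqOf L e) + 2 * (b / Nn)) := by ring
  have hI4 : a / Nn ≤ 2 * ENNReal.ofReal (K * ksqOf L e) + 2 * (b / Nn) :=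
    (ENNReal.mul_le_mul_iff_right hc6_0 hc6_top).1 hI3
  have hI5 : a ≤ (2 * ENNReal.ofReal (K * ksqOf L e) + 2 * (b / Nn)) * Nn := (ENNReal.div_le_iff hN0 hNtop).1 hI4
  calc a ≤ (2 * ENNReal.ofReal (K * ksqOf L e) + 2 * (b / Nn)) * Nn := hI5
    _ = 2 * b + ENNReal.ofReal (2 * (m + 1 : ℕ) * K * ksqOf L e) := by
        rw [add_mul, mul_assoc 2 (b / Nn), ENNReal.div_mul_cancel hN0 hNtop, add_comm]
        congr 1
        conv_rhs => rw [show (2 * ((m + 1 : ℕ) : ℝ) * K * ksqOf L e) =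
            ((m + 1 : ℕ) : ℝ) * (2 * (K * ksqOf L e)) by ring, ENNReal.ofReal_mul (Nat.cast_nonneg _),
          ENNReal.ofReal_natCast, ENNReal.ofReal_mul zero_le_two, ENNReal.ofReal_ofNat]
        rw [hNn]
        push_cast
        ring

end Main

/-! ### Consequence for the crux: the infrared bound it forces on exact ground states -/

section Crux

open Summit.AtomisticToContinuum.BoseEinsteinCondensation.Theorems.GaussianDominationCan.Negative (InWindow)

/-- **The crux's conclusion at one datum forces the scale-free beat-mode bound**
`n_{e−n}(|Φ|) ≤ 2 n_{−n}(|Φ|) + 8π² C N |e|₂²/‖n‖²` for every lattice vector `e`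
(`K = C L²/‖n‖²`, `2NK|k_e|² = 8π²CN|e|²/‖n‖²`: the side `L` cancels). [folklore] -/
theorem fibreBoundAt_occupation (hL : 0 < L) {n : Fin 3 → ℤ} (Φ : PeriodicTrialState (m + 1) L)
    (hΦ : ∀ X, Φ.ψ X ≠ 0) {C : ℝ} (hC : 0 ≤ C) (h : FibreBoundAt L n Φ C) (e : Fin 3 → ℤ) :
    cellOccupation (m + 1) L (planeWaveMode L (e - n)) (fun X => (‖Φ.ψ X‖ : ℂ)) ≤
      2 * cellOccupation (m + 1) L (planeWaveMode L (-n)) (fun X => (‖Φ.ψ X‖ : ℂ)) +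
        ENNReal.ofReal (8 * Real.pi ^ 2 * C * (m + 1 : ℕ) * (∑ j, (e j : ℝ) ^ 2) /
          ‖(fun j => (n j : ℝ))‖ ^ 2) := by
  obtain ⟨J, hJ, hcost⟩ := h
  have hK : 0 ≤ C * L ^ 2 / ‖(fun j => (n j : ℝ))‖ ^ 2 := by positivity
  have key := infraredNecessity_occupation hL n e Φ hΦ hJ hK hcost
  have heq : 2 * ((m + 1 : ℕ) : ℝ) * (C * L ^ 2 / ‖(fun j => (n j : ℝ))‖ ^ 2) * ksqOf L e =
      8 * Real.pi ^ 2 * C * (m + 1 : ℕ) * (∑ j, (e j : ℝ) ^ 2) / ‖(fun j => (n j : ℝ))‖ ^ 2 := by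
    unfold ksqOf
    field_simp
    ring
  rwa [heq] at key

/-- **INFRARED BOUND** — the thermodynamic-limit content of the crux, isolated as a statement about
exact zero-free ground states in the crux's own window: for every bounded admissible `v` and `M`
there are `ρ₀, C, N₀` such that every exact datum of the crux satisfies, for every lattice vector `e`,
`n_{e−n}(|Φ|) ≤ 2 n_{−n}(|Φ|) + 8π² C N |e|₂²/‖n‖²` — single-mode occupation control on the lattice
neighbours of the source mode `−n`, relative to `n_{−n}`.  No energy method in print gives this at
the window top; Bogoliubov-type ground states satisfy it with room `≍ L`. [folklore] -/
def InfraredBound : Prop :=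
  ∀ v : ℝ → ℝ≥0∞, IsRepulsiveFiniteRange v → (∃ B : ℝ, ∀ r, v r ≤ ENNReal.ofReal B) →
    ∀ M : ℝ, 0 < M → ∃ ρ₀ C : ℝ, 0 < ρ₀ ∧ 0 < C ∧ ∃ N₀ : ℕ,
      ∀ m : ℕ, N₀ ≤ m + 1 → ∀ L : ℝ, 0 < L → ((m + 1 : ℕ) : ℝ) ≤ ρ₀ * L ^ 3 →
        ∀ n : Fin 3 → ℤ, n ≠ 0 → InWindow M m L n →
          ∀ Φ : PeriodicTrialState (m + 1) L,
            periodicEnergy v Φ = periodicGroundStateEnergy v (m + 1) L → (∀ X, Φ.ψ X ≠ 0) →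
              ∀ e : Fin 3 → ℤ,
                cellOccupation (m + 1) L (planeWaveMode L (e - n)) (fun X => (‖Φ.ψ X‖ : ℂ)) ≤
                  2 * cellOccupation (m + 1) L (planeWaveMode L (-n)) (fun X => (‖Φ.ψ X‖ : ℂ)) +
                    ENNReal.ofReal (8 * Real.pi ^ 2 * C * (m + 1 : ℕ) * (∑ j, (e j : ℝ) ^ 2) /
                      ‖(fun j => (n j : ℝ))‖ ^ 2)

/-- **`FibreConductance → InfraredBound`**: every proof of the crux proves the infrared bound on
exact ground states (same `ρ₀, C, N₀`); contrapositively, an admissible bounded `v` whose exact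
ground states violate `InfraredBound` refutes the crux — the template for any kill at `v ≠ 0`.
[folklore] -/
theorem fibreConductance_infrared
    (h : Summit.AtomisticToContinuum.BoseEinsteinCondensation.Theses.BECThomsonPrinciple.FibreConductance) :
    InfraredBound := by
  rw [fibreConductance_iff] at h
  intro v hv hB M hM
  obtain ⟨ρ₀, C, hρ, hC, N₀, hmain⟩ := h v hv hB M hM
  exact ⟨ρ₀, C, hρ, hC, N₀, fun m hm L hL hd n hn hw Φ hE hz e =>
    fibreBoundAt_occupation hL Φ hz hC.le (hmain m hm L hL hd n hn hw Φ hE hz) e⟩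

end Crux



end Infrared

end Summit.AtomisticToContinuum.BoseEinsteinCondensation.Cruxes.FibreConductance.Disproof

end
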